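import Mathlib.Topology.Algebra.Module.FiniteDimension
import Literature.NumberTheory.EllipticCurves.EichlerShimuraCongruenceHondaProofs
import Literature.NumberTheory.EllipticCurves.Sprung2012.HondaSystemSignedLayerDescent
import Literature.NumberTheory.EllipticCurves.SerreOpenImageOrdinaryInertiaProofs
import Literature.NumberTheory.LFunctions.WooleySimultaneousCongruences
import HarnessLib
/-!
# Honda systems at supersingular primes (Sprung 2012 Thm. 2.2 / Kobayashi 2003 §8), IV: Sprung's sequence `x_k` and the logarithm
# of Honda type `t² − a_p t + p`, its values, the integral isomorphism `F_ss ≅ Ê`, Sprung's tower points and their trace relations,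
# the logarithmic layer descent, generation in primal form, the `p`-adic model and the primal Honda data over `ℚ_[p]`
# (Sprung 2012 §§2, 7; Kobayashi 2003 Prop. 8.12)

**Sprung's logarithm of Honda type `t² − a_p t + p` and the tower points of Theorem 2.2** (F. Sprung, J. Number Theory 132 (2012)
§2 (Thm. 2.2, Cor. 2.10) and §7 (Lemmas 7.4–7.5) [Sprung2012]; S. Kobayashi, Invent. Math. 152 (2003) Prop. 8.12 [Kobayashi2003];
J. Silverman, AEC (2009) IV, VII [SilvermanAEC2009]): the Sprung sequence `x_k`, the logarithm `∑_k x_k((1+X)^{p^k} − 1)/…`, its values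
on the layers, the integral isomorphism `F_ss ≅ Ê`, the points `c_m` with `log c_m = ℓ_m`, the trace relations
`Tr_{m+1/m} c_{m+1} = a·c_m − c_{m−1}`, the logarithmic layer descent, generation in primal form, the `ℤ_p`-model with unit
discriminant and Hasse coefficient in `𝔪`, and the primal Honda data over `ℚ_[p]` for every embedding `ι : ℚ̄ → ℚ̄_p`.
RE-HOMED into `Literature/` by the Hodge foundations lane (`lit-hodgefound`, seat p20, generation 41): verbatim DECLARATION-LEVEL
ports, in dependency order, of the declarations of the modules `Summits/BirchSwinnertonDyer/{Rank1Residual/Additive, BirchSwinnertonDyer/Theorems}/PrintX8VSInputHondaSystemSprungLog, PrintX8VSInputHondaSystemSprungLogValues, PrintX8VSInputHondaSystemSprungHondaIso,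
PrintX8VSInputHondaSystemSprungTowerPoints, KobayashiLayerLogDescent, PrintX8VSInputHondaSystemSprungTowerGeneration, PrintX8VSInputHondaSystemSprungTowerRelations,
PrintX8VSInputHondaSystemLocalGeneration, PrintX8VSInputHondaSystemPadicModel, PrintX8VSInputHondaSystemPrimalPadic.lean`
(BSD cells `b2b-bsdres` / `bsd-inputs`, where they certify `p`-adic analysis of formal groups and of the cyclotomic tower at a
supersingular prime — unconditional facts about elliptic curves over `ℚ` and `ℚ_p`, independent of the Birch–Swinnerton-Dyer conjecture),
namespaces `Summit.BirchSwinnertonDyer.Rank1Residual.Additive` and `Summit.BirchSwinnertonDyer.BirchSwinnertonDyer.Theorems` BOTH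
re-rooted as `Literature.NumberTheory.EllipticCurves.Sprung2012.Honda` (sub-namespaces `BallEval`, `PadicCyclotomicTower`, `HondaFss`,
`SprungHonda`, `SignedEC`, … kept).  The declarations of the cone that are already in `Literature/` (Kobayashi's signed local
conditions `localFixedPointsOfEmb`, `localPairTraceOfEmb`, `towerSubgroup`, … of
`NumberTheory/EllipticCurves/Kobayashi2003/CyclotomicTowerSignedSelmer.lean`) are IMPORTED, not duplicated.  Definitions are ported with
their bodies (real `def`s: evaluation maps, ball points, logarithms, towers, transported points — no `Prop`-valued placeholder, no
named fact: D-0026 net debt 0 for this file); every declaration carries the citation of the printed step it formalises or serves;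
imports Mathlib/Literature only.  The Summits originals stay in place (transitional duplication; twins = same short names under the two
Summits namespaces).  Nothing here bears on the Birch–Swinnerton-Dyer conjecture or any summit statement.
Builds on files I–III of the series; consumed by file V (same directory).
-/

noncomputable section

open Literature.NumberTheory.EllipticCurves.Kobayashi2003

/-!
## Part 1 — port of `Summits/BirchSwinnertonDyer/BirchSwinnertonDyer/Theorems/PrintX8VSInputHondaSystemSprungLog.lean` (18 declarations kept)

# Sprung's supersingular logarithm of Honda type `p − a T + T²`:
# `log_{F_ss}(X) = ∑ₖ xₖ ((1+X)^{pᵏ} − 1)`, `p x_{k+2} = a x_{k+1} − x_k`, `x₀ = 1`, `p x₁ = a`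
#

(Port of the declarations listed in the Part header; the source module's docstring — cell bookkeeping of the BSD
printed-inputs programme — is abridged to its title here.)
-/

section Part1

open scoped _root_.Classical _root_.Topology
open _root_.Filter _root_.PowerSeries
namespace Literature.NumberTheory.EllipticCurves.Sprung2012.Honda
namespace SprungHonda
open Literature.RingTheory.FormalGroups Literature.NumberTheory.EllipticCurves.Sprung2012.Honda.HondaFss
variable {p : ℕ} [hp : Fact p.Prime]

/-! ## §1 The Sprung sequence `x_k`: growth `‖x_k‖ ≤ (√p)ᵏ` -/

/-- `1 ≤ √p` and `√p · √p = p`. [cite: Sprung2012, proof of Thm. 2.2 (p. 1487)] -/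
theorem one_le_sqrt_p : (1 : ℝ) ≤ Real.sqrt p ∧ Real.sqrt p * Real.sqrt p = p := by
  have hp1 : (1 : ℝ) ≤ p := by exact_mod_cast hp.out.one_lt.le
  exact ⟨by simpa using Real.sqrt_le_sqrt hp1, Real.mul_self_sqrt (by positivity)⟩

/-- **Growth of the Sprung sequence**: if `x 0 = 1`, `p x 1 = a`, `p x (k+2) = a x (k+1) − x k` and `‖a‖ ≤ p⁻¹`
(supersingular), then `‖x k‖ ≤ (√p)ᵏ` (two-step induction: `‖x_{k+2}‖ ≤ p · max(‖a‖‖x_{k+1}‖, ‖x_k‖)`).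
[cite: Sprung2012, Def. 2.1 and proof of Thm. 2.2 (p. 1487)] -/
theorem norm_sprungSeq_le {a : ℚ_[p]} (ha : ‖a‖ ≤ (p : ℝ)⁻¹) {x : ℕ → ℚ_[p]} (hx0 : x 0 = 1)
    (hx1 : (p : ℚ_[p]) * x 1 = a) (hrec : ∀ k, (p : ℚ_[p]) * x (k + 2) = a * x (k + 1) - x k) (k : ℕ) :
    ‖x k‖ ≤ Real.sqrt p ^ k := by
  obtain ⟨hs1, hss⟩ := one_le_sqrt_p (p := p)
  have hp0 : (0 : ℝ) < p := by exact_mod_cast hp.out.pos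
  have hpQ : (p : ℚ_[p]) ≠ 0 := Nat.cast_ne_zero.mpr hp.out.ne_zero
  have hnp : ‖(p : ℚ_[p])‖ = (p : ℝ)⁻¹ := Padic.norm_p
  suffices H : ∀ k, ‖x k‖ ≤ Real.sqrt p ^ k ∧ ‖x (k + 1)‖ ≤ Real.sqrt p ^ (k + 1) from (H k).1
  intro k
  induction k with
  | zero =>
    refine ⟨by simp [hx0], ?_⟩
    have e : x 1 = a / p := (eq_div_iff hpQ).mpr (by rw [mul_comm]; exact hx1)
    rw [e, norm_div, hnp, zero_add, pow_one]
    calc ‖a‖ / (p : ℝ)⁻¹ ≤ (p : ℝ)⁻¹ / (p : ℝ)⁻¹ := div_le_div_of_nonneg_right ha (by positivity)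
      _ = 1 := div_self (by positivity)
      _ ≤ Real.sqrt p := hs1
  | succ k ih =>
    refine ⟨ih.2, ?_⟩
    have e : x (k + 2) = (a * x (k + 1) - x k) / p := (eq_div_iff hpQ).mpr (by rw [mul_comm]; exact hrec k)
    rw [show k + 1 + 1 = k + 2 from rfl, e, norm_div, hnp, div_eq_mul_inv, inv_inv]
    have hmax : ‖a * x (k + 1) - x k‖ ≤ max (‖a‖ * ‖x (k + 1)‖) ‖x k‖ := by
      rw [← norm_mul]; exact Literature.NumberTheory.EllipticCurves.padic_norm_sub_le_max _ _
    have h1 : ‖a‖ * ‖x (k + 1)‖ * p ≤ Real.sqrt p ^ (k + 2) := by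
      calc ‖a‖ * ‖x (k + 1)‖ * p ≤ (p : ℝ)⁻¹ * Real.sqrt p ^ (k + 1) * p := by gcongr; exact ih.2
        _ = Real.sqrt p ^ (k + 1) := by field_simp
        _ ≤ Real.sqrt p ^ (k + 2) := pow_le_pow_right₀ hs1 (by omega)
    have h2 : ‖x k‖ * p ≤ Real.sqrt p ^ (k + 2) := by
      calc ‖x k‖ * p ≤ Real.sqrt p ^ k * p := by gcongr; exact ih.1
        _ = Real.sqrt p ^ (k + 2) := by rw [pow_add, sq, hss]
    calc ‖a * x (k + 1) - x k‖ * p ≤ max (‖a‖ * ‖x (k + 1)‖) ‖x k‖ * p := by gcongr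
      _ = max (‖a‖ * ‖x (k + 1)‖ * p) (‖x k‖ * p) := max_mul_of_nonneg _ _ hp0.le
      _ ≤ Real.sqrt p ^ (k + 2) := max_le h1 h2

/-- `(√p)ᵏ · p⁻ᵏ = ((√p)⁻¹)ᵏ`. [cite: Sprung2012, proof of Thm. 2.2 (p. 1487)] -/
theorem sqrt_pow_mul_inv_pow (k : ℕ) : Real.sqrt p ^ k * ((p : ℝ)⁻¹) ^ k = ((Real.sqrt p)⁻¹) ^ k := by
  obtain ⟨hs1, hss⟩ := one_le_sqrt_p (p := p)
  rw [← mul_pow]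
  congr 1
  have hs0 : Real.sqrt p ≠ 0 := by positivity
  have h : (p : ℝ)⁻¹ = (Real.sqrt p)⁻¹ * (Real.sqrt p)⁻¹ := by rw [← mul_inv, hss]
  rw [h, ← mul_assoc, mul_inv_cancel₀ hs0, one_mul]

/-- `(√p)⁻¹ < 1` and `0 ≤ (√p)⁻¹`. [cite: Sprung2012, proof of Thm. 2.2 (p. 1487)] -/
theorem sqrt_inv_lt_one : ((Real.sqrt p)⁻¹ : ℝ) < 1 ∧ (0 : ℝ) ≤ (Real.sqrt p)⁻¹ := by
  have hp1 : (1 : ℝ) < p := by exact_mod_cast hp.out.one_lt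
  have h1 : (1 : ℝ) < Real.sqrt p := by simpa using Real.sqrt_lt_sqrt zero_le_one hp1
  exact ⟨inv_lt_one_of_one_lt₀ h1, by positivity⟩

/-! ## §2 Binomial congruences -/

/-- The binomial difference `(C(p^{j+1}, n) − [n=0]) − [p ∣ n](C(pʲ, n/p) − [n/p = 0])` is the `Xⁿ`-coefficient of
`(1+X)^{p^{j+1}} − (1+Xᵖ)^{pʲ}`. [cite: Sprung2012, proof of Thm. 2.2 (p. 1487)] -/
theorem choose_sub_choose_div_eq_coeff (j n : ℕ) :
    ((((p ^ (j + 1)).choose n : ℚ_[p]) - if n = 0 then 1 else 0) -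
        if p ∣ n then (((p ^ j).choose (n / p) : ℚ_[p]) - if n / p = 0 then 1 else 0) else 0) =
      coeff n ((1 + X : ℚ_[p]⟦X⟧) ^ p ^ (j + 1) - expand p (prime_ne_zero p) ((1 + X : ℚ_[p]⟦X⟧) ^ p ^ j)) := by
  have e : (1 + X : ℚ_[p]⟦X⟧) ^ p ^ (j + 1) - expand p (prime_ne_zero p) ((1 + X : ℚ_[p]⟦X⟧) ^ p ^ j) =
      ((1 + X : ℚ_[p]⟦X⟧) ^ p ^ (j + 1) - 1) - expand p (prime_ne_zero p) ((1 + X : ℚ_[p]⟦X⟧) ^ p ^ j - 1) := by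
    rw [map_sub, map_one]; ring
  rw [e, map_sub, coeff_expand]
  simp only [map_sub, coeff_one_add_X_pow, coeff_one]

/-- The binomial difference `(C(p^{k+2}, n) − [n=0]) − [p² ∣ n](C(pᵏ, n/p²) − [n/p² = 0])` is the `Xⁿ`-coefficient of
`(1+X)^{p^{k+2}} − (1+X^{p²})^{pᵏ}`. [cite: Sprung2012, proof of Thm. 2.2 (p. 1487)] -/
theorem choose_sub_choose_div_sq_eq_coeff (k n : ℕ) :
    ((((p ^ (k + 2)).choose n : ℚ_[p]) - if n = 0 then 1 else 0) -
        if p ^ 2 ∣ n then (((p ^ k).choose (n / p ^ 2) : ℚ_[p]) - if n / p ^ 2 = 0 then 1 else 0) else 0) =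
      coeff n ((1 + X : ℚ_[p]⟦X⟧) ^ p ^ (k + 2) -
        expand (p ^ 2) (prime_sq_ne_zero p) ((1 + X : ℚ_[p]⟦X⟧) ^ p ^ k)) := by
  have e : (1 + X : ℚ_[p]⟦X⟧) ^ p ^ (k + 2) - expand (p ^ 2) (prime_sq_ne_zero p) ((1 + X : ℚ_[p]⟦X⟧) ^ p ^ k) =
      ((1 + X : ℚ_[p]⟦X⟧) ^ p ^ (k + 2) - 1) -
        expand (p ^ 2) (prime_sq_ne_zero p) ((1 + X : ℚ_[p]⟦X⟧) ^ p ^ k - 1) := by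
    rw [map_sub, map_one]; ring
  rw [e, map_sub, coeff_expand]
  simp only [map_sub, coeff_one_add_X_pow, coeff_one]

/-- `(1+X)^{p^{j+1}} ≡ (1+Xᵖ)^{pʲ} (mod p^{j+1})`, coefficientwise (Hazewinkel 1978, I.2.3). [cite: Sprung2012, proof of Thm. 2.2 (p. 1487)] -/
theorem norm_coeff_pow_sub_expand_p_pow_le (j n : ℕ) :
    ‖coeff n ((1 + X : ℚ_[p]⟦X⟧) ^ p ^ (j + 1) - expand p (prime_ne_zero p) ((1 + X : ℚ_[p]⟦X⟧) ^ p ^ j))‖ ≤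
      (p : ℝ)⁻¹ ^ (j + 1) := by
  have hXc : ∀ m, ‖coeff m (X : ℚ_[p]⟦X⟧)‖ ≤ 1 := fun m ↦ by
    rw [coeff_X]; split_ifs <;> simp
  have h1X : ∀ m, ‖coeff m (1 + X : ℚ_[p]⟦X⟧)‖ ≤ 1 := norm_coeff_add_le norm_coeff_one_le hXc
  have hαβ := norm_coeff_pow_sub_expand_le h1X
  have hβ : ∀ m, ‖coeff m (expand p (prime_ne_zero p) (1 + X : ℚ_[p]⟦X⟧))‖ ≤ 1 :=
    norm_coeff_expand_le _ zero_le_one h1X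
  have h := norm_coeff_pow_prime_pow_sub_le (s := 1) le_rfl hβ (fun m ↦ by simpa using hαβ m) j n
  have e1 : ((1 + X : ℚ_[p]⟦X⟧) ^ p) ^ p ^ j = (1 + X : ℚ_[p]⟦X⟧) ^ p ^ (j + 1) := by
    rw [← pow_mul, ← pow_succ']
  have e2 : (expand p (prime_ne_zero p) (1 + X : ℚ_[p]⟦X⟧)) ^ p ^ j =
      expand p (prime_ne_zero p) ((1 + X : ℚ_[p]⟦X⟧) ^ p ^ j) := by rw [map_pow]
  rw [e1, e2, Nat.add_comm 1 j] at h
  exact h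

/-- `(1+X)^{p^{k+2}} ≡ (1+X^{p²})^{pᵏ} (mod p^{k+1})`, coefficientwise (Hazewinkel 1978, I.2.3). [cite: Sprung2012, proof of Thm. 2.2 (p. 1487)] -/
theorem norm_coeff_pow_sub_expand_sq_pow_le (k n : ℕ) :
    ‖coeff n ((1 + X : ℚ_[p]⟦X⟧) ^ p ^ (k + 2) - expand (p ^ 2) (prime_sq_ne_zero p) ((1 + X : ℚ_[p]⟦X⟧) ^ p ^ k))‖ ≤
      (p : ℝ)⁻¹ ^ (k + 1) := by
  have hXc : ∀ m, ‖coeff m (X : ℚ_[p]⟦X⟧)‖ ≤ 1 := fun m ↦ by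
    rw [coeff_X]; split_ifs <;> simp
  have h1X : ∀ m, ‖coeff m (1 + X : ℚ_[p]⟦X⟧)‖ ≤ 1 := norm_coeff_add_le norm_coeff_one_le hXc
  have hαβ := norm_coeff_pow_sq_sub_expand_le h1X
  have hβ : ∀ m, ‖coeff m (expand (p ^ 2) (prime_sq_ne_zero p) (1 + X : ℚ_[p]⟦X⟧))‖ ≤ 1 :=
    norm_coeff_expand_le _ zero_le_one h1X
  have h := norm_coeff_pow_prime_pow_sub_le (s := 1) le_rfl hβ (fun m ↦ by simpa using hαβ m) k n
  have e1 : ((1 + X : ℚ_[p]⟦X⟧) ^ p ^ 2) ^ p ^ k = (1 + X : ℚ_[p]⟦X⟧) ^ p ^ (k + 2) := by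
    rw [← pow_mul, ← pow_add, Nat.add_comm 2 k]
  have e2 : (expand (p ^ 2) (prime_sq_ne_zero p) (1 + X : ℚ_[p]⟦X⟧)) ^ p ^ k =
      expand (p ^ 2) (prime_sq_ne_zero p) ((1 + X : ℚ_[p]⟦X⟧) ^ p ^ k) := by rw [map_pow]
  rw [e1, e2, Nat.add_comm 1 k] at h
  exact h

/-! ## §3 The logarithm and its Honda type `p − aT + T²` -/

/-- Abstract form of the type computation: for a summable double family `t k d` whose head terms `t 0 n`,
`t 1 n − c₂[P₂] t 0 d₂` and combined terms `t (k+2) n − c₂[P₂] t (k+1) d₂ + c₃[P₃] t k d₃` are all integral, the combination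
`∑ₖ t k n − c₂[P₂]∑ₖ t k d₂ + c₃[P₃]∑ₖ t k d₃` is integral (regrouping of three convergent `p`-adic sums; ultrametric inequality).
[cite: Sprung2012, proof of Thm. 2.2 (p. 1487)] -/
theorem norm_three_tsum_comb_le_one {t : ℕ → ℕ → ℚ_[p]} (hs : ∀ d, Summable fun k ↦ t k d) (c₂ c₃ : ℚ_[p])
    (n d₂ d₃ : ℕ) {P₂ P₃ : Prop} {i₂ : Decidable P₂} {i₃ : Decidable P₃}
    (h0 : ‖t 0 n‖ ≤ 1) (h1 : ‖t 1 n - c₂ * (if P₂ then t 0 d₂ else 0)‖ ≤ 1)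
    (hk : ∀ k, ‖t (k + 2) n - c₂ * (if P₂ then t (k + 1) d₂ else 0) + c₃ * (if P₃ then t k d₃ else 0)‖ ≤ 1) :
    ‖∑' k, t k n - c₂ * (if P₂ then ∑' k, t k d₂ else 0) + c₃ * (if P₃ then ∑' k, t k d₃ else 0)‖ ≤ 1 := by
  set u : ℕ → ℚ_[p] := fun k ↦ c₂ * (if P₂ then t k d₂ else 0) with hu
  set v : ℕ → ℚ_[p] := fun k ↦ c₃ * (if P₃ then t k d₃ else 0) with hv
  have hsu : Summable u := by
    by_cases hP : P₂
    · simp only [hu, if_pos hP]; exact (hs d₂).mul_left _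
    · simp only [hu, if_neg hP, mul_zero]; exact summable_zero
  have hsv : Summable v := by
    by_cases hP : P₃
    · simp only [hv, if_pos hP]; exact (hs d₃).mul_left _
    · simp only [hv, if_neg hP, mul_zero]; exact summable_zero
  have h2 : c₂ * (if P₂ then ∑' k, t k d₂ else 0) = ∑' k, u k := by
    by_cases hP : P₂
    · simp only [hu, if_pos hP]; rw [tsum_mul_left]
    · simp only [hu, if_neg hP, mul_zero, tsum_zero]
  have h3 : c₃ * (if P₃ then ∑' k, t k d₃ else 0) = ∑' k, v k := by
    by_cases hP : P₃
    · simp only [hv, if_pos hP]; rw [tsum_mul_left]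
    · simp only [hv, if_neg hP, mul_zero, tsum_zero]
  rw [h2, h3]
  have hs1 : Summable fun k ↦ t (k + 1) n := (summable_nat_add_iff 1).mpr (hs n)
  have hs2 : Summable fun k ↦ t (k + 2) n := (summable_nat_add_iff 2).mpr (hs n)
  have hsu1 : Summable fun k ↦ u (k + 1) := (summable_nat_add_iff 1).mpr hsu
  rw [(hs n).tsum_eq_zero_add, hs1.tsum_eq_zero_add, hsu.tsum_eq_zero_add]
  have hcomb : ∑' k, t (k + 1 + 1) n - ∑' k, u (k + 1) + ∑' k, v k = ∑' k, (t (k + 2) n - u (k + 1) + v k) := by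
    rw [← hs2.tsum_sub hsu1, ← (hs2.sub hsu1).tsum_add hsv]
  have hrearr : t 0 n + (t (0 + 1) n + ∑' k, t (k + 1 + 1) n) - (u 0 + ∑' k, u (k + 1)) + ∑' k, v k =
      (t 0 n + (t 1 n - u 0)) + (∑' k, t (k + 1 + 1) n - ∑' k, u (k + 1) + ∑' k, v k) := by ring
  rw [hrearr, hcomb]
  refine (IsUltrametricDist.norm_add_le_max _ _).trans (max_le ((IsUltrametricDist.norm_add_le_max _ _).trans
    (max_le h0 h1)) ?_)
  exact IsUltrametricDist.norm_tsum_le_of_forall_le_of_nonneg zero_le_one fun k ↦ hk k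

/-- At `d = 0` the term `x_k (C(pᵏ, 0) − 1)` vanishes. [cite: Sprung2012, proof of Thm. 2.2 (p. 1487)] -/
theorem sprungTerm_zero (x : ℕ → ℚ_[p]) (k : ℕ) :
    x k * (((p ^ k).choose 0 : ℚ_[p]) - if (0 : ℕ) = 0 then 1 else 0) = 0 := by
  simp

/-- **`‖x_k (C(pᵏ, d) − [d = 0])‖ ≤ d · (√p)⁻ᵏ`** under the growth bound `‖x_k‖ ≤ (√p)ᵏ`
(`‖C(pᵏ, d)‖ ≤ d p⁻ᵏ`). [cite: Sprung2012, proof of Thm. 2.2 (p. 1487)] -/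
theorem norm_sprungTerm_le {x : ℕ → ℚ_[p]} (hxb : ∀ k, ‖x k‖ ≤ Real.sqrt p ^ k) (k d : ℕ) :
    ‖x k * (((p ^ k).choose d : ℚ_[p]) - if d = 0 then 1 else 0)‖ ≤ d * ((Real.sqrt p)⁻¹) ^ k := by
  rcases Nat.eq_zero_or_pos d with rfl | hd
  · rw [sprungTerm_zero]; simp
  rw [if_neg hd.ne', sub_zero, norm_mul]
  have h := norm_choose_prime_pow_le p k hd.ne'
  calc ‖x k‖ * ‖((p ^ k).choose d : ℚ_[p])‖ ≤ Real.sqrt p ^ k * (d * ((p : ℝ)⁻¹) ^ k) :=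
        mul_le_mul (hxb k) h (norm_nonneg _) (by positivity)
    _ = d * (Real.sqrt p ^ k * ((p : ℝ)⁻¹) ^ k) := by ring
    _ = d * ((Real.sqrt p)⁻¹) ^ k := by rw [sqrt_pow_mul_inv_pow]

/-- The terms `x_k (C(pᵏ, d) − [d = 0])` are summable in `k` (geometric majorant, ratio `(√p)⁻¹`). [cite: Sprung2012, proof of Thm. 2.2 (p. 1487)] -/
theorem summable_sprungTerm {x : ℕ → ℚ_[p]} (hxb : ∀ k, ‖x k‖ ≤ Real.sqrt p ^ k) (d : ℕ) :
    Summable fun k : ℕ ↦ x k * (((p ^ k).choose d : ℚ_[p]) - if d = 0 then 1 else 0) := by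
  obtain ⟨hr1, hr0⟩ := sqrt_inv_lt_one (p := p)
  refine Summable.of_norm_bounded (g := fun k : ℕ ↦ (d : ℝ) * ((Real.sqrt p)⁻¹) ^ k) ?_ (norm_sprungTerm_le hxb · d)
  exact (summable_geometric_of_lt_one hr0 hr1).mul_left _

/-- The coefficients of the Sprung logarithm `log_{F_ss} = PowerSeries.mk fun d ↦ ∑' k, x_k (C(pᵏ,d) − [d = 0])`.
[cite: Sprung2012, proof of Thm. 2.2 (p. 1487)] -/
theorem coeff_sprungLog (x : ℕ → ℚ_[p]) (d : ℕ) :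
    coeff d (PowerSeries.mk fun d ↦ ∑' k : ℕ, x k * (((p ^ k).choose d : ℚ_[p]) - if d = 0 then 1 else 0)) =
      ∑' k : ℕ, x k * (((p ^ k).choose d : ℚ_[p]) - if d = 0 then 1 else 0) := by
  rw [coeff_mk]

/-- `log_{F_ss}(0) = 0`. [cite: Sprung2012, proof of Thm. 2.2 (p. 1487)] -/
theorem constantCoeff_sprungLog (x : ℕ → ℚ_[p]) :
    constantCoeff (PowerSeries.mk fun d ↦ ∑' k : ℕ, x k * (((p ^ k).choose d : ℚ_[p]) - if d = 0 then 1 else 0)) = 0 := by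
  rw [← coeff_zero_eq_constantCoeff, coeff_sprungLog]
  simp

/-- **`‖[Xᵈ] log_{F_ss}‖ ≤ d`** (logarithmic growth of the coefficients; Kobayashi's `P`, §8.1). [cite: Kobayashi2003, §8.1–8.2] -/
theorem norm_coeff_sprungLog_le {x : ℕ → ℚ_[p]} (hxb : ∀ k, ‖x k‖ ≤ Real.sqrt p ^ k) (d : ℕ) :
    ‖coeff d (PowerSeries.mk fun d ↦ ∑' k : ℕ, x k * (((p ^ k).choose d : ℚ_[p]) - if d = 0 then 1 else 0))‖ ≤ d := by
  obtain ⟨hr1, hr0⟩ := sqrt_inv_lt_one (p := p)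
  rw [coeff_sprungLog]
  refine IsUltrametricDist.norm_tsum_le_of_forall_le_of_nonneg (Nat.cast_nonneg d) fun k ↦ ?_
  refine (norm_sprungTerm_le hxb k d).trans ?_
  calc (d : ℝ) * ((Real.sqrt p)⁻¹) ^ k ≤ d * 1 :=
        mul_le_mul_of_nonneg_left (pow_le_one₀ hr0 hr1.le) (Nat.cast_nonneg d)
    _ = d := mul_one _

/-- **`‖[X¹] log_{F_ss}‖ = 1`**: `[X¹] log = ∑ₖ x_k pᵏ`, whose `k = 0` term is `x₀ = 1` and whose tail has norm `< 1`.
[cite: Sprung2012, proof of Thm. 2.2 (p. 1487)] -/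
theorem norm_coeff_one_sprungLog {x : ℕ → ℚ_[p]} (hx0 : x 0 = 1) (hxb : ∀ k, ‖x k‖ ≤ Real.sqrt p ^ k) :
    ‖coeff 1 (PowerSeries.mk fun d ↦ ∑' k : ℕ, x k * (((p ^ k).choose d : ℚ_[p]) - if d = 0 then 1 else 0))‖ = 1 := by
  obtain ⟨hr1, hr0⟩ := sqrt_inv_lt_one (p := p)
  rw [coeff_sprungLog]
  have hs := summable_sprungTerm hxb 1
  rw [hs.tsum_eq_zero_add]
  have h0 : x 0 * (((p ^ 0).choose 1 : ℚ_[p]) - if (1 : ℕ) = 0 then 1 else 0) = 1 := by simp [hx0]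
  have htail : ‖∑' k : ℕ, x (k + 1) * (((p ^ (k + 1)).choose 1 : ℚ_[p]) - if (1 : ℕ) = 0 then 1 else 0)‖ < 1 := by
    refine (IsUltrametricDist.norm_tsum_le_of_forall_le_of_nonneg hr0 fun k ↦ ?_).trans_lt hr1
    refine (norm_sprungTerm_le hxb (k + 1) 1).trans ?_
    rw [Nat.cast_one, one_mul, pow_succ]
    exact mul_le_of_le_one_left hr0 (pow_le_one₀ hr0 hr1.le)
  rw [h0, IsUltrametricDist.norm_add_eq_max_of_norm_ne_norm, norm_one, max_eq_left htail.le]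
  rw [norm_one]; exact (ne_of_lt htail).symm

/-- **The combined term is integral.** With `t k d = x_k (C(pᵏ,d) − [d=0])`:
`‖t (k+2) n − (a/p)[p ∣ n] t (k+1) (n/p) + (1/p)[p² ∣ n] t k (n/p²)‖ ≤ 1`, because by the recursion
`p x_{k+2} = a x_{k+1} − x_k` it equals `(a/p)x_{k+1}[Xⁿ]((1+X)^{p^{k+2}} − (1+Xᵖ)^{p^{k+1}}) − (1/p)x_k[Xⁿ]((1+X)^{p^{k+2}} −
(1+X^{p²})^{pᵏ})`, and the two differences are `≡ 0` modulo `p^{k+2}`, `p^{k+1}`. [cite: Kobayashi2003, §8.2 and Thm. 8.3 iii)] -/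
theorem norm_sprung_combined_le_one {a : ℚ_[p]} (ha : ‖a‖ ≤ (p : ℝ)⁻¹) {x : ℕ → ℚ_[p]}
    (hrec : ∀ k, (p : ℚ_[p]) * x (k + 2) = a * x (k + 1) - x k) (hxb : ∀ k, ‖x k‖ ≤ Real.sqrt p ^ k)
    (k n : ℕ) :
    ‖x (k + 2) * (((p ^ (k + 2)).choose n : ℚ_[p]) - if n = 0 then 1 else 0) -
        a / p * (if p ∣ n then x (k + 1) * (((p ^ (k + 1)).choose (n / p) : ℚ_[p]) - if n / p = 0 then 1 else 0) else 0) +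
        1 / (p : ℚ_[p]) * (if p ^ 2 ∣ n then x k * (((p ^ k).choose (n / p ^ 2) : ℚ_[p]) -
          if n / p ^ 2 = 0 then 1 else 0) else 0)‖ ≤ 1 := by
  obtain ⟨hs1, hss⟩ := one_le_sqrt_p (p := p)
  have hp0 : (0 : ℝ) < p := by exact_mod_cast hp.out.pos
  have hpQ : (p : ℚ_[p]) ≠ 0 := Nat.cast_ne_zero.mpr hp.out.ne_zero
  have hnp : ‖(p : ℚ_[p])‖ = (p : ℝ)⁻¹ := Padic.norm_p
  set D1 := (1 + X : ℚ_[p]⟦X⟧) ^ p ^ (k + 1 + 1) - expand p (prime_ne_zero p) ((1 + X : ℚ_[p]⟦X⟧) ^ p ^ (k + 1))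
    with hD1
  set D2 := (1 + X : ℚ_[p]⟦X⟧) ^ p ^ (k + 2) - expand (p ^ 2) (prime_sq_ne_zero p) ((1 + X : ℚ_[p]⟦X⟧) ^ p ^ k)
    with hD2
  have hx2 : x (k + 2) = (a * x (k + 1) - x k) / p := (eq_div_iff hpQ).mpr (by rw [mul_comm]; exact hrec k)
  have key : x (k + 2) * (((p ^ (k + 2)).choose n : ℚ_[p]) - if n = 0 then 1 else 0) -
        a / p * (if p ∣ n then x (k + 1) * (((p ^ (k + 1)).choose (n / p) : ℚ_[p]) - if n / p = 0 then 1 else 0) else 0) +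
        1 / (p : ℚ_[p]) * (if p ^ 2 ∣ n then x k * (((p ^ k).choose (n / p ^ 2) : ℚ_[p]) -
          if n / p ^ 2 = 0 then 1 else 0) else 0) =
      a / p * x (k + 1) * coeff n D1 - 1 / p * x k * coeff n D2 := by
    rw [hD1, hD2, ← choose_sub_choose_div_eq_coeff, ← choose_sub_choose_div_sq_eq_coeff, hx2,
      show k + 1 + 1 = k + 2 from rfl]
    split_ifs <;> ring
  rw [key]
  have hb1 := norm_coeff_pow_sub_expand_p_pow_le (p := p) (k + 1) n
  have hb2 := norm_coeff_pow_sub_expand_sq_pow_le (p := p) k n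
  rw [← hD1] at hb1
  rw [← hD2] at hb2
  have hsp : Real.sqrt p ≤ p := by nlinarith
  have h1 : ‖a / p * x (k + 1) * coeff n D1‖ ≤ 1 := by
    rw [norm_mul, norm_mul, norm_div, hnp]
    calc ‖a‖ / (p : ℝ)⁻¹ * ‖x (k + 1)‖ * ‖coeff n D1‖
        ≤ ((p : ℝ)⁻¹ / (p : ℝ)⁻¹) * Real.sqrt p ^ (k + 1) * ((p : ℝ)⁻¹ ^ (k + 1 + 1)) := by
          gcongr
          exact hxb (k + 1)
      _ = Real.sqrt p ^ (k + 1) * ((p : ℝ)⁻¹ ^ (k + 2)) := by rw [div_self (by positivity), one_mul]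
      _ ≤ (p : ℝ) ^ (k + 1) * ((p : ℝ)⁻¹ ^ (k + 2)) := by gcongr
      _ = (p : ℝ)⁻¹ := by
          rw [pow_succ ((p : ℝ)⁻¹) (k + 1), ← mul_assoc, ← mul_pow, mul_inv_cancel₀ (by positivity), one_pow, one_mul]
      _ ≤ 1 := inv_le_one_of_one_le₀ (by exact_mod_cast hp.out.one_lt.le)
  have h2 : ‖1 / p * x k * coeff n D2‖ ≤ 1 := by
    rw [norm_mul, norm_mul, norm_div, norm_one, hnp, one_div, inv_inv]
    calc (p : ℝ) * ‖x k‖ * ‖coeff n D2‖ ≤ p * Real.sqrt p ^ k * ((p : ℝ)⁻¹ ^ (k + 1)) := by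
          gcongr
          exact hxb k
      _ ≤ p * (p : ℝ) ^ k * ((p : ℝ)⁻¹ ^ (k + 1)) := by gcongr
      _ = 1 := by rw [← pow_succ', ← mul_pow, mul_inv_cancel₀ (by positivity), one_pow]
  exact (Literature.NumberTheory.EllipticCurves.padic_norm_sub_le_max _ _).trans (max_le h1 h2)

/-- **The Sprung logarithm is of Honda type `p − aT + T²`**: `hondaShift p a log_{F_ss} ∈ ℤ_p⟦X⟧`
(Kobayashi Thm. 8.3 iii) for the Eisenstein polynomial `t² − a t + p`; Sprung 2012 p. 1487: "what we need is a formal group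
whose logarithm is of Honda type `t² − a_p t + p`"). Hypotheses: `‖a‖ ≤ p⁻¹` (supersingular) and `x` the Sprung sequence.
[cite: Sprung2012, proof of Thm. 2.2 (p. 1487)] -/
theorem norm_coeff_hondaShift_sprungLog_le_one {a : ℚ_[p]} (ha : ‖a‖ ≤ (p : ℝ)⁻¹) {x : ℕ → ℚ_[p]} (hx0 : x 0 = 1)
    (hx1 : (p : ℚ_[p]) * x 1 = a) (hrec : ∀ k, (p : ℚ_[p]) * x (k + 2) = a * x (k + 1) - x k) (n : ℕ) :
    ‖coeff n (hondaShift p a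
      (PowerSeries.mk fun d ↦ ∑' k : ℕ, x k * (((p ^ k).choose d : ℚ_[p]) - if d = 0 then 1 else 0)))‖ ≤ 1 := by
  have hxb := norm_sprungSeq_le ha hx0 hx1 hrec
  have hp0 : (0 : ℝ) < p := by exact_mod_cast hp.out.pos
  have hpQ : (p : ℚ_[p]) ≠ 0 := Nat.cast_ne_zero.mpr hp.out.ne_zero
  have hnp : ‖(p : ℚ_[p])‖ = (p : ℝ)⁻¹ := Padic.norm_p
  rw [coeff_hondaShift]
  simp only [coeff_sprungLog]
  refine norm_three_tsum_comb_le_one (t := fun k d ↦ x k * (((p ^ k).choose d : ℚ_[p]) - if d = 0 then 1 else 0))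
    (summable_sprungTerm hxb) (a / p) (1 / (p : ℚ_[p])) n (n / p) (n / p ^ 2) ?_ ?_ ?_
  · -- `t 0 n = C(1, n) − [n = 0]` is `[n = 1]`
    simp only [hx0, pow_zero, one_mul]
    rcases n with _ | _ | n
    · simp
    · simp
    · rw [if_neg (by omega), sub_zero, Nat.choose_eq_zero_of_lt (by omega)]; simp
  · -- `t 1 n − (a/p)[p∣n] t 0 (n/p) = (a/p)·[Xⁿ]((1+X)^p − (1+Xᵖ))`
    have e1 : x 1 = a / p := (eq_div_iff hpQ).mpr (by rw [mul_comm]; exact hx1)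
    have hD := norm_coeff_pow_sub_expand_p_pow_le (p := p) 0 n
    have hid := choose_sub_choose_div_eq_coeff (p := p) 0 n
    simp only [zero_add, pow_one, pow_zero] at hD hid
    have key : x 1 * (((p ^ 1).choose n : ℚ_[p]) - if n = 0 then 1 else 0) -
        a / p * (if p ∣ n then x 0 * (((p ^ 0).choose (n / p) : ℚ_[p]) - if n / p = 0 then 1 else 0) else 0) =
        a / p * coeff n ((1 + X : ℚ_[p]⟦X⟧) ^ p - expand p (prime_ne_zero p) (1 + X : ℚ_[p]⟦X⟧)) := by
      rw [← hid, e1, hx0, pow_one, pow_zero]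
      split_ifs <;> ring
    rw [key, norm_mul, norm_div, hnp]
    calc ‖a‖ / (p : ℝ)⁻¹ * ‖coeff n ((1 + X : ℚ_[p]⟦X⟧) ^ p - expand p (prime_ne_zero p) (1 + X))‖
        ≤ (p : ℝ)⁻¹ / (p : ℝ)⁻¹ * (p : ℝ)⁻¹ := by gcongr
      _ = (p : ℝ)⁻¹ := by rw [div_self (by positivity), one_mul]
      _ ≤ 1 := inv_le_one_of_one_le₀ (by exact_mod_cast hp.out.one_lt.le)
  · intro k
    exact norm_sprung_combined_le_one ha hrec hxb k n

end SprungHonda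
end Literature.NumberTheory.EllipticCurves.Sprung2012.Honda

end Part1

/-!
## Part 2 — port of `Summits/BirchSwinnertonDyer/BirchSwinnertonDyer/Theorems/PrintX8VSInputHondaSystemSprungLogValues.lean` (8 declarations kept)

# The values of Sprung's logarithm: `log_{F_ss}(y) = ∑ₖ x_k ((1+y)^{pᵏ} − 1)` at every point `‖y‖ < 1` of a complete
# ultrametric normed `ℚ_p`-algebra (rearrangement), the finite form at `p`-power roots of unity, and the CONGRUENCE form
# `log_{F_ss}(y) ∈ K' + 𝒪_K`

(Port of the declarations listed in the Part header; the source module's docstring — cell bookkeeping of the BSD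
printed-inputs programme — is abridged to its title here.)
-/

section Part2

open scoped _root_.Classical _root_.Topology
open _root_.Filter _root_.PowerSeries _root_.Finset

namespace Literature.NumberTheory.EllipticCurves.Sprung2012.Honda

namespace SprungHonda

open Literature.NumberTheory.EllipticCurves.Sprung2012.Honda.BallEval Literature.NumberTheory.EllipticCurves.Sprung2012.Honda.HondaFss

variable {p : ℕ} [hp : Fact p.Prime] {K : Type*} [NontriviallyNormedField K] [NormedAlgebra ℚ_[p] K]

/-! ## §1 The double family -/

/-- The row as a finite sum of the terms: `x_k((1+y)^{pᵏ} − 1) = ∑_{d ≤ pᵏ} x_k(C(pᵏ,d) − [d=0]) · yᵈ` (binomial theorem).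
[cite: Sprung2012, proof of Thm. 2.2 (p. 1487)] -/
theorem sprungRow_eq_sum (x : ℕ → ℚ_[p]) (y : K) (k : ℕ) :
    algebraMap ℚ_[p] K (x k) * ((1 + y) ^ p ^ k - 1) =
      ∑ d ∈ range (p ^ k + 1), algebraMap ℚ_[p] K (x k * (((p ^ k).choose d : ℚ_[p]) - if d = 0 then 1 else 0)) * y ^ d := by
  rw [add_comm (1 : K) y, add_pow]
  simp only [one_pow, mul_one]
  have h1 : (∑ d ∈ range (p ^ k + 1), y ^ d * ((p ^ k).choose d : K)) - 1 =
      ∑ d ∈ range (p ^ k + 1), (((p ^ k).choose d : K) - if d = 0 then 1 else 0) * y ^ d := by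
    have hone : (1 : K) = ∑ d ∈ range (p ^ k + 1), (if d = 0 then (1 : K) else 0) * y ^ d := by
      rw [Finset.sum_eq_single 0 (fun d _ hd ↦ by rw [if_neg hd, zero_mul]) (fun h ↦ absurd (by simp) h)]
      simp
    conv_lhs => rw [hone, ← Finset.sum_sub_distrib]
    refine Finset.sum_congr rfl fun d _ ↦ ?_
    split_ifs <;> ring
  rw [h1, Finset.mul_sum]
  refine Finset.sum_congr rfl fun d _ ↦ ?_
  rw [map_mul, map_sub, map_natCast]
  split_ifs with hd
  · rw [map_one]; ring
  · rw [map_zero]; ring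

/-- The terms of the row vanish beyond `d = pᵏ`. [cite: Sprung2012, proof of Thm. 2.2 (p. 1487)] -/
theorem sprungTerm_eq_zero_of_lt (x : ℕ → ℚ_[p]) {k d : ℕ} (h : p ^ k < d) :
    x k * (((p ^ k).choose d : ℚ_[p]) - if d = 0 then 1 else 0) = 0 := by
  rw [Nat.choose_eq_zero_of_lt h, if_neg (by omega)]
  simp

/-- Row sums: `∑_d x_k(C(pᵏ,d) − [d=0]) yᵈ = x_k((1+y)^{pᵏ} − 1)`. [cite: Sprung2012, proof of Thm. 2.2 (p. 1487)] -/
theorem hasSum_sprung_row (x : ℕ → ℚ_[p]) (y : K) (k : ℕ) :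
    HasSum (fun d : ℕ ↦ algebraMap ℚ_[p] K (x k * (((p ^ k).choose d : ℚ_[p]) - if d = 0 then 1 else 0)) * y ^ d)
      (algebraMap ℚ_[p] K (x k) * ((1 + y) ^ p ^ k - 1)) := by
  rw [sprungRow_eq_sum]
  refine hasSum_sum_of_ne_finset_zero fun d hd ↦ ?_
  rw [mem_range, not_lt] at hd
  rw [sprungTerm_eq_zero_of_lt x (by omega), map_zero, zero_mul]

/-- Column sums: `∑_k x_k(C(pᵏ,d) − [d=0]) yᵈ = [Xᵈ]log · yᵈ`. [cite: Sprung2012, proof of Thm. 2.2 (p. 1487)] -/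
theorem hasSum_sprung_col {x : ℕ → ℚ_[p]} (hxb : ∀ k, ‖x k‖ ≤ Real.sqrt p ^ k) (y : K) (d : ℕ) :
    HasSum (fun k : ℕ ↦ algebraMap ℚ_[p] K (x k * (((p ^ k).choose d : ℚ_[p]) - if d = 0 then 1 else 0)) * y ^ d)
      (algebraMap ℚ_[p] K (coeff d (PowerSeries.mk fun d ↦
        ∑' k : ℕ, x k * (((p ^ k).choose d : ℚ_[p]) - if d = 0 then 1 else 0))) * y ^ d) := by
  rw [coeff_sprungLog]
  exact ((summable_sprungTerm hxb d).hasSum.map (algebraMap ℚ_[p] K) (continuous_algebraMap ℚ_[p] K)).mul_right (y ^ d)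

/-- **Summability of the double family**: `‖x_k(C(pᵏ,d) − [d=0]) yᵈ‖ ≤ ((√p)⁻¹)ᵏ · (d ‖y‖ᵈ)`. [cite: Sprung2012, proof of Thm. 2.2 (p. 1487)] -/
theorem summable_sprung_double [CompleteSpace K] {x : ℕ → ℚ_[p]} (hxb : ∀ k, ‖x k‖ ≤ Real.sqrt p ^ k) {y : K}
    (hy : ‖y‖ < 1) :
    Summable fun kd : ℕ × ℕ ↦
      algebraMap ℚ_[p] K (x kd.1 * (((p ^ kd.1).choose kd.2 : ℚ_[p]) - if kd.2 = 0 then 1 else 0)) * y ^ kd.2 := by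
  obtain ⟨hr1, hr0⟩ := sqrt_inv_lt_one (p := p)
  have hg1 : Summable fun k : ℕ ↦ ((Real.sqrt p)⁻¹ : ℝ) ^ k := summable_geometric_of_lt_one hr0 hr1
  have hg2 : Summable fun d : ℕ ↦ (d : ℝ) * ‖y‖ ^ d := by
    simpa [pow_one] using summable_pow_mul_geometric_of_norm_lt_one 1 (r := ‖y‖) (by rwa [norm_norm])
  refine Summable.of_norm_bounded (hg1.mul_of_nonneg hg2 (fun k ↦ by positivity) (fun d ↦ by positivity)) ?_
  rintro ⟨k, d⟩
  dsimp only
  rw [norm_mul, norm_pow, norm_algebraMap_padic]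
  calc ‖x k * (((p ^ k).choose d : ℚ_[p]) - if d = 0 then 1 else 0)‖ * ‖y‖ ^ d
      ≤ (d * ((Real.sqrt p)⁻¹) ^ k) * ‖y‖ ^ d := mul_le_mul_of_nonneg_right (norm_sprungTerm_le hxb k d) (by positivity)
    _ = ((Real.sqrt p)⁻¹) ^ k * (d * ‖y‖ ^ d) := by ring

/-! ## §2 `log_{F_ss}(y) = ∑ₖ x_k((1+y)^{pᵏ} − 1)` -/

/-- **`∑ₖ x_k((1+y)^{pᵏ} − 1) = log_{F_ss}(y)`** (`= qEval log y`) for `‖y‖ < 1` in a complete ultrametric normed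
`ℚ_p`-algebra: both are iterated sums of the summable double family. [cite: Sprung2012, proof of Thm. 2.2 (p. 1487)] -/
theorem hasSum_sprungRow [CompleteSpace K] {x : ℕ → ℚ_[p]} (hxb : ∀ k, ‖x k‖ ≤ Real.sqrt p ^ k) {y : K} (hy : ‖y‖ < 1) :
    HasSum (fun k : ℕ ↦ algebraMap ℚ_[p] K (x k) * ((1 + y) ^ p ^ k - 1))
      (qEval p K (PowerSeries.mk fun d ↦ ∑' k : ℕ, x k * (((p ^ k).choose d : ℚ_[p]) - if d = 0 then 1 else 0)) y) := by
  have hs := summable_sprung_double hxb hy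
  have h1 : HasSum (fun k : ℕ ↦ algebraMap ℚ_[p] K (x k) * ((1 + y) ^ p ^ k - 1))
      (∑' kd : ℕ × ℕ, algebraMap ℚ_[p] K (x kd.1 * (((p ^ kd.1).choose kd.2 : ℚ_[p]) - if kd.2 = 0 then 1 else 0)) *
        y ^ kd.2) :=
    hs.hasSum.prod_fiberwise fun k ↦ hasSum_sprung_row x y k
  have hs' := (Equiv.prodComm ℕ ℕ).summable_iff.mpr hs
  have h2 : HasSum (fun d : ℕ ↦ algebraMap ℚ_[p] K (coeff d (PowerSeries.mk fun d ↦
        ∑' k : ℕ, x k * (((p ^ k).choose d : ℚ_[p]) - if d = 0 then 1 else 0))) * y ^ d)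
      (∑' dk : ℕ × ℕ, algebraMap ℚ_[p] K (x dk.2 * (((p ^ dk.2).choose dk.1 : ℚ_[p]) - if dk.1 = 0 then 1 else 0)) *
        y ^ dk.1) :=
    hs'.hasSum.prod_fiberwise fun d ↦ hasSum_sprung_col hxb y d
  have h3 := hasSum_qEval (K := K) (norm_coeff_sprungLog_le hxb) hy
  rw [h3.unique h2, ← (Equiv.prodComm ℕ ℕ).tsum_eq]
  exact h1

/-- **Finite form**: if `(1+y)^{pᵏ} = 1` for all `k ≥ k₀` then `log_{F_ss}(y) = ∑_{k < k₀} x_k((1+y)^{pᵏ} − 1)` (the case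
`y = ζ_{p^{k₀}} − 1` of [K] Lemma 8.9 / Sprung Thm. 2.2). [cite: Kobayashi2003, Lemma 8.9] -/
theorem qEval_sprungLog_eq_sum_of_pow_eq_one [CompleteSpace K] {x : ℕ → ℚ_[p]} (hxb : ∀ k, ‖x k‖ ≤ Real.sqrt p ^ k)
    {y : K} (hy : ‖y‖ < 1) {k₀ : ℕ} (h : ∀ k, k₀ ≤ k → (1 + y) ^ p ^ k = 1) :
    qEval p K (PowerSeries.mk fun d ↦ ∑' k : ℕ, x k * (((p ^ k).choose d : ℚ_[p]) - if d = 0 then 1 else 0)) y =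
      ∑ k ∈ range k₀, algebraMap ℚ_[p] K (x k) * ((1 + y) ^ p ^ k - 1) := by
  refine (hasSum_sprungRow hxb hy).unique (hasSum_sum_of_ne_finset_zero fun k hk ↦ ?_)
  rw [mem_range, not_lt] at hk
  rw [h k hk, sub_self, mul_zero]

/-! ## §3 The congruence form `log_{F_ss}(y) ∈ K' + 𝒪_K` -/

/-- **`log_{F_ss}(y) ∈ K' + 𝒪_K`**: for a subfield `K' ⊇ ℚ_p` such that every `z ∈ 𝒪_K` has `zᵖ ∈ (K' ∩ 𝒪_K) + p𝒪_K`, and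
every `‖y‖ < 1`, there is `μ ∈ K'` with `‖log_{F_ss}(y) − μ‖ ≤ 1`. (Rows: `(1+y)^{pᵏ} = s_k + e_k`, `‖e_k‖ ≤ ‖p‖ᵏ`, so row
`k` is `x_k(s_k − 1) + x_k e_k` with `x_k(s_k − 1) ∈ K'` and `‖x_k e_k‖ ≤ (√p)ᵏ p⁻ᵏ ≤ 1`; the tail of the convergent series is
eventually of norm `≤ 1`.) [cite: Kobayashi2003, Prop. 8.11 (proof)] -/
theorem exists_mem_norm_qEval_sprungLog_sub_le_one [IsUltrametricDist K] [CompleteSpace K] {x : ℕ → ℚ_[p]}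
    (hxb : ∀ k, ‖x k‖ ≤ Real.sqrt p ^ k) (K' : Subfield K) (hK' : ∀ q : ℚ_[p], algebraMap ℚ_[p] K q ∈ K')
    (hFrob : ∀ z : K, ‖z‖ ≤ 1 → ∃ s ∈ K', ‖s‖ ≤ 1 ∧ ‖z ^ p - s‖ ≤ ‖(p : K)‖)
    {y : K} (hy : ‖y‖ < 1) :
    ∃ μ ∈ K', ‖qEval p K (PowerSeries.mk fun d ↦
      ∑' k : ℕ, x k * (((p ^ k).choose d : ℚ_[p]) - if d = 0 then 1 else 0)) y - μ‖ ≤ 1 := by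
  obtain ⟨hr1, hr0⟩ := sqrt_inv_lt_one (p := p)
  obtain ⟨hq0, hq1⟩ : 0 < ‖(p : K)‖ ∧ ‖(p : K)‖ < 1 := by
    rw [norm_natCast_p]
    exact ⟨inv_pos.mpr (by exact_mod_cast hp.out.pos), inv_lt_one_of_one_lt₀ (by exact_mod_cast hp.out.one_lt)⟩
  have hsum := hasSum_sprungRow hxb hy
  -- tail: rows tend to `0`, so eventually `‖row k‖ ≤ 1`
  have htend := hsum.summable.tendsto_atTop_zero
  rw [Metric.tendsto_atTop] at htend
  obtain ⟨N, hN⟩ := htend 1 one_pos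
  have hN' : ∀ k, N ≤ k → ‖algebraMap ℚ_[p] K (x k) * ((1 + y) ^ p ^ k - 1)‖ ≤ 1 := fun k hk ↦ by
    have := hN k hk; rw [dist_zero_right] at this; exact this.le
  -- each row `k` is in `K' + 𝒪`
  have hrow : ∀ k, ∃ μ ∈ K', ‖algebraMap ℚ_[p] K (x k) * ((1 + y) ^ p ^ k - 1) - μ‖ ≤ 1 := by
    intro k
    rcases Nat.eq_zero_or_pos k with rfl | hk
    · refine ⟨0, K'.zero_mem, ?_⟩
      rw [sub_zero, pow_zero, pow_one, add_sub_cancel_left, norm_mul, norm_algebraMap_padic]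
      calc ‖x 0‖ * ‖y‖ ≤ Real.sqrt p ^ 0 * 1 := mul_le_mul (hxb 0) hy.le (norm_nonneg _) (by positivity)
        _ = 1 := by rw [pow_zero, one_mul]
    · have hz : ‖1 + y‖ ≤ 1 := (IsUltrametricDist.norm_add_le_max _ _).trans (max_le (by rw [norm_one]) hy.le)
      obtain ⟨s, hs, hs1, hse⟩ := exists_norm_pow_sub_le K' hFrob hz hk
      refine ⟨algebraMap ℚ_[p] K (x k) * (s - 1), K'.mul_mem (hK' _) (K'.sub_mem hs K'.one_mem), ?_⟩
      have e : algebraMap ℚ_[p] K (x k) * ((1 + y) ^ p ^ k - 1) - algebraMap ℚ_[p] K (x k) * (s - 1) =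
          algebraMap ℚ_[p] K (x k) * ((1 + y) ^ p ^ k - s) := by ring
      rw [e, norm_mul, norm_algebraMap_padic]
      calc ‖x k‖ * ‖(1 + y) ^ p ^ k - s‖ ≤ Real.sqrt p ^ k * ‖(p : K)‖ ^ k :=
            mul_le_mul (hxb k) hse (norm_nonneg _) (by positivity)
        _ = ((Real.sqrt p)⁻¹) ^ k := by rw [norm_natCast_p, sqrt_pow_mul_inv_pow]
        _ ≤ 1 := pow_le_one₀ hr0 hr1.le
  -- assemble: finite part + tail
  choose μ hμK hμ using hrow
  refine ⟨∑ k ∈ range N, μ k, K'.sum_mem fun k _ ↦ hμK k, ?_⟩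
  have hsplit : qEval p K (PowerSeries.mk fun d ↦
        ∑' k : ℕ, x k * (((p ^ k).choose d : ℚ_[p]) - if d = 0 then 1 else 0)) y =
      (∑ k ∈ range N, algebraMap ℚ_[p] K (x k) * ((1 + y) ^ p ^ k - 1)) +
        ∑' k : ℕ, algebraMap ℚ_[p] K (x (k + N)) * ((1 + y) ^ p ^ (k + N) - 1) := by
    rw [← hsum.tsum_eq, ← hsum.summable.sum_add_tsum_nat_add N]
  rw [hsplit, add_sub_right_comm, ← Finset.sum_sub_distrib]
  refine (IsUltrametricDist.norm_add_le_max _ _).trans (max_le ?_ ?_)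
  · exact IsUltrametricDist.norm_sum_le_of_forall_le_of_nonneg zero_le_one fun k _ ↦ hμ k
  · exact IsUltrametricDist.norm_tsum_le_of_forall_le_of_nonneg zero_le_one fun k ↦ hN' _ (by omega)

end SprungHonda

end Literature.NumberTheory.EllipticCurves.Sprung2012.Honda

end Part2

/-!
## Part 3 — port of `Summits/BirchSwinnertonDyer/BirchSwinnertonDyer/Theorems/PrintX8VSInputHondaSystemSprungHondaIso.lean` (6 declarations kept)

# Honda's isomorphism `i = exp_E ∘ ℓ ∈ Xℤ_p⟦X⟧` for a logarithm `ℓ` of the SAME Honda type `p − aT + T²` as `log_E`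
# (`a = a_p(M)`, any supersingular or not, `p` odd), its inverse, and the Honda points `c(y) = P(i(y)) ∈ E₁(K)` with
# `Λ(c(y)) = ℓ(y)`

(Port of the declarations listed in the Part header; the source module's docstring — cell bookkeeping of the BSD
printed-inputs programme — is abridged to its title here.)
-/

section Part3

open scoped _root_.Classical _root_.Topology _root_.NNReal
open _root_.Filter _root_.PowerSeries

namespace Literature.NumberTheory.EllipticCurves.Sprung2012.Honda

namespace SprungHonda

open Literature.RingTheory.FormalGroups (liftInt map_liftInt hondaShift norm_coeff_le_one_of_subst_eq map_subst_apply)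
open Literature.NumberTheory.EllipticCurves.Sprung2012.Honda.HondaFss (hasSubst_formalExp')

/-! ## §1 Honda's isomorphism as a pair of integral series -/

section Formal

variable {p : ℕ} [hp : Fact p.Prime] (M : WeierstrassCurve ℤ_[p])

/-- The formal identities behind `ψ = exp_E ∘ ℓ`: `ψ(0) = 0`, `log_E ∘ ψ = ℓ`, `[X¹]ψ = [X¹]ℓ`. [cite: Kobayashi2003, Thm. 8.3 ii)] -/
theorem formalExp_subst_props {ℓ : ℚ_[p]⟦X⟧} (hℓ0 : constantCoeff ℓ = 0) :
    constantCoeff (PowerSeries.subst ℓ (M.map (PadicInt.Coe.ringHom (p := p))).formalExp) = 0 ∧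
    (M.map (PadicInt.Coe.ringHom (p := p))).formalLog.subst
        (PowerSeries.subst ℓ (M.map (PadicInt.Coe.ringHom (p := p))).formalExp) = ℓ ∧
    coeff 1 (PowerSeries.subst ℓ (M.map (PadicInt.Coe.ringHom (p := p))).formalExp) = coeff 1 ℓ := by
  have hℓs : HasSubst ℓ := HasSubst.of_constantCoeff_zero' hℓ0
  have h0 : constantCoeff (PowerSeries.subst ℓ (M.map (PadicInt.Coe.ringHom (p := p))).formalExp) = 0 := by
    rw [Literature.RingTheory.FormalGroups.constantCoeff_subst_of_constantCoeff_eq_zero hℓ0,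
      (M.map PadicInt.Coe.ringHom).constantCoeff_formalExp]
  have hlog : (M.map (PadicInt.Coe.ringHom (p := p))).formalLog.subst
      (PowerSeries.subst ℓ (M.map (PadicInt.Coe.ringHom (p := p))).formalExp) = ℓ := by
    rw [← PowerSeries.subst_comp_subst_apply (hasSubst_formalExp' p M) hℓs,
      (M.map PadicInt.Coe.ringHom).formalLog_subst_formalExp, PowerSeries.subst_X hℓs]
  refine ⟨h0, hlog, ?_⟩
  have h := congrArg (coeff 1) hlog
  rw [Literature.RingTheory.FormalGroups.coeff_subst_eq_sum h0, Finset.sum_range_succ, Finset.sum_range_succ,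
    Finset.sum_range_zero, zero_add, PowerSeries.coeff_zero_eq_constantCoeff,
    (M.map PadicInt.Coe.ringHom).constantCoeff_formalLog, zero_mul, zero_add,
    (M.map PadicInt.Coe.ringHom).coeff_one_formalLog, one_mul, pow_one] at h
  exact h

variable [hE : (M.map PadicInt.Coe.ringHom).IsElliptic] [hEt : (M.map PadicInt.toZMod).IsElliptic]

/-- **Honda's isomorphism, integrally** (`p` odd): for `ℓ ∈ Xℚ_p⟦X⟧` with `‖[X¹]ℓ‖ = 1` of Honda type `p − aT + T²`,
`a = a_p(M) := HasseManin.tr (M mod p)`, there are `i, j ∈ Xℤ_p⟦X⟧` with `i ∘ j = X = j ∘ i` and `log_E ∘ (i ⊗ ℚ_p) = ℓ`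
(`i = exp_E ∘ ℓ`, `j = exp_ℓ ∘ log_E`; `log_E` is of the same type by the tree's Honda congruences, and two logarithms of one
type give integral transition series — Honda's Thm. 2 via the tree's `norm_coeff_le_one_of_subst_eq`). For `a = 0` these are
the tree's `hondaIso`/`hondaIsoInv`. [cite: Kobayashi2003, Thm. 8.3 ii) and Thm. 8.4] -/
theorem exists_integral_hondaIso (hp2 : p ≠ 2) {ℓ : ℚ_[p]⟦X⟧} (hℓ0 : constantCoeff ℓ = 0) (hℓ1 : ‖coeff 1 ℓ‖ = 1)
    (hℓ : ∀ n, ‖coeff n (hondaShift p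
      (Literature.NumberTheory.EllipticCurves.HasseManin.tr (M.map PadicInt.toZMod) : ℚ_[p]) ℓ)‖ ≤ 1) :
    ∃ i j : ℤ_[p]⟦X⟧, constantCoeff i = 0 ∧ constantCoeff j = 0 ∧ i.subst j = X ∧ j.subst i = X ∧
      (M.map (PadicInt.Coe.ringHom (p := p))).formalLog.subst (i.map PadicInt.Coe.ringHom) = ℓ := by
  obtain ⟨hψ0, hlog, hc1⟩ := formalExp_subst_props M hℓ0
  set ψ : ℚ_[p]⟦X⟧ := PowerSeries.subst ℓ (M.map (PadicInt.Coe.ringHom (p := p))).formalExp with hψdef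
  have hu : IsUnit (coeff 1 ψ) := by
    rw [hc1, isUnit_iff_ne_zero, ← norm_pos_iff, hℓ1]; exact one_pos
  have hψs : HasSubst ψ := HasSubst.of_constantCoeff_zero' hψ0
  set ψ' : ℚ_[p]⟦X⟧ := PowerSeries.substInvOfIsUnit ψ hu with hψ'def
  have hψ'0 : constantCoeff ψ' = 0 := PowerSeries.constantCoeff_substInvOfIsUnit _ _
  have hψ's : HasSubst ψ' := PowerSeries.HasSubst.substInvOfIsUnit _ _
  have hright : ψ.subst ψ' = X := PowerSeries.subst_substInvOfIsUnit_right ψ hψ0 hu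
  have hleft : ψ'.subst ψ = X := PowerSeries.subst_substInvOfIsUnit_left ψ hψ0 hu
  -- `ℓ ∘ ψ' = log_E`
  have hlog' : ℓ.subst ψ' = (M.map (PadicInt.Coe.ringHom (p := p))).formalLog := by
    have h := congrArg (fun F : ℚ_[p]⟦X⟧ ↦ F.subst ψ') hlog
    rw [← h, PowerSeries.subst_comp_subst_apply hψs hψ's, hright, PowerSeries.X_subst]
  -- integrality (Honda)
  have hElog := M.norm_coeff_hondaShift_formalLog_le_one hp2
  have hlog1 : ‖coeff 1 (M.map (PadicInt.Coe.ringHom (p := p))).formalLog‖ = 1 := by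
    rw [(M.map PadicInt.Coe.ringHom).coeff_one_formalLog, norm_one]
  have hint : ∀ n, ‖coeff n ψ‖ ≤ 1 :=
    norm_coeff_le_one_of_subst_eq (p := p) (Padic.norm_int_le_one _) hElog hℓ hlog1 hψ0 hlog
  have hint' : ∀ n, ‖coeff n ψ'‖ ≤ 1 :=
    norm_coeff_le_one_of_subst_eq (p := p) (Padic.norm_int_le_one _) hℓ hElog hℓ1 hψ'0 hlog'
  refine ⟨liftInt ψ hint, liftInt ψ' hint', ?_, ?_, ?_, ?_, ?_⟩
  · have h0 := congrArg (coeff 0) (map_liftInt ψ hint)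
    rw [coeff_map, PowerSeries.coeff_zero_eq_constantCoeff, PowerSeries.coeff_zero_eq_constantCoeff, hψ0] at h0
    exact Subtype.ext h0
  · have h0 := congrArg (coeff 0) (map_liftInt ψ' hint')
    rw [coeff_map, PowerSeries.coeff_zero_eq_constantCoeff, PowerSeries.coeff_zero_eq_constantCoeff, hψ'0] at h0
    exact Subtype.ext h0
  · apply Literature.NumberTheory.EllipticCurves.Sprung2012.Honda.HondaFss.map_injective
    have hj0 : constantCoeff (liftInt ψ' hint') = 0 := by
      have h0 := congrArg (coeff 0) (map_liftInt ψ' hint')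
      rw [coeff_map, PowerSeries.coeff_zero_eq_constantCoeff, PowerSeries.coeff_zero_eq_constantCoeff, hψ'0] at h0
      exact Subtype.ext h0
    rw [map_subst_apply (HasSubst.of_constantCoeff_zero' hj0), map_liftInt, map_liftInt, PowerSeries.map_X]
    exact hright
  · apply Literature.NumberTheory.EllipticCurves.Sprung2012.Honda.HondaFss.map_injective
    have hi0 : constantCoeff (liftInt ψ hint) = 0 := by
      have h0 := congrArg (coeff 0) (map_liftInt ψ hint)
      rw [coeff_map, PowerSeries.coeff_zero_eq_constantCoeff, PowerSeries.coeff_zero_eq_constantCoeff, hψ0] at h0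
      exact Subtype.ext h0
    rw [map_subst_apply (HasSubst.of_constantCoeff_zero' hi0), map_liftInt, map_liftInt, PowerSeries.map_X]
    exact hleft
  · rw [map_liftInt]; exact hlog

end Formal

/-! ## §2 Honda points `c(y) = P(i(y)) ∈ E₁(K)` over a complete ultrametric normed `ℚ_p`-algebra -/

section Points

open Literature.NumberTheory.EllipticCurves.Sprung2012.Honda.BallEval
open Literature.NumberTheory.GaloisRepresentations.LubinTate (unitBall)
open Literature.NumberTheory.EllipticCurves.FormalGroupChart (kernel)

variable {p : ℕ} [hp : Fact p.Prime] {K : Type*} [NontriviallyNormedField K] [NormedAlgebra ℚ_[p] K]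
  [IsUltrametricDist K] [CompleteSpace K] {M : WeierstrassCurve ℤ_[p]} {ℓ : ℚ_[p]⟦X⟧} {i j : ℤ_[p]⟦X⟧}

/-- **`Λ(c(y)) = ℓ(y)`** for the Honda point `c(y) = ptOf (i(y))`, `‖y‖ < 1`, when `i(0) = 0` and `log_E ∘ (i ⊗ ℚ_p) = ℓ`
(`qEval_subst` for the outer series `log_E`, `‖[Xⁿ]log_E‖ ≤ n`). [cite: Kobayashi2003, §8.4 and Lemma 8.9] -/
theorem ptLog_ptOf_hondaIso [(M.map PadicInt.Coe.ringHom).IsElliptic] (hi0 : constantCoeff i = 0)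
    (hlog : (M.map (PadicInt.Coe.ringHom (p := p))).formalLog.subst (i.map PadicInt.Coe.ringHom) = ℓ)
    {y : unitBall K} (hy : ‖(y : K)‖ < 1) :
    ptLog p K M (ptOf p K M (ev₁ p K y (hasEval_of_norm_lt_one hy) i) (norm_ev₁_lt_one_of_constantCoeff hi0 hy)) =
      qEval p K ℓ (y : K) := by
  rw [ptLog, zCoord_ptOf, bLog, ← hlog]
  exact (qEval_subst (K := K) (norm_coeff_logQ_le (p := p) (M := M)) hi0 hy).symm

/-- `i(j(t)) = t` at points of the open unit ball (`i ∘ j = X`). [cite: Kobayashi2003, Thm. 8.3 ii)] -/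
theorem ev₁_hondaIso_ev₁_hondaIsoInv (hj0 : constantCoeff j = 0) (hij : i.subst j = X) {t : unitBall K}
    (ht : ‖(t : K)‖ < 1) :
    ev₁ p K (ev₁ p K t (hasEval_of_norm_lt_one ht) j)
        (hasEval_of_norm_lt_one (norm_ev₁_lt_one_of_constantCoeff hj0 ht)) i = t := by
  rw [← ev₁_subst hj0 (hasEval_of_norm_lt_one ht), hij, ev₁_X]

variable [hE : (M.map PadicInt.Coe.ringHom).IsElliptic]
  [hint : (curveK p K M).IsIntegral (NormedField.valuation (K := K)).integer]

/-- **Every `P ∈ E₁(K)` is a Honda point**: `P = ptOf (i(y))` with `y = j(z P)`, `‖y‖ ≤ ‖z P‖ < 1` (for a pair with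
`i(0) = j(0) = 0`, `i ∘ j = X`). [cite: Kobayashi2003, §8.4] -/
theorem exists_eq_ptOf_hondaIso (hi0 : constantCoeff i = 0) (hj0 : constantCoeff j = 0) (hij : i.subst j = X)
    {P : (curveK p K M).toAffine.Point} (hP : P ∈ kernel (NormedField.valuation (K := K)) (curveK p K M)) :
    ∃ (y : unitBall K) (hy : ‖(y : K)‖ < 1),
      P = ptOf p K M (ev₁ p K y (hasEval_of_norm_lt_one hy) i) (norm_ev₁_lt_one_of_constantCoeff hi0 hy) ∧
        ‖(y : K)‖ ≤ ‖P.zCoord‖ := by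
  set y : unitBall K := ev₁ p K (zBall P hP) (hasEval_of_norm_lt_one (norm_zBall_lt_one hP)) j with hydef
  have hyle : ‖(y : K)‖ ≤ ‖P.zCoord‖ := norm_ev₁_le _ (norm_zBall_lt_one hP).le hj0
  have hy : ‖(y : K)‖ < 1 := hyle.trans_lt (norm_zCoord_lt_one hP)
  refine ⟨y, hy, ?_, hyle⟩
  refine eq_of_zCoord_eq hP (ptOf_mem_kernel _) ?_
  have hyt : ev₁ p K y (hasEval_of_norm_lt_one hy) i = zBall P hP := ev₁_hondaIso_ev₁_hondaIsoInv hj0 hij (norm_zBall_lt_one hP)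
  rw [zCoord_ptOf, hyt]; rfl

/-- **`Λ(E₁(K)) ⊆ K' + 𝒪_K` from the congruence form of `ℓ`**: if `‖ℓ(y) − μ‖ ≤ 1` has a solution `μ ∈ K'` for every
`‖y‖ < 1`, then every `P ∈ E₁(K)` has `‖Λ(P) − μ‖ ≤ 1` for some `μ ∈ K'` (`Λ(P) = ℓ(y)` for the Honda parameter `y` of `P`).
This is Kobayashi's Prop. 8.11 «`Λ(Ê(𝔪_n)) ⊆ 𝔪_n + k_{n−1}`» once the congruence form of `ℓ` is supplied (file 2).
[cite: Kobayashi2003, Prop. 8.11] -/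
theorem exists_mem_norm_ptLog_sub_le_one_of_forall (hi0 : constantCoeff i = 0)
    (hj0 : constantCoeff j = 0) (hij : i.subst j = X)
    (hlog : (M.map (PadicInt.Coe.ringHom (p := p))).formalLog.subst (i.map PadicInt.Coe.ringHom) = ℓ)
    (K' : Subfield K) (hK' : ∀ y : K, ‖y‖ < 1 → ∃ μ ∈ K', ‖qEval p K ℓ y - μ‖ ≤ 1)
    {P : (curveK p K M).toAffine.Point} (hP : P ∈ kernel (NormedField.valuation (K := K)) (curveK p K M)) :
    ∃ μ ∈ K', ‖ptLog p K M P - μ‖ ≤ 1 := by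
  obtain ⟨y, hy, hPy, -⟩ := exists_eq_ptOf_hondaIso hi0 hj0 hij hP
  rw [hPy, ptLog_ptOf_hondaIso hi0 hlog hy]
  exact hK' _ hy

end Points

end SprungHonda

end Literature.NumberTheory.EllipticCurves.Sprung2012.Honda

end Part3

/-!
## Part 4 — port of `Summits/BirchSwinnertonDyer/BirchSwinnertonDyer/Theorems/PrintX8VSInputHondaSystemSprungTowerPoints.lean` (8 declarations kept)

# Sprung's tower points `c_m ∈ E₁(ℚ_p(ζ_{p^m}))` inside `E(ℚ̄_p)`: the values
# `Λ(c_m) = ℓ_m = ∑_{k<m} x_k (ζ_{p^{m−k}} − 1)` and the TRACE IDENTITY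
# `∑_{Gal(k_m/k_{m−1})} σℓ_{m+1} = −p + a ℓ_m − ℓ_{m−1}`

(Port of the declarations listed in the Part header; the source module's docstring — cell bookkeeping of the BSD
printed-inputs programme — is abridged to its title here.)
-/

section Part4

open scoped _root_.Classical _root_.Topology _root_.NNReal
open _root_.Filter _root_.PowerSeries _root_.Finset

namespace Literature.NumberTheory.EllipticCurves.Sprung2012.Honda

namespace SprungHonda

open Literature.NumberTheory.EllipticCurves.Sprung2012.Honda Literature.NumberTheory.EllipticCurves.Sprung2012.Honda.BallEval
open Literature.NumberTheory.EllipticCurves.Sprung2012.Honda.PadicCyclotomicTower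
open Literature.NumberTheory.GaloisRepresentations.LubinTate (unitBall)
open Literature.NumberTheory.EllipticCurves.FormalGroupChart (kernel)

variable {p : ℕ} [hp : Fact p.Prime]

/-! ## §1 The logarithms `ℓ_m = ∑_{k<m} x_k(ζ_{m−k} − 1)` and their traces -/

/-- `ζ_m^{pᵏ} = ζ_{m−k}` (with `ζ_0 = 1` when `k ≥ m`). [cite: Kobayashi2003, Lemma 8.9] -/
theorem zeta_pow_prime_pow (m k : ℕ) : zeta p m ^ p ^ k = zeta p (m - k) := by
  by_cases h : k ≤ m
  · obtain ⟨j, rfl⟩ := Nat.exists_eq_add_of_le' h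
    rw [Nat.add_sub_cancel, zeta_add_pow]
  · push Not at h
    rw [Nat.sub_eq_zero_of_le h.le, zeta_zero, zeta_pow_eq_one_of_le p h.le]

/-- `ℓ_{m+1} = x_0 (ζ_{m+1} − 1) + ∑_{k<m} x_{k+1}(ζ_{m−k} − 1)`. [cite: Kobayashi2003, Lemma 8.9] -/
theorem sprungEll_succ (x : ℕ → ℚ_[p]) (m : ℕ) :
    ∑ k ∈ range (m + 1), algebraMap ℚ_[p] (PadicAlgCl p) (x k) * (zeta p (m + 1 - k) - 1) =
      algebraMap ℚ_[p] (PadicAlgCl p) (x 0) * (zeta p (m + 1) - 1) +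
        ∑ k ∈ range m, algebraMap ℚ_[p] (PadicAlgCl p) (x (k + 1)) * (zeta p (m - k) - 1) := by
  rw [sum_range_succ', Nat.sub_zero, add_comm]
  congr 1
  exact sum_congr rfl fun k _ ↦ by rw [show m + 1 - (k + 1) = m - k by omega]

/-- The terms `x_{k+1}(ζ_{m−k} − 1)` lie in `layer m` and are fixed by `stab p m`. [cite: Kobayashi2003, Lemma 8.9] -/
theorem smul_sprungEll_tail_term (x : ℕ → ℚ_[p]) {m : ℕ} (k : ℕ) {σ : Field.absoluteGaloisGroup ℚ_[p]}
    (hσ : σ ∈ stab p m) :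
    σ • (algebraMap ℚ_[p] (PadicAlgCl p) (x (k + 1)) * (zeta p (m - k) - 1)) =
      algebraMap ℚ_[p] (PadicAlgCl p) (x (k + 1)) * (zeta p (m - k) - 1) := by
  refine smul_eq_self_of_mem_stab hσ ?_
  have hz : zeta p (m - k) ∈ layer p m := layer_mono p (Nat.sub_le m k) (zeta_mem_layer p (m - k))
  exact mul_mem ((layer p m).algebraMap_mem _) (sub_mem hz (one_mem _))

/-- `p · ∑_{k<m} x_{k+1}(ζ_{m−k} − 1) = a ℓ_m − ℓ_{m−1}` for `m ≥ 1`: the recursion `p x_1 = a x_0` (`x_0 = 1`),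
`p x_{k+2} = a x_{k+1} − x_k`, term by term. [cite: Sprung2012, Def. 2.1 and proof of Thm. 2.2 (p. 1487)] -/
theorem p_mul_sprungEll_tail {a : ℤ} {x : ℕ → ℚ_[p]} (hx0 : x 0 = 1) (hx1 : (p : ℚ_[p]) * x 1 = a)
    (hrec : ∀ k, (p : ℚ_[p]) * x (k + 2) = a * x (k + 1) - x k) {m : ℕ} (hm : 1 ≤ m) :
    (p : PadicAlgCl p) * ∑ k ∈ range m, algebraMap ℚ_[p] (PadicAlgCl p) (x (k + 1)) * (zeta p (m - k) - 1) =
      (a : PadicAlgCl p) * ∑ k ∈ range m, algebraMap ℚ_[p] (PadicAlgCl p) (x k) * (zeta p (m - k) - 1) -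
        ∑ k ∈ range (m - 1), algebraMap ℚ_[p] (PadicAlgCl p) (x k) * (zeta p (m - 1 - k) - 1) := by
  obtain ⟨m', rfl⟩ := Nat.exists_eq_add_of_le' hm
  rw [Nat.add_sub_cancel]
  -- images of the recursion in `Ω`
  set X : ℕ → PadicAlgCl p := fun k ↦ algebraMap ℚ_[p] (PadicAlgCl p) (x k) with hX
  have hX0 : X 0 = 1 := by simp [hX, hx0]
  have hX1 : (p : PadicAlgCl p) * X 1 = a := by
    have h := congrArg (algebraMap ℚ_[p] (PadicAlgCl p)) hx1
    rwa [map_mul, map_natCast, map_intCast] at h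
  have hXr : ∀ k, (p : PadicAlgCl p) * X (k + 2) = a * X (k + 1) - X k := fun k ↦ by
    have h := congrArg (algebraMap ℚ_[p] (PadicAlgCl p)) (hrec k)
    rwa [map_mul, map_sub, map_mul, map_natCast, map_intCast] at h
  change (p : PadicAlgCl p) * ∑ k ∈ range (m' + 1), X (k + 1) * (zeta p (m' + 1 - k) - 1) =
    (a : PadicAlgCl p) * ∑ k ∈ range (m' + 1), X k * (zeta p (m' + 1 - k) - 1) -
      ∑ k ∈ range m', X k * (zeta p (m' - k) - 1)
  rw [sum_range_succ' (fun k ↦ X (k + 1) * (zeta p (m' + 1 - k) - 1)),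
    sum_range_succ' (fun k ↦ X k * (zeta p (m' + 1 - k) - 1)), Nat.sub_zero, hX0, one_mul, mul_add, mul_add,
    mul_sum, mul_sum, ← mul_assoc, hX1]
  have hterm : ∀ k ∈ range m', (p : PadicAlgCl p) * (X (k + 1 + 1) * (zeta p (m' + 1 - (k + 1)) - 1)) =
      (a : PadicAlgCl p) * (X (k + 1) * (zeta p (m' + 1 - (k + 1)) - 1)) - X k * (zeta p (m' - k) - 1) := by
    intro k _
    rw [show m' + 1 - (k + 1) = m' - k by omega, ← mul_assoc, hXr k]; ring
  rw [sum_congr rfl hterm, sum_sub_distrib]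
  ring

/-- **The trace identity** for `m ≥ 1`: `∑_{q ∈ stab m / stab (m+1)} q̃ • ℓ_{m+1} = −p + a ℓ_m − ℓ_{m−1}`
(`∑ q̃ • (ζ_{m+1} − 1) = −p`, the other terms of `ℓ_{m+1}` are fixed and counted `p` times). [cite: Sprung2012, Thm. 2.2 (1)]
[cite: Kobayashi2003, Lemma 8.9] -/
theorem sum_smul_sprungEll_succ {a : ℤ} {x : ℕ → ℚ_[p]} (hx0 : x 0 = 1) (hx1 : (p : ℚ_[p]) * x 1 = a)
    (hrec : ∀ k, (p : ℚ_[p]) * x (k + 2) = a * x (k + 1) - x k) {m : ℕ} (hm : 1 ≤ m)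
    [Fintype (stab p m ⧸ (stab p (m + 1)).subgroupOf (stab p m))] :
    ∑ q : stab p m ⧸ (stab p (m + 1)).subgroupOf (stab p m), ((q.out : stab p m) : Field.absoluteGaloisGroup ℚ_[p]) •
        ∑ k ∈ range (m + 1), algebraMap ℚ_[p] (PadicAlgCl p) (x k) * (zeta p (m + 1 - k) - 1) =
      -(p : PadicAlgCl p) + (a : PadicAlgCl p) * ∑ k ∈ range m, algebraMap ℚ_[p] (PadicAlgCl p) (x k) * (zeta p (m - k) - 1) -
        ∑ k ∈ range (m - 1), algebraMap ℚ_[p] (PadicAlgCl p) (x k) * (zeta p (m - 1 - k) - 1) := by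
  simp_rw [sprungEll_succ, hx0, map_one, one_mul, smul_add, smul_sum]
  rw [sum_add_distrib, sum_out_smul_zeta_succ_sub_one, sum_comm]
  have hfix : ∀ k ∈ range m, ∑ q : stab p m ⧸ (stab p (m + 1)).subgroupOf (stab p m),
      ((q.out : stab p m) : Field.absoluteGaloisGroup ℚ_[p]) •
        (algebraMap ℚ_[p] (PadicAlgCl p) (x (k + 1)) * (zeta p (m - k) - 1)) =
      (p : PadicAlgCl p) * (algebraMap ℚ_[p] (PadicAlgCl p) (x (k + 1)) * (zeta p (m - k) - 1)) := by
    intro k _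
    rw [sum_out_smul_of_forall_smul_eq m fun σ hσ ↦ smul_sprungEll_tail_term x k hσ,
      index_subgroupOf_stab_succ, if_neg (by omega), nsmul_eq_mul]
  rw [sum_congr rfl hfix, ← mul_sum, p_mul_sprungEll_tail hx0 hx1 hrec hm]
  ring

/-- **The trace identity at the bottom**: `∑_{q ∈ Γ / stab 1} q̃ • ℓ_1 = −p` (`ℓ_1 = ζ_1 − 1`). [cite: Sprung2012, Thm. 2.2 (2)]
[cite: Kobayashi2003, Lemma 8.9] -/
theorem sum_smul_sprungEll_one {x : ℕ → ℚ_[p]} (hx0 : x 0 = 1) [Fintype (stab p 0 ⧸ (stab p 1).subgroupOf (stab p 0))] :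
    ∑ q : stab p 0 ⧸ (stab p 1).subgroupOf (stab p 0), ((q.out : stab p 0) : Field.absoluteGaloisGroup ℚ_[p]) •
        ∑ k ∈ range 1, algebraMap ℚ_[p] (PadicAlgCl p) (x k) * (zeta p (1 - k) - 1) = -(p : PadicAlgCl p) := by
  simp_rw [sum_range_one, Nat.sub_zero, hx0, map_one, one_mul]
  exact sum_out_smul_zeta_succ_sub_one p 0

/-- The tail of `ℓ_m` lies in `layer (m−1)`: **`ℓ_m − (ζ_m − 1) ∈ layer (m − 1)`** (`m ≥ 1`, `x_0 = 1`). [cite: Kobayashi2003, Lemma 8.9] -/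
theorem sprungEll_sub_mem_layer_pred {x : ℕ → ℚ_[p]} (hx0 : x 0 = 1) {m : ℕ} (hm : 1 ≤ m) :
    ∑ k ∈ range m, algebraMap ℚ_[p] (PadicAlgCl p) (x k) * (zeta p (m - k) - 1) - (zeta p m - 1) ∈ layer p (m - 1) := by
  obtain ⟨m', rfl⟩ := Nat.exists_eq_add_of_le' hm
  rw [sprungEll_succ, hx0, map_one, one_mul, add_sub_cancel_left, Nat.add_sub_cancel]
  refine Subalgebra.sum_mem _ fun k _ ↦ ?_
  have hz : zeta p (m' - k) ∈ layer p m' := layer_mono p (Nat.sub_le m' k) (zeta_mem_layer p (m' - k))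
  exact IntermediateField.mul_mem _ ((layer p m').algebraMap_mem _) (IntermediateField.sub_mem _ hz (IntermediateField.one_mem _))

section Points

variable {M : WeierstrassCurve ℤ_[p]} [hE : (M.map PadicInt.Coe.ringHom).IsElliptic]

/-- **Sprung's / Kobayashi's tower points, existentially** (def-free): for the Sprung sequence `x` (growth `‖x k‖ ≤ (√p)ᵏ`) and an
integral Honda isomorphism `i` with `log_E ∘ (i ⊗ ℚ_p) = log_{F_ss}` (file 3), there are points `c_m ∈ E(ℚ̄_p)` with `c_0 = O`,
**`c_m ∈ L(m) ∩ E₁`** and **`Λ(c_m) = ℓ_m = ∑_{k<m} x_k(ζ_{m−k} − 1)`** — the Honda point of `ζ_m − 1` in the complete layer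
`ℚ_p(ζ_m)` (`(1 + (ζ_m − 1))^{pᵏ} = ζ_{m−k}`, `= 1` for `k ≥ m`: the finite form of `log_{F_ss}`, file 2).
[cite: Sprung2012, proof of Thm. 2.2 (p. 1487)] [cite: Kobayashi2003, Def. 8.8 and Lemma 8.9] -/
theorem exists_sprungTowerPoints {x : ℕ → ℚ_[p]} (hxb : ∀ k, ‖x k‖ ≤ Real.sqrt p ^ k) {i : ℤ_[p]⟦X⟧}
    (hi0 : constantCoeff i = 0)
    (hlog : (M.map (PadicInt.Coe.ringHom (p := p))).formalLog.subst (i.map PadicInt.Coe.ringHom) =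
      PowerSeries.mk fun d ↦ ∑' k : ℕ, x k * (((p ^ k).choose d : ℚ_[p]) - if d = 0 then 1 else 0)) :
    haveI := isIntegral_genFib_baseChange p M
    ∃ c : ℕ → (genFibΩ p M).toAffine.Point, c 0 = 0 ∧
      (∀ m, c m ∈ subfieldPoints (genFibΩ p M) (layer p m).toSubfield coeffs_mem_layer) ∧
      (∀ m, c m ∈ kernel (Valued.v (R := PadicAlgCl p)) (genFibΩ p M)) ∧
      (∀ m, ptLogΩ p M (c m) = ∑ k ∈ range m, algebraMap ℚ_[p] (PadicAlgCl p) (x k) * (zeta p (m - k) - 1)) := by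
  haveI := isIntegral_genFib_baseChange p M
  -- the Honda point of `ζ_m − 1` in the complete layer `K_m = LayerField p m`, embedded
  let c : ℕ → (genFibΩ p M).toAffine.Point := fun m ↦
    if hm : 1 ≤ m then toOmega p M m (ptOf p (LayerField p m) M
      (ev₁ p (LayerField p m) (towerParam p m) (hasEval_of_norm_lt_one (norm_towerParam_lt_one hm)) i)
      (norm_ev₁_lt_one_of_constantCoeff hi0 (norm_towerParam_lt_one hm))) else 0
  have hc_pos : ∀ {m : ℕ} (hm : 1 ≤ m), c m = toOmega p M m (ptOf p (LayerField p m) M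
      (ev₁ p (LayerField p m) (towerParam p m) (hasEval_of_norm_lt_one (norm_towerParam_lt_one hm)) i)
      (norm_ev₁_lt_one_of_constantCoeff hi0 (norm_towerParam_lt_one hm))) := fun hm ↦ dif_pos hm
  have hc0 : c 0 = 0 := dif_neg (by omega)
  refine ⟨c, hc0, fun m ↦ ?_, fun m ↦ ?_, fun m ↦ ?_⟩
  · by_cases hm : 1 ≤ m
    · rw [hc_pos hm]; exact toOmega_mem_subfieldPoints _
    · rw [show m = 0 by omega, hc0]; exact (subfieldPoints _ _ _).zero_mem
  · by_cases hm : 1 ≤ m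
    · haveI := isIntegral_curveK p (LayerField p m) M
      rw [hc_pos hm]
      exact (toOmega_mem_kernel_iff _).mpr (ptOf_mem_kernel _)
    · rw [show m = 0 by omega, hc0]; exact (kernel (Valued.v (R := PadicAlgCl p)) (genFibΩ p M)).zero_mem
  · by_cases hm : 1 ≤ m
    · haveI := isIntegral_curveK p (LayerField p m) M
      rw [hc_pos hm, ptLogΩ_toOmega (ptOf_mem_kernel _), ptLog_ptOf_hondaIso hi0 hlog (norm_towerParam_lt_one hm),
        qEval_sprungLog_eq_sum_of_pow_eq_one (k₀ := m) hxb (norm_towerParam_lt_one hm) ?_]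
      · rw [map_sum]
        refine sum_congr rfl fun k _ ↦ ?_
        rw [map_mul, AlgHom.commutes, map_sub, map_pow, map_add, map_one, emb_towerParam, add_sub_cancel,
          zeta_pow_prime_pow]
      · intro k hk
        apply LayerField.emb_injective
        rw [map_pow, map_add, map_one, emb_towerParam, add_sub_cancel, zeta_pow_eq_one_of_le p hk]
    · rw [show m = 0 by omega, hc0, ptLogΩ_zero, sum_range_zero]

end Points

end SprungHonda

end Literature.NumberTheory.EllipticCurves.Sprung2012.Honda

end Part4

/-!
## Part 5 — port of `Summits/BirchSwinnertonDyer/Rank1Residual/Additive/KobayashiLayerLogDescent.lean` (9 declarations kept)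

# Layer descent by the logarithm: a subgroup of `E₁(k_m)` that is `p`-divisible modulo `E₁(k_{m'})`
# lies in `E₁(k_{m'})`; test points with prescribed logarithm

(Port of the declarations listed in the Part header; the source module's docstring — cell bookkeeping of the BSD
printed-inputs programme — is abridged to its title here.)
-/

section Part5

open scoped _root_.Classical _root_.Topology _root_.NNReal
open _root_.Filter _root_.PowerSeries _root_.Finset

namespace Literature.NumberTheory.EllipticCurves.Sprung2012.Honda

namespace BallEval

open Literature.NumberTheory.GaloisRepresentations.LubinTate (unitBall mem_unitBall_iff)
open Literature.NumberTheory.EllipticCurves Literature.NumberTheory.EllipticCurves.FormalGroupChart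
open _root_.WeierstrassCurve PadicCyclotomicTower _root_.Field

variable (p : ℕ) [hp : Fact p.Prime]

/-! ## §1 The value group of the layer is discrete -/

variable (M : WeierstrassCurve ℤ_[p]) [hE : (M.map PadicInt.Coe.ringHom).IsElliptic]

variable {p M}
variable [hintΩ : (genFibΩ p M).IsIntegral (Valued.v (R := PadicAlgCl p)).integer]

omit hE in
/-- `‖z Q‖ < 1` on `E₁(Ω)`. [cite: SilvermanAEC2009, IV.6.4] -/
theorem norm_zCoord_lt_one_of_mem_kernel {Q : (genFibΩ p M).toAffine.Point}
    (hk : Q ∈ kernel (Valued.v (R := PadicAlgCl p)) (genFibΩ p M)) : ‖Q.zCoord‖ < 1 := by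
  have := val_zCoord_lt_one hk
  rwa [PadicAlgCl.valuation_def, ← NNReal.coe_lt_coe, coe_nnnorm, NNReal.coe_one] at this

omit hE hintΩ in
/-- `z Q ∈ layer m` for `Q ∈ L(m)`. [cite: SilvermanAEC2009, IV.6.4] -/
theorem zCoord_mem_layer {m : ℕ} {Q : (genFibΩ p M).toAffine.Point}
    (hQ : Q ∈ subfieldPoints (genFibΩ p M) (layer p m).toSubfield coeffs_mem_layer) :
    Q.zCoord ∈ layer p m := by
  obtain ⟨P, rfl⟩ := exists_toOmega_eq hQ
  rw [zCoord_toOmega]; exact LayerField.emb_mem _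

omit hE in
/-- **The isometry at depth, on `Ω`-points**: `‖Λ Q‖ = ‖z Q‖` for `Q ∈ L(m) ∩ E₁` with `‖z Q‖ < 1/2`.
[cite: SilvermanAEC2009, IV.6.4] -/
theorem norm_ptLogΩ_eq_of_lt_half {m : ℕ} {Q : (genFibΩ p M).toAffine.Point}
    (hQ : Q ∈ subfieldPoints (genFibΩ p M) (layer p m).toSubfield coeffs_mem_layer)
    (hk : Q ∈ kernel (Valued.v (R := PadicAlgCl p)) (genFibΩ p M)) (hlt : ‖Q.zCoord‖ < 1 / 2) :
    ‖ptLogΩ p M Q‖ = ‖Q.zCoord‖ := by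
  haveI := isIntegral_curveK p (LayerField p m) M
  obtain ⟨P, rfl⟩ := exists_toOmega_eq hQ
  have hP : P ∈ kernel (NormedField.valuation (K := LayerField p m)) (curveK p (LayerField p m) M) :=
    (toOmega_mem_kernel_iff P).mp hk
  rw [zCoord_toOmega, LayerField.norm_emb] at hlt ⊢
  rw [ptLogΩ_toOmega hP, LayerField.norm_emb, norm_ptLog_eq hlt]

omit hE in
/-- **`Λ(L(m) ∩ E₁) ⊆ layer m`** (the series has coefficients in `ℚ_p` and converges in the complete
field `ℚ_p(ζ_{p^m})`). [cite: Kobayashi2003, §8.4] -/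
theorem ptLogΩ_mem_layer {m : ℕ} {Q : (genFibΩ p M).toAffine.Point}
    (hQ : Q ∈ subfieldPoints (genFibΩ p M) (layer p m).toSubfield coeffs_mem_layer)
    (hk : Q ∈ kernel (Valued.v (R := PadicAlgCl p)) (genFibΩ p M)) : ptLogΩ p M Q ∈ layer p m := by
  haveI := isIntegral_curveK p (LayerField p m) M
  obtain ⟨P, rfl⟩ := exists_toOmega_eq hQ
  have hP : P ∈ kernel (NormedField.valuation (K := LayerField p m)) (curveK p (LayerField p m) M) :=
    (toOmega_mem_kernel_iff P).mp hk
  rw [ptLogΩ_toOmega hP]; exact LayerField.emb_mem _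

omit hintΩ in
/-- `Λ(−P) = −Λ(P)` on `E₁(K)`. [cite: SilvermanAEC2009, IV.6.4] -/
theorem ptLog_neg {K : Type*} [NontriviallyNormedField K] [NormedAlgebra ℚ_[p] K] [IsUltrametricDist K]
    [CompleteSpace K] [(curveK p K M).IsIntegral (NormedField.valuation (K := K)).integer]
    {P : (curveK p K M).toAffine.Point} (hP : P ∈ kernel (NormedField.valuation (K := K)) (curveK p K M)) :
    ptLog p K M (-P) = -ptLog p K M P := by
  have h := ptLog_add hP ((kernel (NormedField.valuation (K := K)) (curveK p K M)).neg_mem hP)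
  rw [add_neg_cancel, ptLog_zero] at h
  linear_combination -h

omit hintΩ in
/-- `Λ(n • P) = n Λ(P)` on `E₁(K)` for `n ∈ ℤ`. [cite: SilvermanAEC2009, IV.6.4] -/
theorem ptLog_zsmul {K : Type*} [NontriviallyNormedField K] [NormedAlgebra ℚ_[p] K] [IsUltrametricDist K]
    [CompleteSpace K] [(curveK p K M).IsIntegral (NormedField.valuation (K := K)).integer]
    {P : (curveK p K M).toAffine.Point} (hP : P ∈ kernel (NormedField.valuation (K := K)) (curveK p K M))
    (n : ℤ) : ptLog p K M (n • P) = n * ptLog p K M P := by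
  cases n with
  | ofNat k => rw [Int.ofNat_eq_natCast, natCast_zsmul, ptLog_nsmul hP k, Int.cast_natCast]
  | negSucc k =>
    rw [negSucc_zsmul, ptLog_neg ((kernel (NormedField.valuation (K := K)) (curveK p K M)).nsmul_mem hP _),
      ptLog_nsmul hP (k + 1), Int.cast_negSucc, neg_mul]

/-- **`Λ(n • Q) = n Λ(Q)`** on `L(m) ∩ E₁`, `n ∈ ℤ`. [cite: SilvermanAEC2009, IV.6.4] -/
theorem ptLogΩ_zsmul {m : ℕ} {Q : (genFibΩ p M).toAffine.Point}
    (hQ : Q ∈ subfieldPoints (genFibΩ p M) (layer p m).toSubfield coeffs_mem_layer)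
    (hk : Q ∈ kernel (Valued.v (R := PadicAlgCl p)) (genFibΩ p M)) (n : ℤ) :
    ptLogΩ p M (n • Q) = n * ptLogΩ p M Q := by
  haveI := isIntegral_curveK p (LayerField p m) M
  obtain ⟨P, rfl⟩ := exists_toOmega_eq hQ
  have hP : P ∈ kernel (NormedField.valuation (K := LayerField p m)) (curveK p (LayerField p m) M) :=
    (toOmega_mem_kernel_iff P).mp hk
  rw [← map_zsmul, ptLogΩ_toOmega hP,
    ptLogΩ_toOmega ((kernel (NormedField.valuation (K := LayerField p m)) (curveK p (LayerField p m) M)).zsmul_mem hP n),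
    ptLog_zsmul hP n, map_mul, map_intCast]

/-- `Λ(n • Q) = n Λ(Q)` on `L(m) ∩ E₁`, `n ∈ ℕ`. [cite: SilvermanAEC2009, IV.6.4] -/
theorem ptLogΩ_nsmul {m : ℕ} {Q : (genFibΩ p M).toAffine.Point}
    (hQ : Q ∈ subfieldPoints (genFibΩ p M) (layer p m).toSubfield coeffs_mem_layer)
    (hk : Q ∈ kernel (Valued.v (R := PadicAlgCl p)) (genFibΩ p M)) (n : ℕ) :
    ptLogΩ p M (n • Q) = n * ptLogΩ p M Q := by
  have h := ptLogΩ_zsmul hQ hk (n : ℤ)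
  rwa [natCast_zsmul, Int.cast_natCast] at h

/-! ## §3 Layer descent -/

/-- **Test points**: every `z ∈ layer m` with `‖z‖ ≤ 1/4` is the logarithm of a point of
`L(m) ∩ E₁` (local surjectivity of `Λ` on `E₁(ℚ_p(ζ_{p^m}))`, transported to `Ω`).
[cite: SilvermanAEC2009, IV.6.4] -/
theorem exists_mem_kernel_ptLogΩ_eq {m : ℕ} {z : PadicAlgCl p} (hz : z ∈ layer p m) (hz4 : ‖z‖ ≤ 1 / 4) :
    ∃ Q ∈ subfieldPoints (genFibΩ p M) (layer p m).toSubfield coeffs_mem_layer,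
      Q ∈ kernel (Valued.v (R := PadicAlgCl p)) (genFibΩ p M) ∧ ptLogΩ p M Q = z := by
  haveI := isIntegral_curveK p (LayerField p m) M
  set y : LayerField p m := LayerField.mk p m z hz with hy
  have hy4 : ‖y‖ ≤ 1 / 4 := by rw [← LayerField.norm_emb, hy, LayerField.emb_mk]; exact hz4
  obtain ⟨P, hP, hPy, -⟩ := exists_ptLog_eq (p := p) (K := LayerField p m) (M := M) hy4
  refine ⟨toOmega p M m P, toOmega_mem_subfieldPoints P, (toOmega_mem_kernel_iff P).mpr hP, ?_⟩
  rw [ptLogΩ_toOmega hP, hPy, hy, LayerField.emb_mk]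

end BallEval

end Literature.NumberTheory.EllipticCurves.Sprung2012.Honda

end Part5

/-!
## Part 6 — port of `Summits/BirchSwinnertonDyer/BirchSwinnertonDyer/Theorems/PrintX8VSInputHondaSystemSprungTowerGeneration.lean` (5 declarations kept)

# The generation step `E₁(K_m) = ℤ[Γ·c_m] + pE₁(K_m) + E₁(K_{m−1})` and the trace relations
# `Tr_{m+1/m} c_{m+1} − a·c_m + c_{m−1} ∈ E(ℚ_p)` for Sprung's tower points

(Port of the declarations listed in the Part header; the source module's docstring — cell bookkeeping of the BSD
printed-inputs programme — is abridged to its title here.)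
-/

section Part6

open scoped _root_.Classical _root_.Topology _root_.NNReal
open _root_.Filter _root_.PowerSeries _root_.Finset

namespace Literature.NumberTheory.EllipticCurves.Sprung2012.Honda

namespace SprungHonda

open Literature.NumberTheory.EllipticCurves.Sprung2012.Honda Literature.NumberTheory.EllipticCurves.Sprung2012.Honda.BallEval
open Literature.NumberTheory.EllipticCurves.Sprung2012.Honda.PadicCyclotomicTower
open Literature.NumberTheory.GaloisRepresentations.LubinTate (unitBall)
open Literature.NumberTheory.EllipticCurves.FormalGroupChart (kernel val_zCoord_lt_one)
open _root_.WeierstrassCurve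

variable {p : ℕ} [hp : Fact p.Prime] {M : WeierstrassCurve ℤ_[p]} [hE : (M.map PadicInt.Coe.ringHom).IsElliptic]
variable [hintΩ : (genFibΩ p M).IsIntegral (Valued.v (R := PadicAlgCl p)).integer]

/-! ## §1 The closure correspondence -/

/-- **The closure correspondence**: if `Λ(c) = ℓ_m` with `ℓ_m − (ζ_m − 1) ∈ layer (m−1)` and `c ∈ L(m) ∩ E₁`, then every
`z ∈ ℤ[Γ·ζ_m]` is `Λ(B)` modulo `layer (m−1)` for some `B ∈ ℤ[Γ·c] ⊆ L(m) ∩ E₁`. [cite: Kobayashi2003, Prop. 8.11] -/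
theorem exists_closure_pt_sprung
    (act : Field.absoluteGaloisGroup ℚ_[p] → (genFibΩ p M).toAffine.Point → (genFibΩ p M).toAffine.Point)
    (hact0 : ∀ σ, act σ 0 = 0)
    (hact : ∀ σ (x y : PadicAlgCl p) (h : (genFibΩ p M).toAffine.Nonsingular x y),
      ∃ h', act σ (Affine.Point.some x y h) = Affine.Point.some (σ • x) (σ • y) h')
    {m : ℕ} {c : (genFibΩ p M).toAffine.Point}
    (hcL : c ∈ subfieldPoints (genFibΩ p M) (layer p m).toSubfield coeffs_mem_layer)
    (hck : c ∈ kernel (Valued.v (R := PadicAlgCl p)) (genFibΩ p M))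
    {ℓ : PadicAlgCl p} (hcΛ : ptLogΩ p M c = ℓ) (hℓ : ℓ - (zeta p m - 1) ∈ layer p (m - 1))
    {z : PadicAlgCl p}
    (hz : z ∈ AddSubgroup.closure (Set.range fun σ : Field.absoluteGaloisGroup ℚ_[p] ↦ σ • zeta p m)) :
    ∃ B ∈ AddSubgroup.closure (Set.range fun σ : Field.absoluteGaloisGroup ℚ_[p] ↦ act σ c),
      B ∈ subfieldPoints (genFibΩ p M) (layer p m).toSubfield coeffs_mem_layer ∧
      B ∈ kernel (Valued.v (R := PadicAlgCl p)) (genFibΩ p M) ∧ ptLogΩ p M B - z ∈ layer p (m - 1) := by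
  haveI := isIntegral_curveK p (LayerField p m) M
  have hcz : ‖c.zCoord‖ < 1 := by
    have := val_zCoord_lt_one hck
    rwa [PadicAlgCl.valuation_def, ← NNReal.coe_lt_coe, coe_nnnorm, NNReal.coe_one] at this
  induction hz using AddSubgroup.closure_induction with
  | mem x hx =>
    obtain ⟨σ, rfl⟩ := hx
    refine ⟨act σ c, AddSubgroup.subset_closure ⟨σ, rfl⟩,
      act_mem_subfieldPoints act hact0 hact σ hcL, act_mem_kernel act hact0 hact σ hck, ?_⟩
    rw [ptLogΩ_act act hact0 hact σ hcz, hcΛ]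
    have e : σ • ℓ - σ • zeta p m = σ • (ℓ - (zeta p m - 1)) - 1 := by
      rw [smul_sub, smul_sub, smul_one]; ring
    change σ • ℓ - σ • zeta p m ∈ layer p (m - 1)
    rw [e]
    exact IntermediateField.sub_mem _ (smul_mem_layer σ hℓ) (IntermediateField.one_mem _)
  | zero =>
    refine ⟨0, AddSubgroup.zero_mem _, (subfieldPoints _ _ _).zero_mem,
      (kernel (Valued.v (R := PadicAlgCl p)) (genFibΩ p M)).zero_mem, ?_⟩
    rw [ptLogΩ_zero, sub_zero]; exact IntermediateField.zero_mem _
  | add u v _ _ ihu ihv =>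
    obtain ⟨B₁, hB₁, hB₁L, hB₁k, h₁⟩ := ihu
    obtain ⟨B₂, hB₂, hB₂L, hB₂k, h₂⟩ := ihv
    refine ⟨B₁ + B₂, AddSubgroup.add_mem _ hB₁ hB₂, (subfieldPoints _ _ _).add_mem hB₁L hB₂L,
      (kernel (Valued.v (R := PadicAlgCl p)) (genFibΩ p M)).add_mem hB₁k hB₂k, ?_⟩
    rw [ptLogΩ_add (m := m) hB₁L hB₂L hB₁k hB₂k]
    have e : ptLogΩ p M B₁ + ptLogΩ p M B₂ - (u + v) = (ptLogΩ p M B₁ - u) + (ptLogΩ p M B₂ - v) := by ring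
    rw [e]; exact IntermediateField.add_mem _ h₁ h₂
  | neg u _ ih =>
    obtain ⟨B, hB, hBL, hBk, h⟩ := ih
    refine ⟨-B, AddSubgroup.neg_mem _ hB, (subfieldPoints _ _ _).neg_mem hBL,
      (kernel (Valued.v (R := PadicAlgCl p)) (genFibΩ p M)).neg_mem hBk, ?_⟩
    have hneg : ptLogΩ p M (-B) = -ptLogΩ p M B := by
      have h0 := ptLogΩ_sub (m := m) (subfieldPoints _ _ _).zero_mem hBL
        (kernel (Valued.v (R := PadicAlgCl p)) (genFibΩ p M)).zero_mem hBk
      rw [zero_sub, ptLogΩ_zero, zero_sub] at h0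
      exact h0
    rw [hneg]
    have e : -ptLogΩ p M B - -u = -(ptLogΩ p M B - u) := by ring
    rw [e]; exact IntermediateField.neg_mem _ h

/-! ## §2 The generation step -/

/-- The subfield `K_{m−1} ⊆ K_m = LayerField p m` contains `ℚ_p`. [cite: Kobayashi2003, Lemma 8.9] -/
theorem algebraMap_mem_comap_layer (m m' : ℕ) (q : ℚ_[p]) :
    algebraMap ℚ_[p] (LayerField p m) q ∈ Subfield.comap (LayerField.emb p m).toRingHom (layer p m').toSubfield := by
  change LayerField.emb p m (algebraMap ℚ_[p] (LayerField p m) q) ∈ (layer p m').toSubfield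
  rw [AlgHom.commutes]
  exact (layer p m').algebraMap_mem q

/-- **The generation step** (Kobayashi Prop. 8.11 ⇒ Prop. 8.12 ii) for Sprung's points): for `m ≥ 1`, `p` odd, a tower point
`c ∈ L(m) ∩ E₁` with `Λ(c) = ℓ_m`, `ℓ_m − (ζ_m − 1) ∈ layer (m−1)`, an integral Honda pair `(i, j)` for the Sprung logarithm, and
`P ∈ L(m) ∩ E₁`, there are `B ∈ ℤ[Γ·c]` and `R ∈ L(m) ∩ E₁` with `P − B − p•R ∈ L(m−1)` — provided `L(m)` has no `p`-power torsion.
[cite: Kobayashi2003, Prop. 8.11 and Prop. 8.12] [cite: Sprung2012, Lemmas 7.4–7.5] -/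
theorem exists_sub_closure_sub_smul_mem_sprung (hp2 : p ≠ 2) {x : ℕ → ℚ_[p]} (hxb : ∀ k, ‖x k‖ ≤ Real.sqrt p ^ k)
    {i j : ℤ_[p]⟦X⟧} (hi0 : constantCoeff i = 0) (hj0 : constantCoeff j = 0) (hij : i.subst j = X)
    (hlog : (M.map (PadicInt.Coe.ringHom (p := p))).formalLog.subst (i.map PadicInt.Coe.ringHom) =
      PowerSeries.mk fun d ↦ ∑' k : ℕ, x k * (((p ^ k).choose d : ℚ_[p]) - if d = 0 then 1 else 0))
    (act : Field.absoluteGaloisGroup ℚ_[p] → (genFibΩ p M).toAffine.Point → (genFibΩ p M).toAffine.Point)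
    (hact0 : ∀ σ, act σ 0 = 0)
    (hact : ∀ σ (x y : PadicAlgCl p) (h : (genFibΩ p M).toAffine.Nonsingular x y),
      ∃ h', act σ (Affine.Point.some x y h) = Affine.Point.some (σ • x) (σ • y) h')
    {m : ℕ} (hm : 1 ≤ m)
    (htors : ∀ Q ∈ subfieldPoints (genFibΩ p M) (layer p m).toSubfield coeffs_mem_layer, ∀ k : ℕ, p ^ k • Q = 0 → Q = 0)
    {c : (genFibΩ p M).toAffine.Point}
    (hcL : c ∈ subfieldPoints (genFibΩ p M) (layer p m).toSubfield coeffs_mem_layer)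
    (hck : c ∈ kernel (Valued.v (R := PadicAlgCl p)) (genFibΩ p M))
    (hcΛ : ptLogΩ p M c = ∑ k ∈ range m, algebraMap ℚ_[p] (PadicAlgCl p) (x k) * (zeta p (m - k) - 1))
    (hx0 : x 0 = 1)
    {P : (genFibΩ p M).toAffine.Point} (hP : P ∈ subfieldPoints (genFibΩ p M) (layer p m).toSubfield coeffs_mem_layer)
    (hPk : P ∈ kernel (Valued.v (R := PadicAlgCl p)) (genFibΩ p M)) :
    ∃ B ∈ AddSubgroup.closure (Set.range fun σ : Field.absoluteGaloisGroup ℚ_[p] ↦ act σ c),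
      ∃ R ∈ subfieldPoints (genFibΩ p M) (layer p m).toSubfield coeffs_mem_layer,
        R ∈ kernel (Valued.v (R := PadicAlgCl p)) (genFibΩ p M) ∧
        P - B - p • R ∈ subfieldPoints (genFibΩ p M) (layer p (m - 1)).toSubfield coeffs_mem_layer := by
  haveI := isIntegral_curveK p (LayerField p m) M
  -- lift `P` to `K = K_m`
  obtain ⟨PK, rfl⟩ := exists_toOmega_eq hP
  have hPKk : PK ∈ kernel (NormedField.valuation (K := LayerField p m)) (curveK p (LayerField p m) M) :=
    (toOmega_mem_kernel_iff PK).mp hPk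
  -- (BR1): `Λ(P) = μ₀ + y`, `μ₀ ∈ K_{m−1}`, `‖y‖ ≤ 1`
  set K' : Subfield (LayerField p m) := Subfield.comap (LayerField.emb p m).toRingHom (layer p (m - 1)).toSubfield with hK'
  have hcongr : ∀ y : LayerField p m, ‖y‖ < 1 → ∃ μ ∈ K', ‖qEval p (LayerField p m)
      (PowerSeries.mk fun d ↦ ∑' k : ℕ, x k * (((p ^ k).choose d : ℚ_[p]) - if d = 0 then 1 else 0)) y - μ‖ ≤ 1 :=
    fun y hy ↦ exists_mem_norm_qEval_sprungLog_sub_le_one hxb K' (algebraMap_mem_comap_layer m (m - 1))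
      (frob_layerField hp2 hm) hy
  obtain ⟨μ₀, hμ₀, hμ₀y⟩ := exists_mem_norm_ptLog_sub_le_one_of_forall hi0 hj0 hij hlog K' hcongr hPKk
  set y : LayerField p m := ptLog p (LayerField p m) M PK - μ₀ with hy
  have hμ₀L : LayerField.emb p m μ₀ ∈ layer p (m - 1) := hμ₀
  -- (DEC): `emb y − p³ y'Ω ∈ ℤ[Γ·ζ_m] + layer (m−1)`
  obtain ⟨y'Ω, hy'L, hy'1, hdec⟩ := exists_sub_pow_mul_mem_closure_sup p hm (LayerField.emb_mem y)
    (by rw [LayerField.norm_emb]; exact hμ₀y) 3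
  obtain ⟨z, hz, ν, hν, hzν⟩ := AddSubgroup.mem_sup.mp hdec
  have hνL : ν ∈ layer p (m - 1) := hν
  -- local surjectivity: `p³ y' = Λ(p • RK)`
  set y'K : LayerField p m := LayerField.mk p m y'Ω hy'L with hy'K
  have hp1 : ‖(p : LayerField p m)‖ = (p : ℝ)⁻¹ := by
    rw [← LayerField.norm_emb, map_natCast, ← map_natCast (algebraMap ℚ_[p] (PadicAlgCl p)) p]
    exact (PadicAlgCl.norm_extends (p := p) (p : ℚ_[p])).trans Padic.norm_p
  have htarget : ‖(p : LayerField p m) ^ 2 * y'K‖ ≤ 1 / 4 := by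
    rw [norm_mul, norm_pow, hp1]
    have hy'n : ‖y'K‖ ≤ 1 := by rw [hy'K, ← LayerField.norm_emb, LayerField.emb_mk]; exact hy'1
    have hp2' : (2 : ℝ) ≤ p := by exact_mod_cast hp.out.two_le
    have hinv : (p : ℝ)⁻¹ ≤ 1 / 2 := by rw [one_div]; exact inv_anti₀ two_pos hp2'
    calc (p : ℝ)⁻¹ ^ 2 * ‖y'K‖ ≤ (1 / 2) ^ 2 * 1 :=
          mul_le_mul (pow_le_pow_left₀ (by positivity) hinv 2) hy'n (norm_nonneg _) (by positivity)
      _ = 1 / 4 := by norm_num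
  obtain ⟨RK, hRKk, hΛR, -⟩ := exists_ptLog_eq (p := p) (M := M) htarget
  have hΛpR : ptLog p (LayerField p m) M (p • RK) = (p : LayerField p m) ^ 3 * y'K := by
    rw [ptLog_nsmul hRKk, hΛR]; ring
  -- the `Γ`-combination of conjugates of `c`
  obtain ⟨B, hB, hBL, hBk, hBz⟩ := exists_closure_pt_sprung act hact0 hact hcL hck hcΛ
    (sprungEll_sub_mem_layer_pred hx0 hm) hz
  set νB := ptLogΩ p M B - z with hνB
  -- assemble
  refine ⟨B, hB, toOmega p M m RK, toOmega_mem_subfieldPoints _, (toOmega_mem_kernel_iff RK).mpr hRKk, ?_⟩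
  have hPRL : toOmega p M m PK - B - p • toOmega p M m RK ∈
      subfieldPoints (genFibΩ p M) (layer p m).toSubfield coeffs_mem_layer :=
    (subfieldPoints _ _ _).sub_mem ((subfieldPoints _ _ _).sub_mem (toOmega_mem_subfieldPoints _) hBL)
      ((subfieldPoints _ _ _).nsmul_mem (toOmega_mem_subfieldPoints _) _)
  have hpRk : p • toOmega p M m RK ∈ kernel (Valued.v (R := PadicAlgCl p)) (genFibΩ p M) :=
    (kernel (Valued.v (R := PadicAlgCl p)) (genFibΩ p M)).nsmul_mem ((toOmega_mem_kernel_iff RK).mpr hRKk) _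
  have hPRk : toOmega p M m PK - B - p • toOmega p M m RK ∈ kernel (Valued.v (R := PadicAlgCl p)) (genFibΩ p M) :=
    (kernel (Valued.v (R := PadicAlgCl p)) (genFibΩ p M)).sub_mem
      ((kernel (Valued.v (R := PadicAlgCl p)) (genFibΩ p M)).sub_mem hPk hBk) hpRk
  refine mem_subfieldPoints_of_ptLogΩ_mem act hact0 hact htors hPRL hPRk ?_
  -- the logarithm of `P − B − p•R`
  have hΛP : ptLogΩ p M (toOmega p M m PK) = LayerField.emb p m μ₀ + LayerField.emb p m y := by
    rw [ptLogΩ_toOmega hPKk, hy, ← map_add]; congr 1; ring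
  have hΛpR' : ptLogΩ p M (p • toOmega p M m RK) = (p : PadicAlgCl p) ^ 3 * y'Ω := by
    rw [← map_nsmul, ptLogΩ_toOmega ((kernel (NormedField.valuation (K := LayerField p m))
      (curveK p (LayerField p m) M)).nsmul_mem hRKk _), hΛpR, map_mul, map_pow, map_natCast, hy'K, LayerField.emb_mk]
  rw [ptLogΩ_sub (m := m) ((subfieldPoints _ _ _).sub_mem (toOmega_mem_subfieldPoints _) hBL)
      ((subfieldPoints _ _ _).nsmul_mem (toOmega_mem_subfieldPoints _) _)
      ((kernel (Valued.v (R := PadicAlgCl p)) (genFibΩ p M)).sub_mem hPk hBk) hpRk,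
    ptLogΩ_sub (m := m) (toOmega_mem_subfieldPoints _) hBL hPk hBk, hΛP, hΛpR']
  have eB : ptLogΩ p M B = z + νB := by rw [hνB]; ring
  rw [eB]
  have e : LayerField.emb p m μ₀ + LayerField.emb p m y - (z + νB) - (p : PadicAlgCl p) ^ 3 * y'Ω =
      LayerField.emb p m μ₀ + ν - νB + (LayerField.emb p m y - (p : PadicAlgCl p) ^ 3 * y'Ω - (z + ν)) := by ring
  rw [e, hzν, sub_self, add_zero]
  exact IntermediateField.sub_mem _ (IntermediateField.add_mem _ hμ₀L hνL) hBz

/-! ## §3 The trace relations as points of `E(ℚ_p)` -/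

/-- **The trace relation of Sprung's Thm. 2.2 (1) / [K] Lemma 8.9 as a point statement** (`m ≥ 1`): for tower points `c` with
`Λ(c n) = ℓ_n`, `(∑_{q ∈ stab m / stab (m+1)} act q̃ (c (m+1))) − a•(c m) + c (m−1)` has logarithm `−p`, hence lies in
`L(0) = E(ℚ_p)` (given no `p`-power torsion in `L(m+1)`). [cite: Sprung2012, Thm. 2.2 (1)] [cite: Kobayashi2003, Lemma 8.9] -/
theorem sum_act_sub_smul_add_mem_sprung {a : ℤ} {x : ℕ → ℚ_[p]} (hx0 : x 0 = 1) (hx1 : (p : ℚ_[p]) * x 1 = a)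
    (hrec : ∀ k, (p : ℚ_[p]) * x (k + 2) = a * x (k + 1) - x k)
    (act : Field.absoluteGaloisGroup ℚ_[p] → (genFibΩ p M).toAffine.Point → (genFibΩ p M).toAffine.Point)
    (hact0 : ∀ σ, act σ 0 = 0)
    (hact : ∀ σ (x y : PadicAlgCl p) (h : (genFibΩ p M).toAffine.Nonsingular x y),
      ∃ h', act σ (Affine.Point.some x y h) = Affine.Point.some (σ • x) (σ • y) h')
    {c : ℕ → (genFibΩ p M).toAffine.Point}
    (hcL : ∀ n, c n ∈ subfieldPoints (genFibΩ p M) (layer p n).toSubfield coeffs_mem_layer)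
    (hck : ∀ n, c n ∈ kernel (Valued.v (R := PadicAlgCl p)) (genFibΩ p M))
    (hcΛ : ∀ n, ptLogΩ p M (c n) = ∑ k ∈ range n, algebraMap ℚ_[p] (PadicAlgCl p) (x k) * (zeta p (n - k) - 1))
    {m : ℕ} (hm : 1 ≤ m)
    [Fintype (stab p m ⧸ (stab p (m + 1)).subgroupOf (stab p m))]
    (htors : ∀ Q ∈ subfieldPoints (genFibΩ p M) (layer p (m + 1)).toSubfield coeffs_mem_layer,
      ∀ k : ℕ, p ^ k • Q = 0 → Q = 0) :
    (∑ q : stab p m ⧸ (stab p (m + 1)).subgroupOf (stab p m),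
        act ((q.out : stab p m) : Field.absoluteGaloisGroup ℚ_[p]) (c (m + 1))) - a • c m + c (m - 1) ∈
      subfieldPoints (genFibΩ p M) (layer p 0).toSubfield coeffs_mem_layer := by
  haveI := isIntegral_curveK p (LayerField p (m + 1)) M
  have hcz : ‖(c (m + 1)).zCoord‖ < 1 := by
    have := val_zCoord_lt_one (hck (m + 1))
    rwa [PadicAlgCl.valuation_def, ← NNReal.coe_lt_coe, coe_nnnorm, NNReal.coe_one] at this
  have hSL : (∑ q : stab p m ⧸ (stab p (m + 1)).subgroupOf (stab p m),
      act ((q.out : stab p m) : Field.absoluteGaloisGroup ℚ_[p]) (c (m + 1))) ∈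
      subfieldPoints (genFibΩ p M) (layer p (m + 1)).toSubfield coeffs_mem_layer :=
    (subfieldPoints _ _ _).sum_mem fun q _ ↦ act_mem_subfieldPoints act hact0 hact _ (hcL (m + 1))
  have hSk : (∑ q : stab p m ⧸ (stab p (m + 1)).subgroupOf (stab p m),
      act ((q.out : stab p m) : Field.absoluteGaloisGroup ℚ_[p]) (c (m + 1))) ∈
      kernel (Valued.v (R := PadicAlgCl p)) (genFibΩ p M) :=
    (kernel (Valued.v (R := PadicAlgCl p)) (genFibΩ p M)).sum_mem fun q _ ↦ act_mem_kernel act hact0 hact _ (hck (m + 1))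
  have hcmL : a • c m ∈ subfieldPoints (genFibΩ p M) (layer p (m + 1)).toSubfield coeffs_mem_layer :=
    (subfieldPoints _ _ _).zsmul_mem (subfieldPoints_layer_mono (Nat.le_succ m) (hcL m)) _
  have hcmk : a • c m ∈ kernel (Valued.v (R := PadicAlgCl p)) (genFibΩ p M) :=
    (kernel (Valued.v (R := PadicAlgCl p)) (genFibΩ p M)).zsmul_mem (hck m) _
  have hc'L : c (m - 1) ∈ subfieldPoints (genFibΩ p M) (layer p (m + 1)).toSubfield coeffs_mem_layer :=
    subfieldPoints_layer_mono (by omega) (hcL (m - 1))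
  refine mem_subfieldPoints_of_ptLogΩ_mem act hact0 hact htors
    ((subfieldPoints _ _ _).add_mem ((subfieldPoints _ _ _).sub_mem hSL hcmL) hc'L)
    ((kernel (Valued.v (R := PadicAlgCl p)) (genFibΩ p M)).add_mem
      ((kernel (Valued.v (R := PadicAlgCl p)) (genFibΩ p M)).sub_mem hSk hcmk) (hck (m - 1))) ?_
  rw [ptLogΩ_add (m := m + 1) ((subfieldPoints _ _ _).sub_mem hSL hcmL) hc'L
      ((kernel (Valued.v (R := PadicAlgCl p)) (genFibΩ p M)).sub_mem hSk hcmk) (hck (m - 1)),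
    ptLogΩ_sub (m := m + 1) hSL hcmL hSk hcmk,
    ptLogΩ_zsmul (m := m) (hcL m) (hck m),
    ptLogΩ_finset_sum (m := m + 1) _ _ (fun q _ ↦ act_mem_subfieldPoints act hact0 hact _ (hcL (m + 1)))
      (fun q _ ↦ act_mem_kernel act hact0 hact _ (hck (m + 1)))]
  simp_rw [ptLogΩ_act act hact0 hact _ hcz, hcΛ]
  rw [sum_smul_sprungEll_succ hx0 hx1 hrec hm]
  have e : -(p : PadicAlgCl p) + (a : PadicAlgCl p) * ∑ k ∈ range m, algebraMap ℚ_[p] (PadicAlgCl p) (x k) * (zeta p (m - k) - 1) -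
        ∑ k ∈ range (m - 1), algebraMap ℚ_[p] (PadicAlgCl p) (x k) * (zeta p (m - 1 - k) - 1) -
        (a : ℤ) * ∑ k ∈ range m, algebraMap ℚ_[p] (PadicAlgCl p) (x k) * (zeta p (m - k) - 1) +
        ∑ k ∈ range (m - 1), algebraMap ℚ_[p] (PadicAlgCl p) (x k) * (zeta p (m - 1 - k) - 1) = -(p : PadicAlgCl p) := by
    ring
  rw [e]
  exact IntermediateField.neg_mem _ (by exact_mod_cast IntermediateField.natCast_mem (layer p 0) p)

/-- **The trace relation at the bottom** (Sprung's Thm. 2.2 (2) shape): `∑_{q ∈ Γ / stab 1} act q̃ (c 1) ∈ L(0) = E(ℚ_p)` (its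
logarithm is `−p`), given no `p`-power torsion in `L(1)`. [cite: Sprung2012, Thm. 2.2 (2)] [cite: Kobayashi2003, Lemma 8.9] -/
theorem sum_act_one_mem_sprung {x : ℕ → ℚ_[p]} (hx0 : x 0 = 1)
    (act : Field.absoluteGaloisGroup ℚ_[p] → (genFibΩ p M).toAffine.Point → (genFibΩ p M).toAffine.Point)
    (hact0 : ∀ σ, act σ 0 = 0)
    (hact : ∀ σ (x y : PadicAlgCl p) (h : (genFibΩ p M).toAffine.Nonsingular x y),
      ∃ h', act σ (Affine.Point.some x y h) = Affine.Point.some (σ • x) (σ • y) h')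
    {c : ℕ → (genFibΩ p M).toAffine.Point}
    (hcL : ∀ n, c n ∈ subfieldPoints (genFibΩ p M) (layer p n).toSubfield coeffs_mem_layer)
    (hck : ∀ n, c n ∈ kernel (Valued.v (R := PadicAlgCl p)) (genFibΩ p M))
    (hcΛ : ∀ n, ptLogΩ p M (c n) = ∑ k ∈ range n, algebraMap ℚ_[p] (PadicAlgCl p) (x k) * (zeta p (n - k) - 1))
    [Fintype (stab p 0 ⧸ (stab p 1).subgroupOf (stab p 0))]
    (htors : ∀ Q ∈ subfieldPoints (genFibΩ p M) (layer p 1).toSubfield coeffs_mem_layer, ∀ k : ℕ, p ^ k • Q = 0 → Q = 0) :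
    (∑ q : stab p 0 ⧸ (stab p 1).subgroupOf (stab p 0),
        act ((q.out : stab p 0) : Field.absoluteGaloisGroup ℚ_[p]) (c 1)) ∈
      subfieldPoints (genFibΩ p M) (layer p 0).toSubfield coeffs_mem_layer := by
  haveI := isIntegral_curveK p (LayerField p 1) M
  have hcz : ‖(c 1).zCoord‖ < 1 := by
    have := val_zCoord_lt_one (hck 1)
    rwa [PadicAlgCl.valuation_def, ← NNReal.coe_lt_coe, coe_nnnorm, NNReal.coe_one] at this
  have hSL : (∑ q : stab p 0 ⧸ (stab p 1).subgroupOf (stab p 0),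
      act ((q.out : stab p 0) : Field.absoluteGaloisGroup ℚ_[p]) (c 1)) ∈
      subfieldPoints (genFibΩ p M) (layer p 1).toSubfield coeffs_mem_layer :=
    (subfieldPoints _ _ _).sum_mem fun q _ ↦ act_mem_subfieldPoints act hact0 hact _ (hcL 1)
  have hSk : (∑ q : stab p 0 ⧸ (stab p 1).subgroupOf (stab p 0),
      act ((q.out : stab p 0) : Field.absoluteGaloisGroup ℚ_[p]) (c 1)) ∈
      kernel (Valued.v (R := PadicAlgCl p)) (genFibΩ p M) :=
    (kernel (Valued.v (R := PadicAlgCl p)) (genFibΩ p M)).sum_mem fun q _ ↦ act_mem_kernel act hact0 hact _ (hck 1)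
  refine mem_subfieldPoints_of_ptLogΩ_mem act hact0 hact htors hSL hSk ?_
  rw [ptLogΩ_finset_sum (m := 1) _ _ (fun q _ ↦ act_mem_subfieldPoints act hact0 hact _ (hcL 1))
      (fun q _ ↦ act_mem_kernel act hact0 hact _ (hck 1))]
  simp_rw [ptLogΩ_act act hact0 hact _ hcz, hcΛ]
  rw [sum_smul_sprungEll_one hx0]
  exact IntermediateField.neg_mem _ (by exact_mod_cast IntermediateField.natCast_mem (layer p 0) p)

end SprungHonda

end Literature.NumberTheory.EllipticCurves.Sprung2012.Honda

end Part6

/-!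
## Part 7 — port of `Summits/BirchSwinnertonDyer/BirchSwinnertonDyer/Theorems/PrintX8VSInputHondaSystemSprungTowerRelations.lean` (5 declarations kept)

# The trace relations of Sprung's tower points as EQUALITIES of `E_Ω`-points

(Port of the declarations listed in the Part header; the source module's docstring — cell bookkeeping of the BSD
printed-inputs programme — is abridged to its title here.)
-/

section Part7

open scoped _root_.Classical _root_.Topology _root_.NNReal
open _root_.Filter _root_.PowerSeries _root_.Finset

namespace Literature.NumberTheory.EllipticCurves.Sprung2012.Honda

namespace SprungHonda

open Literature.NumberTheory.EllipticCurves.Sprung2012.Honda Literature.NumberTheory.EllipticCurves.Sprung2012.Honda.BallEval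
open Literature.NumberTheory.EllipticCurves.Sprung2012.Honda.PadicCyclotomicTower
open Literature.NumberTheory.GaloisRepresentations.LubinTate (unitBall)
open Literature.NumberTheory.EllipticCurves.FormalGroupChart (kernel val_zCoord_lt_one)
open _root_.WeierstrassCurve

variable {p : ℕ} [hp : Fact p.Prime] {M : WeierstrassCurve ℤ_[p]} [hE : (M.map PadicInt.Coe.ringHom).IsElliptic]
variable [hintΩ : (genFibΩ p M).IsIntegral (Valued.v (R := PadicAlgCl p)).integer]

/-- **`Λ` is injective on `L(m) ∩ E₁`** when `L(m)` has no `p`-power torsion. [cite: Kobayashi2003, Prop. 8.7 and Lemma 8.9] -/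
theorem eq_of_ptLogΩ_eq {m : ℕ}
    (htors : ∀ Q ∈ subfieldPoints (genFibΩ p M) (layer p m).toSubfield coeffs_mem_layer, ∀ k : ℕ, p ^ k • Q = 0 → Q = 0)
    {Q₁ Q₂ : (genFibΩ p M).toAffine.Point}
    (h₁ : Q₁ ∈ subfieldPoints (genFibΩ p M) (layer p m).toSubfield coeffs_mem_layer)
    (h₂ : Q₂ ∈ subfieldPoints (genFibΩ p M) (layer p m).toSubfield coeffs_mem_layer)
    (hk₁ : Q₁ ∈ kernel (Valued.v (R := PadicAlgCl p)) (genFibΩ p M)) (hk₂ : Q₂ ∈ kernel (Valued.v (R := PadicAlgCl p)) (genFibΩ p M))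
    (hΛ : ptLogΩ p M Q₁ = ptLogΩ p M Q₂) : Q₁ = Q₂ := by
  haveI := isIntegral_curveK p (LayerField p m) M
  have hsubL : Q₁ - Q₂ ∈ subfieldPoints (genFibΩ p M) (layer p m).toSubfield coeffs_mem_layer := (subfieldPoints _ _ _).sub_mem h₁ h₂
  have hsubk : Q₁ - Q₂ ∈ kernel (Valued.v (R := PadicAlgCl p)) (genFibΩ p M) :=
    (kernel (Valued.v (R := PadicAlgCl p)) (genFibΩ p M)).sub_mem hk₁ hk₂
  have h0 : ptLogΩ p M (Q₁ - Q₂) = 0 := by rw [ptLogΩ_sub (m := m) h₁ h₂ hk₁ hk₂, hΛ, sub_self]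
  obtain ⟨k, hk⟩ := exists_pow_smul_eq_zero_of_ptLogΩ_eq_zero hsubL hsubk h0
  exact sub_eq_zero.mp (htors _ hsubL k hk)

section Relations

variable {a : ℤ} {x : ℕ → ℚ_[p]}
  (act : Field.absoluteGaloisGroup ℚ_[p] → (genFibΩ p M).toAffine.Point → (genFibΩ p M).toAffine.Point)
  {c : ℕ → (genFibΩ p M).toAffine.Point}

/-- **`Λ(T_m) = −p`** (`m ≥ 1`): the logarithm of `∑_{q ∈ Stab(ζ_m)/Stab(ζ_{m+1})} q̃ ⋆ c_{m+1} − a•c_m + c_{m−1}` (file 4's trace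
identity `∑ q̃•ℓ_{m+1} = −p + aℓ_m − ℓ_{m−1}`). [cite: Sprung2012, Thm. 2.2 (1)] [cite: Kobayashi2003, Lemma 8.9] -/
theorem ptLogΩ_sum_act_sub_smul_add_sprung (hx0 : x 0 = 1) (hx1 : (p : ℚ_[p]) * x 1 = a)
    (hrec : ∀ k, (p : ℚ_[p]) * x (k + 2) = a * x (k + 1) - x k)
    (hact0 : ∀ σ, act σ 0 = 0)
    (hact : ∀ σ (x y : PadicAlgCl p) (h : (genFibΩ p M).toAffine.Nonsingular x y),
      ∃ h', act σ (Affine.Point.some x y h) = Affine.Point.some (σ • x) (σ • y) h')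
    (hcL : ∀ n, c n ∈ subfieldPoints (genFibΩ p M) (layer p n).toSubfield coeffs_mem_layer)
    (hck : ∀ n, c n ∈ kernel (Valued.v (R := PadicAlgCl p)) (genFibΩ p M))
    (hcΛ : ∀ n, ptLogΩ p M (c n) = ∑ k ∈ range n, algebraMap ℚ_[p] (PadicAlgCl p) (x k) * (zeta p (n - k) - 1))
    {m : ℕ} (hm : 1 ≤ m) [Fintype (stab p m ⧸ (stab p (m + 1)).subgroupOf (stab p m))] :
    ptLogΩ p M ((∑ q : stab p m ⧸ (stab p (m + 1)).subgroupOf (stab p m),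
        act ((q.out : stab p m) : Field.absoluteGaloisGroup ℚ_[p]) (c (m + 1))) - a • c m + c (m - 1)) = -(p : PadicAlgCl p) := by
  haveI := isIntegral_curveK p (LayerField p (m + 1)) M
  haveI := isIntegral_curveK p (LayerField p m) M
  have hcz : ‖(c (m + 1)).zCoord‖ < 1 := by
    have := val_zCoord_lt_one (hck (m + 1))
    rwa [PadicAlgCl.valuation_def, ← NNReal.coe_lt_coe, coe_nnnorm, NNReal.coe_one] at this
  have hSL : (∑ q : stab p m ⧸ (stab p (m + 1)).subgroupOf (stab p m),
      act ((q.out : stab p m) : Field.absoluteGaloisGroup ℚ_[p]) (c (m + 1))) ∈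
      subfieldPoints (genFibΩ p M) (layer p (m + 1)).toSubfield coeffs_mem_layer :=
    (subfieldPoints _ _ _).sum_mem fun q _ ↦ act_mem_subfieldPoints act hact0 hact _ (hcL (m + 1))
  have hSk : (∑ q : stab p m ⧸ (stab p (m + 1)).subgroupOf (stab p m),
      act ((q.out : stab p m) : Field.absoluteGaloisGroup ℚ_[p]) (c (m + 1))) ∈
      kernel (Valued.v (R := PadicAlgCl p)) (genFibΩ p M) :=
    (kernel (Valued.v (R := PadicAlgCl p)) (genFibΩ p M)).sum_mem fun q _ ↦ act_mem_kernel act hact0 hact _ (hck (m + 1))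
  have hcmL : a • c m ∈ subfieldPoints (genFibΩ p M) (layer p (m + 1)).toSubfield coeffs_mem_layer :=
    (subfieldPoints _ _ _).zsmul_mem (subfieldPoints_layer_mono (Nat.le_succ m) (hcL m)) _
  have hcmk : a • c m ∈ kernel (Valued.v (R := PadicAlgCl p)) (genFibΩ p M) :=
    (kernel (Valued.v (R := PadicAlgCl p)) (genFibΩ p M)).zsmul_mem (hck m) _
  have hc'L : c (m - 1) ∈ subfieldPoints (genFibΩ p M) (layer p (m + 1)).toSubfield coeffs_mem_layer :=
    subfieldPoints_layer_mono (by omega) (hcL (m - 1))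
  rw [ptLogΩ_add (m := m + 1) ((subfieldPoints _ _ _).sub_mem hSL hcmL) hc'L
      ((kernel (Valued.v (R := PadicAlgCl p)) (genFibΩ p M)).sub_mem hSk hcmk) (hck (m - 1)),
    ptLogΩ_sub (m := m + 1) hSL hcmL hSk hcmk,
    ptLogΩ_zsmul (m := m) (hcL m) (hck m),
    ptLogΩ_finset_sum (m := m + 1) _ _ (fun q _ ↦ act_mem_subfieldPoints act hact0 hact _ (hcL (m + 1)))
      (fun q _ ↦ act_mem_kernel act hact0 hact _ (hck (m + 1)))]
  simp_rw [ptLogΩ_act act hact0 hact _ hcz, hcΛ]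
  rw [sum_smul_sprungEll_succ hx0 hx1 hrec hm]
  ring

/-- **`Λ(T_0) = −p`**: the logarithm of `∑_{q ∈ Γ/Stab(ζ_1)} q̃ ⋆ c_1` (`∑ q̃•(ζ_1 − 1) = −p`). [cite: Sprung2012, Thm. 2.2 (2)]
[cite: Kobayashi2003, Lemma 8.9] -/
theorem ptLogΩ_sum_act_one_sprung (hx0 : x 0 = 1)
    (hact0 : ∀ σ, act σ 0 = 0)
    (hact : ∀ σ (x y : PadicAlgCl p) (h : (genFibΩ p M).toAffine.Nonsingular x y),
      ∃ h', act σ (Affine.Point.some x y h) = Affine.Point.some (σ • x) (σ • y) h')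
    (hcL : ∀ n, c n ∈ subfieldPoints (genFibΩ p M) (layer p n).toSubfield coeffs_mem_layer)
    (hck : ∀ n, c n ∈ kernel (Valued.v (R := PadicAlgCl p)) (genFibΩ p M))
    (hcΛ : ∀ n, ptLogΩ p M (c n) = ∑ k ∈ range n, algebraMap ℚ_[p] (PadicAlgCl p) (x k) * (zeta p (n - k) - 1))
    [Fintype (stab p 0 ⧸ (stab p 1).subgroupOf (stab p 0))] :
    ptLogΩ p M (∑ q : stab p 0 ⧸ (stab p 1).subgroupOf (stab p 0),
        act ((q.out : stab p 0) : Field.absoluteGaloisGroup ℚ_[p]) (c 1)) = -(p : PadicAlgCl p) := by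
  haveI := isIntegral_curveK p (LayerField p 1) M
  have hcz : ‖(c 1).zCoord‖ < 1 := by
    have := val_zCoord_lt_one (hck 1)
    rwa [PadicAlgCl.valuation_def, ← NNReal.coe_lt_coe, coe_nnnorm, NNReal.coe_one] at this
  rw [ptLogΩ_finset_sum (m := 1) _ _ (fun q _ ↦ act_mem_subfieldPoints act hact0 hact _ (hcL 1))
      (fun q _ ↦ act_mem_kernel act hact0 hact _ (hck 1))]
  simp_rw [ptLogΩ_act act hact0 hact _ hcz, hcΛ]
  exact sum_smul_sprungEll_one hx0

/-- **The relations of Thm. 2.2 as equalities of points**: for `m ≥ 1`,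
`∑_{q ∈ Stab(ζ_m)/Stab(ζ_{m+1})} q̃ ⋆ c_{m+1} − a•c_m + c_{m−1} = ∑_{q ∈ Γ/Stab(ζ_1)} q̃ ⋆ c_1` (`= −Q`): both sides lie in
`L(0) ∩ E₁` (file 5) and have logarithm `−p`, and `Λ` is injective on the torsion-free `L(1) ∩ E₁`.
[cite: Sprung2012, Thm. 2.2 (1), (2)] [cite: Kobayashi2003, Lemma 8.9] -/
theorem sum_act_sub_smul_add_eq_sum_act_one_sprung (hx0 : x 0 = 1) (hx1 : (p : ℚ_[p]) * x 1 = a)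
    (hrec : ∀ k, (p : ℚ_[p]) * x (k + 2) = a * x (k + 1) - x k)
    (hact0 : ∀ σ, act σ 0 = 0)
    (hact : ∀ σ (x y : PadicAlgCl p) (h : (genFibΩ p M).toAffine.Nonsingular x y),
      ∃ h', act σ (Affine.Point.some x y h) = Affine.Point.some (σ • x) (σ • y) h')
    (hcL : ∀ n, c n ∈ subfieldPoints (genFibΩ p M) (layer p n).toSubfield coeffs_mem_layer)
    (hck : ∀ n, c n ∈ kernel (Valued.v (R := PadicAlgCl p)) (genFibΩ p M))
    (hcΛ : ∀ n, ptLogΩ p M (c n) = ∑ k ∈ range n, algebraMap ℚ_[p] (PadicAlgCl p) (x k) * (zeta p (n - k) - 1))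
    (htors : ∀ m, 1 ≤ m → ∀ Q ∈ subfieldPoints (genFibΩ p M) (layer p m).toSubfield coeffs_mem_layer,
      ∀ k : ℕ, p ^ k • Q = 0 → Q = 0)
    {m : ℕ} (hm : 1 ≤ m) [Fintype (stab p m ⧸ (stab p (m + 1)).subgroupOf (stab p m))]
    [Fintype (stab p 0 ⧸ (stab p 1).subgroupOf (stab p 0))] :
    (∑ q : stab p m ⧸ (stab p (m + 1)).subgroupOf (stab p m),
        act ((q.out : stab p m) : Field.absoluteGaloisGroup ℚ_[p]) (c (m + 1))) - a • c m + c (m - 1) =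
      ∑ q : stab p 0 ⧸ (stab p 1).subgroupOf (stab p 0), act ((q.out : stab p 0) : Field.absoluteGaloisGroup ℚ_[p]) (c 1) := by
  -- both sides lie in `L(0) ∩ E₁`
  have hL₁ := sum_act_sub_smul_add_mem_sprung hx0 hx1 hrec act hact0 hact hcL hck hcΛ hm (htors (m + 1) (by omega))
  have hL₂ := sum_act_one_mem_sprung hx0 act hact0 hact hcL hck hcΛ (htors 1 le_rfl)
  have hk₁ : (∑ q : stab p m ⧸ (stab p (m + 1)).subgroupOf (stab p m),
      act ((q.out : stab p m) : Field.absoluteGaloisGroup ℚ_[p]) (c (m + 1))) - a • c m + c (m - 1) ∈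
      kernel (Valued.v (R := PadicAlgCl p)) (genFibΩ p M) :=
    (kernel _ _).add_mem ((kernel _ _).sub_mem ((kernel _ _).sum_mem fun q _ ↦ act_mem_kernel act hact0 hact _ (hck (m + 1)))
      ((kernel _ _).zsmul_mem (hck m) _)) (hck (m - 1))
  have hk₂ : (∑ q : stab p 0 ⧸ (stab p 1).subgroupOf (stab p 0),
      act ((q.out : stab p 0) : Field.absoluteGaloisGroup ℚ_[p]) (c 1)) ∈ kernel (Valued.v (R := PadicAlgCl p)) (genFibΩ p M) :=
    (kernel _ _).sum_mem fun q _ ↦ act_mem_kernel act hact0 hact _ (hck 1)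
  refine eq_of_ptLogΩ_eq (m := 1) (htors 1 le_rfl) (subfieldPoints_layer_mono (Nat.zero_le 1) hL₁)
    (subfieldPoints_layer_mono (Nat.zero_le 1) hL₂) hk₁ hk₂ ?_
  rw [ptLogΩ_sum_act_sub_smul_add_sprung act hx0 hx1 hrec hact0 hact hcL hck hcΛ hm,
    ptLogΩ_sum_act_one_sprung act hx0 hact0 hact hcL hck hcΛ]

/-- **`Λ(Q) = p`** for `Q := −∑_{q ∈ Γ/Stab(ζ_1)} q̃ ⋆ c_1 ∈ L(0) ∩ E₁`. [cite: Sprung2012, Thm. 2.2 (2)] -/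
theorem ptLogΩ_neg_sum_act_one_sprung (hx0 : x 0 = 1)
    (hact0 : ∀ σ, act σ 0 = 0)
    (hact : ∀ σ (x y : PadicAlgCl p) (h : (genFibΩ p M).toAffine.Nonsingular x y),
      ∃ h', act σ (Affine.Point.some x y h) = Affine.Point.some (σ • x) (σ • y) h')
    (hcL : ∀ n, c n ∈ subfieldPoints (genFibΩ p M) (layer p n).toSubfield coeffs_mem_layer)
    (hck : ∀ n, c n ∈ kernel (Valued.v (R := PadicAlgCl p)) (genFibΩ p M))
    (hcΛ : ∀ n, ptLogΩ p M (c n) = ∑ k ∈ range n, algebraMap ℚ_[p] (PadicAlgCl p) (x k) * (zeta p (n - k) - 1))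
    [Fintype (stab p 0 ⧸ (stab p 1).subgroupOf (stab p 0))] :
    ptLogΩ p M (-(∑ q : stab p 0 ⧸ (stab p 1).subgroupOf (stab p 0),
        act ((q.out : stab p 0) : Field.absoluteGaloisGroup ℚ_[p]) (c 1))) = (p : PadicAlgCl p) := by
  haveI := isIntegral_curveK p (LayerField p 1) M
  have hL : (∑ q : stab p 0 ⧸ (stab p 1).subgroupOf (stab p 0),
      act ((q.out : stab p 0) : Field.absoluteGaloisGroup ℚ_[p]) (c 1)) ∈
      subfieldPoints (genFibΩ p M) (layer p 1).toSubfield coeffs_mem_layer :=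
    (subfieldPoints _ _ _).sum_mem fun q _ ↦ act_mem_subfieldPoints act hact0 hact _ (hcL 1)
  have hk : (∑ q : stab p 0 ⧸ (stab p 1).subgroupOf (stab p 0),
      act ((q.out : stab p 0) : Field.absoluteGaloisGroup ℚ_[p]) (c 1)) ∈ kernel (Valued.v (R := PadicAlgCl p)) (genFibΩ p M) :=
    (kernel _ _).sum_mem fun q _ ↦ act_mem_kernel act hact0 hact _ (hck 1)
  rw [← neg_one_zsmul, ptLogΩ_zsmul (m := 1) hL hk, ptLogΩ_sum_act_one_sprung act hx0 hact0 hact hcL hck hcΛ]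
  push_cast
  ring

end Relations

end SprungHonda

end Literature.NumberTheory.EllipticCurves.Sprung2012.Honda

end Part7

/-!
## Part 8 — port of `Summits/BirchSwinnertonDyer/BirchSwinnertonDyer/Theorems/PrintX8VSInputHondaSystemLocalGeneration.lean` (3 declarations kept)

# The generation clauses (primal form) for the `Δ`-descended Honda points at `ℚ_p`

(Port of the declarations listed in the Part header; the source module's docstring — cell bookkeeping of the BSD
printed-inputs programme — is abridged to its title here.)
-/

section Part8

open scoped _root_.Classical
open _root_.Finset _root_.PowerSeries

namespace Literature.NumberTheory.EllipticCurves.Sprung2012.Honda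

namespace SprungHonda

open Literature.NumberTheory.EllipticCurves Literature.NumberTheory.GaloisRepresentations
  Literature.NumberTheory.EllipticCurves.ZpExtension Literature.NumberTheory.EllipticCurves.Kobayashi2003
  Literature.NumberTheory.EllipticCurves.Sprung2012.Honda Literature.NumberTheory.EllipticCurves.Sprung2012.Honda.PadicCyclotomicTower
  Literature.NumberTheory.EllipticCurves.Sprung2012.Honda.BallEval
open Literature.NumberTheory.EllipticCurves.FormalGroupChart (kernel)

variable {p : ℕ} [hp : Fact p.Prime] (κ : ZpExtension ℚ p) (ι : AlgebraicClosure ℚ →ₐ[ℚ] AlgebraicClosure ℚ_[p])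
  (W : WeierstrassCurve ℚ) (U : ℕ → Subgroup (Field.absoluteGaloisGroup ℚ)) [hUf : ∀ n, (U n).FiniteIndex]
  [hUN : ∀ n, (U n).Normal]
  {M : WeierstrassCurve ℤ_[p]} [hE : (M.map PadicInt.Coe.ringHom).IsElliptic] [hEt : (M.map PadicInt.toZMod).IsElliptic]
  [hintΩ : (genFibΩ p M).IsIntegral (Valued.v (R := PadicAlgCl p)).integer]

/-! ## §0 Torsion and the fixed-point dictionary -/

omit hUf hE hEt hintΩ in
/-- No `p`-power torsion in `L(m) = E(ℚ_p(ζ_m))`, `m ≥ 1` (tree `eq_zero_of_prime_pow_smul_eq_zero_localFixedPointsOfEmb_of_stab`, read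
through `toLoc`). [cite: Kobayashi2003, Prop. 8.7] -/
theorem torsionFree_layer_of_stab [W.IsElliptic] (hp2 : p ≠ 2) (hΔ : IsUnit M.Δ) (hA : M.hasseCoeff p ∈ IsLocalRing.maximalIdeal ℤ_[p])
    (hWM : M.baseChange (AlgebraicClosure ℚ_[p]) = W.baseChange (AlgebraicClosure ℚ_[p]))
    (hU : ∀ n, localSubgroupOfEmb (U n) ι = stab p (n + 1)) (m : ℕ) (hm : 1 ≤ m) :
    ∀ Q ∈ subfieldPoints (genFibΩ p M) (layer p m).toSubfield coeffs_mem_layer, ∀ k : ℕ, p ^ k • Q = 0 → Q = 0 := by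
  have hV : genFibΩ p M = W.baseChange (AlgebraicClosure ℚ_[p]) := (genFibΩ_eq_baseChange M).trans hWM
  intro Q hQ k hk
  obtain ⟨m₀, rfl⟩ := Nat.exists_eq_add_of_le' hm
  have hQ' : (toLoc hV Q : localPoints W ℚ_[p]) ∈ localFixedPointsOfEmb ι W (U m₀) := by
    rw [mem_localFixedPointsOfEmb_iff_mem_subfieldPoints ι hV hU]; simpa using hQ
  have := eq_zero_of_prime_pow_smul_eq_zero_localFixedPointsOfEmb_of_stab ι W U hp2 M hΔ hA hWM hU m₀ k (toLoc hV Q) hQ'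
    (by rw [← map_nsmul, hk, map_zero])
  exact (toLoc hV).injective (by rw [this, map_zero])

/-! ## §1 (GEN) for `n ≥ 1` -/

/-- **(GEN) for `n ≥ 1`.** For `P ∈ E(ℚ_{p,n})` there are `B ∈ ℤ[Γ·c_n]`, `P' ∈ E(ℚ_{p,n−1})`, `R ∈ E(ℚ_{p,n})` with
`((p−1)N₁²)•P = B + P' + p•R`, where `c_n = N₁•𝒟_n(e cΩ_{n+1}) + (p−1)•e QΩ`: Kobayashi's step
`N₁•P ∈ ℤ[Γ·e cΩ_{n+1}] + E(k_{n−1}) + p·E(k_n)` (file `…SprungTowerGeneration`, `N₁•P ∈ E₁`) pushed down by `𝒟_n`.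
[cite: Kobayashi2003, Prop. 8.12] [cite: Sprung2012, Thm. 2.2 (p. 1487) and Lemmas 7.4–7.5] -/
theorem descent_generation [W.IsElliptic] (hp2 : p ≠ 2) (hκ : κ.IsCyclotomic) (hUL : ∀ n, U n ≤ κ.layerSubgroup n)
    (hU : ∀ n, localSubgroupOfEmb (U n) ι = stab p (n + 1)) (hΔ : IsUnit M.Δ) (hA : M.hasseCoeff p ∈ IsLocalRing.maximalIdeal ℤ_[p])
    (hWM : M.baseChange (AlgebraicClosure ℚ_[p]) = W.baseChange (AlgebraicClosure ℚ_[p]))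
    (hV : genFibΩ p M = W.baseChange (AlgebraicClosure ℚ_[p]))
    {x : ℕ → ℚ_[p]} (hx0 : x 0 = 1) (hxb : ∀ k, ‖x k‖ ≤ Real.sqrt p ^ k)
    {i j : ℤ_[p]⟦X⟧} (hi0 : constantCoeff i = 0) (hj0 : constantCoeff j = 0) (hij : i.subst j = PowerSeries.X)
    (hlog : (M.map (PadicInt.Coe.ringHom (p := p))).formalLog.subst (i.map PadicInt.Coe.ringHom) =
      PowerSeries.mk fun d ↦ ∑' k : ℕ, x k * (((p ^ k).choose d : ℚ_[p]) - if d = 0 then 1 else 0))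
    {cΩ : ℕ → (genFibΩ p M).toAffine.Point}
    (hcL : ∀ m, cΩ m ∈ subfieldPoints (genFibΩ p M) (layer p m).toSubfield coeffs_mem_layer)
    (hck : ∀ m, cΩ m ∈ kernel (Valued.v (R := PadicAlgCl p)) (genFibΩ p M))
    (hcΛ : ∀ m, ptLogΩ p M (cΩ m) = ∑ k ∈ range m, algebraMap ℚ_[p] (PadicAlgCl p) (x k) * (zeta p (m - k) - 1))
    {QΩ : (genFibΩ p M).toAffine.Point} (hQL : QΩ ∈ subfieldPoints (genFibΩ p M) (layer p 0).toSubfield coeffs_mem_layer)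
    {N₁ : ℕ} (hN₁ : N₁ = Nat.card (M.map PadicInt.toZMod).toAffine.Point)
    (c : ℕ → localPoints W ℚ_[p])
    (hc : ∀ n, c n = (N₁ : ℤ) • localPairTraceOfEmb ι W (κ.layerSubgroup n) (U n) (toLoc hV (cΩ (n + 1))) +
      ((p : ℤ) - 1) • toLoc hV QΩ)
    {n : ℕ} (hn : 1 ≤ n) {P : localPoints W ℚ_[p]} (hP : P ∈ localLayerPointsOfEmb κ ι W n) :
    ∃ B ∈ AddSubgroup.closure (Set.range fun σ : Field.absoluteGaloisGroup ℚ_[p] ↦ σ • c n),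
      ∃ P' ∈ localLayerPointsOfEmb κ ι W (n - 1), ∃ R ∈ localLayerPointsOfEmb κ ι W n,
        ((p - 1) * N₁ * N₁) • P = B + P' + p • R := by
  obtain ⟨k, rfl⟩ := Nat.exists_eq_add_of_le' hn
  rw [Nat.add_sub_cancel]
  -- notation and the transported action
  set e := toLoc hV with he
  set act : Field.absoluteGaloisGroup ℚ_[p] → (genFibΩ p M).toAffine.Point → (genFibΩ p M).toAffine.Point :=
    fun σ Q ↦ e.symm (σ • e Q) with hact_def
  have hact0 : ∀ σ, act σ 0 = 0 := fun σ ↦ act_zero hV σ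
  have hact : ∀ σ (x y : PadicAlgCl p) (h : (genFibΩ p M).toAffine.Nonsingular x y),
      ∃ h', act σ (WeierstrassCurve.Affine.Point.some x y h) = WeierstrassCurve.Affine.Point.some (σ • x) (σ • y) h' :=
    fun σ x y h ↦ act_some hV σ x y h
  have he_act : ∀ σ Q, e (act σ Q) = σ • e Q := fun σ Q ↦ by simp only [hact_def, AddEquiv.apply_symm_apply]
  have hFix : ∀ k (P : localPoints W ℚ_[p]), P ∈ localFixedPointsOfEmb ι W (U k) ↔
      e.symm P ∈ subfieldPoints (genFibΩ p M) (layer p (k + 1)).toSubfield coeffs_mem_layer :=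
    fun k P ↦ mem_localFixedPointsOfEmb_iff_mem_subfieldPoints ι hV hU k P
  have hmono := localLayerPointsOfEmb_mono κ ι W
  have htorsΩ := torsionFree_layer_of_stab ι W U hp2 hΔ hA hWM hU
  -- `e QΩ ∈ E(ℚ_p)`
  have hQ0 : e QΩ ∈ localLayerPointsOfEmb κ ι W 0 := by
    rw [mem_localLayerPointsOfEmb_zero_iff]
    exact (mem_localFixedPointsOfEmb_top_iff ι W _).mp
      ((mem_localFixedPointsOfEmb_top_iff_mem_subfieldPoints ι hV _).mpr (by simpa [he] using hQL))
  -- the `Δ`-trace `𝒟 = 𝒟_{k+1}`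
  set 𝒟 := localPairTraceOfEmb ι W (κ.layerSubgroup (k + 1)) (U (k + 1)) with h𝒟
  have hPU : P ∈ localFixedPointsOfEmb ι W (U (k + 1)) := localLayerPointsOfEmb_le_localFixedPointsOfEmb κ ι W U hUL (k + 1) hP
  -- Kobayashi's step in `E(k_{k+1}) = L(k+2)` for `N₁•P ∈ E₁`
  set QP := e.symm P with hQP
  have hQPL : QP ∈ subfieldPoints (genFibΩ p M) (layer p (k + 2)).toSubfield coeffs_mem_layer := (hFix (k + 1) P).mp hPU
  have hN₁k : N₁ • QP ∈ kernel (Valued.v (R := PadicAlgCl p)) (genFibΩ p M) := by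
    rw [hN₁]; exact card_smul_mem_kernel_of_mem_subfieldPoints M hQPL
  obtain ⟨BΩ, hBΩ, RΩ, hRΩL, -, hFΩ⟩ := exists_sub_closure_sub_smul_mem_sprung hp2 hxb hi0 hj0 hij hlog act hact0 hact
    (m := k + 2) (by omega) (htorsΩ (k + 2) (by omega)) (hcL (k + 2)) (hck (k + 2)) (hcΛ (k + 2)) hx0
    ((subfieldPoints _ _ _).nsmul_mem hQPL N₁) hN₁k
  rw [show k + 2 - 1 = k + 1 from rfl] at hFΩ
  -- transport back to `E(ℚ̄_p)`
  set B₁ : localPoints W ℚ_[p] := e BΩ with hB₁def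
  set R₁ : localPoints W ℚ_[p] := e RΩ with hR₁def
  have hB₁cl : B₁ ∈ AddSubgroup.closure (Set.range fun σ : Field.absoluteGaloisGroup ℚ_[p] ↦ σ • e (cΩ (k + 2))) := by
    have himg : (AddSubgroup.closure (Set.range fun σ : Field.absoluteGaloisGroup ℚ_[p] ↦ act σ (cΩ (k + 2)))).map
        e.toAddMonoidHom ≤ AddSubgroup.closure (Set.range fun σ : Field.absoluteGaloisGroup ℚ_[p] ↦ σ • e (cΩ (k + 2))) := by
      rw [AddMonoidHom.map_closure]
      refine AddSubgroup.closure_mono ?_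
      rintro _ ⟨_, ⟨σ, rfl⟩, rfl⟩
      exact ⟨σ, (he_act σ _).symm⟩
    exact himg ⟨BΩ, hBΩ, rfl⟩
  have hR₁ : R₁ ∈ localFixedPointsOfEmb ι W (U (k + 1)) := by
    rw [hFix, hR₁def, AddEquiv.symm_apply_apply]; exact hRΩL
  have hF₁ : N₁ • P - B₁ - p • R₁ ∈ localFixedPointsOfEmb ι W (U k) := by
    rw [hFix, map_sub, map_sub, map_nsmul, map_nsmul, hB₁def, hR₁def, AddEquiv.symm_apply_apply, AddEquiv.symm_apply_apply]
    exact hFΩ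
  have hc₁ : e (cΩ (k + 2)) ∈ localFixedPointsOfEmb ι W (U (k + 1)) := by
    rw [hFix, AddEquiv.symm_apply_apply]; exact hcL (k + 2)
  -- push down by `𝒟`
  have hDP : 𝒟 P = (p - 1) • P := localPairTraceOfEmb_of_mem_layer κ ι W U hp2 hκ hU hP
  have hDB : 𝒟 B₁ ∈ AddSubgroup.closure (Set.range fun σ : Field.absoluteGaloisGroup ℚ_[p] ↦ σ • 𝒟 (e (cΩ (k + 2)))) := by
    rw [← map_localPairTraceOfEmb_closure_orbit κ ι W U (k + 1) hc₁]
    exact ⟨B₁, hB₁cl, rfl⟩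
  have hDF : 𝒟 (N₁ • P - B₁ - p • R₁) ∈ localLayerPointsOfEmb κ ι W k := by
    rw [h𝒟, localPairTraceOfEmb_succ_eq κ ι W U hp2 hκ hU hF₁]
    exact localPairTraceOfEmb_mem_layer κ ι W U k hF₁
  have hDR : 𝒟 R₁ ∈ localLayerPointsOfEmb κ ι W (k + 1) := localPairTraceOfEmb_mem_layer κ ι W U (k + 1) hR₁
  -- `N₁•𝒟B₁ ∈ ℤ[Γ·c_{k+1}] + E(ℚ_{p,k})`
  set S := AddSubgroup.closure (Set.range fun σ : Field.absoluteGaloisGroup ℚ_[p] ↦ σ • c (k + 1)) ⊔ localLayerPointsOfEmb κ ι W k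
    with hS
  have hNDB : N₁ • 𝒟 B₁ ∈ S := by
    refine AddSubgroup.closure_induction (p := fun X _ ↦ N₁ • X ∈ S) ?_ ?_ ?_ ?_ hDB
    · rintro _ ⟨σ, rfl⟩
      have hfixQ : σ • e QΩ = e QΩ := (mem_localLayerPointsOfEmb_zero_iff κ ι W _).mp hQ0 σ
      have heq : N₁ • σ • 𝒟 (e (cΩ (k + 2))) = σ • c (k + 1) - ((p : ℤ) - 1) • e QΩ := by
        rw [hc (k + 1), smul_add, smul_comm σ ((p : ℤ) - 1) (e QΩ), hfixQ, add_sub_cancel_right, smul_comm σ (N₁ : ℤ),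
          natCast_zsmul]
      rw [heq]
      exact sub_mem (AddSubgroup.mem_sup_left (AddSubgroup.subset_closure ⟨σ, rfl⟩))
        (AddSubgroup.mem_sup_right (AddSubgroup.zsmul_mem _ (hmono (Nat.zero_le k) hQ0) _))
    · rw [smul_zero]; exact S.zero_mem
    · intro X Y _ _ hX hY; rw [smul_add]; exact S.add_mem hX hY
    · intro X _ hX; rw [smul_neg]; exact S.neg_mem hX
  obtain ⟨B, hB, Y, hY, hBY⟩ := AddSubgroup.mem_sup.mp hNDB
  -- assemble
  have hNP : N₁ • P = (N₁ • P - B₁ - p • R₁) + B₁ + p • R₁ := by abel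
  refine ⟨B, hB, Y + N₁ • 𝒟 (N₁ • P - B₁ - p • R₁), add_mem hY (AddSubgroup.nsmul_mem _ hDF _), N₁ • 𝒟 R₁,
    AddSubgroup.nsmul_mem _ hDR _, ?_⟩
  calc ((p - 1) * N₁ * N₁) • P = N₁ • N₁ • (p - 1) • P := by rw [show (p - 1) * N₁ * N₁ = N₁ * (N₁ * (p - 1)) by ring,
        mul_smul, mul_smul]
    _ = N₁ • 𝒟 (N₁ • P) := by rw [← hDP, map_nsmul]
    _ = N₁ • 𝒟 ((N₁ • P - B₁ - p • R₁) + B₁ + p • R₁) := by rw [← hNP]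
    _ = N₁ • 𝒟 (N₁ • P - B₁ - p • R₁) + N₁ • 𝒟 B₁ + p • N₁ • 𝒟 R₁ := by
        rw [map_add, map_add, map_nsmul, smul_add, smul_add, smul_comm N₁ p]
    _ = B + (Y + N₁ • 𝒟 (N₁ • P - B₁ - p • R₁)) + p • N₁ • 𝒟 R₁ := by rw [← hBY]; abel

/-! ## §2 (GEN₀) -/

omit hUf in
/-- **(GEN₀).** For `P ∈ E(ℚ_p)` there are `u ∈ ℤ` and `R ∈ E(ℚ_p)` with `((p−1)N₁²)•P = u•(e QΩ) + p•R`: `N₁•P ∈ E₁(ℚ_p)` has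
`Λ(N₁•P) = pμ` with `μ ∈ ℤ_p` (`Λ(E₁(ℚ_p)) ⊆ pℤ_p`), `μ ≡ u (mod p²)` for an integer `u`, and `p³ℤ_p ⊆ Λ(p·E₁(ℚ_p))`
(tree `exists_mem_kernel_ptLogΩ_eq`), `Λ(QΩ) = p`, `Λ` injective on the torsion-free `L(1) ∩ E₁`.
[cite: Sprung2012, Thm. 2.2 (p. 1487) ("F_ss(𝔪_{−1}) is generated by c_{−1}")] [cite: Kobayashi2003, Prop. 8.7] -/
theorem descent_generation_zero [W.IsElliptic] (hp2 : p ≠ 2) (hU : ∀ n, localSubgroupOfEmb (U n) ι = stab p (n + 1))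
    (hΔ : IsUnit M.Δ) (hA : M.hasseCoeff p ∈ IsLocalRing.maximalIdeal ℤ_[p])
    (hWM : M.baseChange (AlgebraicClosure ℚ_[p]) = W.baseChange (AlgebraicClosure ℚ_[p]))
    (hV : genFibΩ p M = W.baseChange (AlgebraicClosure ℚ_[p]))
    {QΩ : (genFibΩ p M).toAffine.Point} (hQL : QΩ ∈ subfieldPoints (genFibΩ p M) (layer p 0).toSubfield coeffs_mem_layer)
    (hQk : QΩ ∈ kernel (Valued.v (R := PadicAlgCl p)) (genFibΩ p M)) (hQΛ : ptLogΩ p M QΩ = (p : PadicAlgCl p))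
    {N₁ : ℕ} (hN₁ : N₁ = Nat.card (M.map PadicInt.toZMod).toAffine.Point)
    {P : localPoints W ℚ_[p]} (hP : P ∈ localLayerPointsOfEmb κ ι W 0) :
    ∃ u : ℤ, ∃ R ∈ localLayerPointsOfEmb κ ι W 0, ((p - 1) * N₁ * N₁) • P = u • toLoc hV QΩ + p • R := by
  haveI := isIntegral_curveK p (LayerField p 1) M
  haveI := isIntegral_curveK p (LayerField p 0) M
  set e := toLoc hV with he
  have htorsΩ := torsionFree_layer_of_stab ι W U hp2 hΔ hA hWM hU
  have hLay0 : ∀ X : localPoints W ℚ_[p], X ∈ localLayerPointsOfEmb κ ι W 0 ↔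
      e.symm X ∈ subfieldPoints (genFibΩ p M) (layer p 0).toSubfield coeffs_mem_layer := fun X ↦ by
    rw [mem_localLayerPointsOfEmb_zero_iff, ← mem_localFixedPointsOfEmb_top_iff ι W,
      mem_localFixedPointsOfEmb_top_iff_mem_subfieldPoints ι hV]
  have hp0 : (0 : ℝ) < p := by exact_mod_cast hp.out.pos
  have hp3 : (3 : ℝ) ≤ p := by
    have := hp.out.two_le; exact_mod_cast (by omega : 3 ≤ p)
  -- `X = N₁•P` on the `E_Ω`-side: in `L(0) ∩ E₁`
  set QP := e.symm P with hQP
  have hQPL : QP ∈ subfieldPoints (genFibΩ p M) (layer p 0).toSubfield coeffs_mem_layer := (hLay0 P).mp hP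
  have hXL : N₁ • QP ∈ subfieldPoints (genFibΩ p M) (layer p 0).toSubfield coeffs_mem_layer := (subfieldPoints _ _ _).nsmul_mem hQPL _
  have hXk : N₁ • QP ∈ kernel (Valued.v (R := PadicAlgCl p)) (genFibΩ p M) := by
    rw [hN₁]; exact card_smul_mem_kernel_of_mem_subfieldPoints M hQPL
  -- `Λ(X) ∈ ℚ_p` with `‖Λ(X)‖ ≤ p⁻¹`
  have hz1 : ‖(N₁ • QP).zCoord‖ < 1 := norm_zCoord_lt_one_of_mem_kernel hXk
  obtain ⟨q, hq⟩ : ∃ q : ℚ_[p], algebraMap ℚ_[p] (PadicAlgCl p) q = (N₁ • QP).zCoord := by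
    have h := zCoord_mem_layer hXL
    rw [PadicCyclotomicTower.layer_zero, IntermediateField.mem_bot] at h
    exact h
  have hqn : ‖q‖ ≤ (p : ℝ)⁻¹ := by
    have h1 : ‖q‖ < 1 := by rw [← norm_algebraMap' (PadicAlgCl p) q, hq]; exact hz1
    have := (Padic.norm_lt_pow_iff_norm_le_pow_sub_one q 0).mp (by simpa using h1)
    simpa using this
  have hzhalf : ‖(N₁ • QP).zCoord‖ < 1 / 2 := by
    rw [← hq, norm_algebraMap']
    refine lt_of_le_of_lt hqn ?_
    rw [inv_lt_comm₀ hp0 (by norm_num)]; linarith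
  have hΛmem : ptLogΩ p M (N₁ • QP) ∈ layer p 0 := ptLogΩ_mem_layer hXL hXk
  obtain ⟨ℓ, hℓ⟩ : ∃ ℓ : ℚ_[p], algebraMap ℚ_[p] (PadicAlgCl p) ℓ = ptLogΩ p M (N₁ • QP) := by
    rw [PadicCyclotomicTower.layer_zero, IntermediateField.mem_bot] at hΛmem; exact hΛmem
  have hℓn : ‖ℓ‖ ≤ (p : ℝ)⁻¹ := by
    rw [← norm_algebraMap' (PadicAlgCl p) ℓ, hℓ, norm_ptLogΩ_eq_of_lt_half hXL hXk hzhalf, ← hq, norm_algebraMap']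
    exact hqn
  -- `ℓ = p μ`, `μ ∈ ℤ_p`, `μ = u + p² ν`
  have hpq : (p : ℚ_[p]) ≠ 0 := by exact_mod_cast hp.out.ne_zero
  have hμn : ‖ℓ / p‖ ≤ 1 := by
    rw [norm_div, Padic.norm_p, div_le_iff₀ (inv_pos.mpr hp0), one_mul]; exact hℓn
  set μ : ℤ_[p] := ⟨ℓ / p, hμn⟩ with hμ
  obtain ⟨ν, hν⟩ : ∃ ν : ℤ_[p], μ - (μ.appr 2 : ℕ) = (p : ℤ_[p]) ^ 2 * ν :=
    Ideal.mem_span_singleton'.mp (PadicInt.appr_spec 2 μ) |>.imp fun ν h ↦ by rw [← h, mul_comm]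
  have hℓeq : ℓ = (p : ℚ_[p]) * ((μ.appr 2 : ℕ) : ℚ_[p]) + (p : ℚ_[p]) ^ 3 * (ν : ℚ_[p]) := by
    have hμq : ((μ : ℤ_[p]) : ℚ_[p]) = ℓ / p := rfl
    have := congrArg (fun t : ℤ_[p] ↦ (t : ℚ_[p])) hν
    push_cast at this
    rw [hμq] at this
    field_simp at this
    linear_combination this
  -- a point `RΩ ∈ L(0) ∩ E₁` with `Λ(RΩ) = p² ν`
  set z : PadicAlgCl p := algebraMap ℚ_[p] (PadicAlgCl p) ((p : ℚ_[p]) ^ 2 * (ν : ℚ_[p])) with hzdef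
  have hzL : z ∈ layer p 0 := (layer p 0).algebraMap_mem _
  have hz4 : ‖z‖ ≤ 1 / 4 := by
    rw [hzdef, norm_algebraMap', norm_mul, norm_pow, Padic.norm_p]
    calc (p : ℝ)⁻¹ ^ 2 * ‖(ν : ℚ_[p])‖ ≤ (3 : ℝ)⁻¹ ^ 2 * 1 := by
          gcongr
          · exact PadicInt.norm_le_one ν
      _ ≤ 1 / 4 := by norm_num
  obtain ⟨RΩ, hRL, hRk, hRΛ⟩ := exists_mem_kernel_ptLogΩ_eq (M := M) hzL hz4
  -- `X − u•QΩ = p•RΩ` by comparing logarithms in the torsion-free `L(1) ∩ E₁`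
  set u : ℤ := ((μ.appr 2 : ℕ) : ℤ) with hu
  have hL1 := fun {Q : (genFibΩ p M).toAffine.Point}
      (h : Q ∈ subfieldPoints (genFibΩ p M) (layer p 0).toSubfield coeffs_mem_layer) ↦ subfieldPoints_layer_mono (Nat.zero_le 1) h
  have heq : N₁ • QP - u • QΩ = p • RΩ := by
    refine eq_of_ptLogΩ_eq (m := 1) (htorsΩ 1 le_rfl) (hL1 ((subfieldPoints _ _ _).sub_mem hXL ((subfieldPoints _ _ _).zsmul_mem hQL u)))
      (hL1 ((subfieldPoints _ _ _).nsmul_mem hRL p))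
      ((kernel _ _).sub_mem hXk ((kernel _ _).zsmul_mem hQk u)) ((kernel _ _).nsmul_mem hRk p) ?_
    rw [ptLogΩ_sub (m := 0) hXL ((subfieldPoints _ _ _).zsmul_mem hQL u) hXk ((kernel _ _).zsmul_mem hQk u),
      ptLogΩ_zsmul (m := 0) hQL hQk, ptLogΩ_nsmul (m := 0) hRL hRk, hQΛ, hRΛ, ← hℓ, hℓeq, hzdef, hu]
    simp only [map_add, map_mul, map_pow, map_natCast, Int.cast_natCast]
    rw [show algebraMap ℚ_[p] (PadicAlgCl p) (ν : ℚ_[p]) = algebraMap ℚ_[p] (PadicAlgCl p) (ν : ℚ_[p]) from rfl]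
    ring
  -- transport and rescale
  have hR0 : e RΩ ∈ localLayerPointsOfEmb κ ι W 0 := by rw [hLay0, AddEquiv.symm_apply_apply]; exact hRL
  have hNP : N₁ • P = u • e QΩ + p • e RΩ := by
    have := congrArg e heq
    rw [map_sub, map_nsmul, map_zsmul, hQP, AddEquiv.apply_symm_apply, map_nsmul] at this
    rw [← this]; abel
  refine ⟨(((p - 1) * N₁ : ℕ) : ℤ) * u, ((p - 1) * N₁) • e RΩ, AddSubgroup.nsmul_mem _ hR0 _, ?_⟩
  rw [mul_smul, hNP, smul_add, mul_zsmul, smul_comm ((p - 1) * N₁) p]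
  simp only [natCast_zsmul]

end SprungHonda

end Literature.NumberTheory.EllipticCurves.Sprung2012.Honda

end Part8

/-!
## Part 9 — port of `Summits/BirchSwinnertonDyer/BirchSwinnertonDyer/Theorems/PrintX8VSInputHondaSystemPadicModel.lean` (4 declarations kept)

# The `ℤ_p`-model of a globally minimal curve at a good SUPERSINGULAR prime `p ∣ a_p` (any `a_p`, not only `a_p = 0`):
# elliptic fibres, `tr(M mod p) = a_p`, unit discriminant, Hasse coefficient in `pℤ_p`, and `‖a_p‖_p ≤ p⁻¹`
#

(Port of the declarations listed in the Part header; the source module's docstring — cell bookkeeping of the BSD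
printed-inputs programme — is abridged to its title here.)
-/

section Part9

open scoped _root_.Classical

namespace Literature.NumberTheory.EllipticCurves.Sprung2012.Honda

namespace SprungHonda

open _root_.WeierstrassCurve Literature.NumberTheory.EllipticCurves Literature.NumberTheory.EllipticCurves.Sprung2012.Honda

variable {p : ℕ} [hp : Fact p.Prime]

/-- **`A_p(M) ∈ pℤ_p` when `p ∣ tr(M mod p)`** (`p` odd): the Hasse coefficient of `M mod p` is the image of `tr` in `𝔽_p`.
[cite: SilvermanAEC2009, Thm. V.4.1(a)] -/
theorem hasseCoeff_mem_maximalIdeal_of_dvd_tr (hp2 : p ≠ 2) (M : WeierstrassCurve ℤ_[p]) [(M.map PadicInt.toZMod).IsElliptic]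
    (htr : (p : ℤ) ∣ Literature.NumberTheory.EllipticCurves.HasseManin.tr (M.map PadicInt.toZMod)) :
    M.hasseCoeff p ∈ IsLocalRing.maximalIdeal ℤ_[p] := by
  have h2 : ringChar (ZMod p) ≠ 2 := by rwa [ZMod.ringChar_zmod_n]
  have key := (M.map PadicInt.toZMod).cast_card_add_one_sub_natCard_point h2
  have htr' : ((((Fintype.card (ZMod p) : ℤ) + 1 - Nat.card (M.map PadicInt.toZMod).toAffine.Point : ℤ) : ℤ) : ZMod p) = 0 :=
    (ZMod.intCast_zmod_eq_zero_iff_dvd _ p).mpr htr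
  rw [htr', ZMod.card] at key
  have hA : (M.map PadicInt.toZMod).hasseCoeff p = 0 := by rw [hasseCoeff]; exact key.symm
  rw [map_hasseCoeff] at hA
  rw [← PadicInt.ker_toZMod, RingHom.mem_ker]
  exact hA

/-- **The supersingular `ℤ_p`-model with arbitrary `a_p`.** For `V/ℚ` elliptic, globally minimal, with good reduction at the odd
prime `p` and `p ∣ a_p(V)`: the model `M = integralModelInt V ⊗ ℤ_p` has elliptic generic and special fibres, `tr(M mod p) = a_p(V)`,
unit discriminant, Hasse coefficient in `pℤ_p`, and `M ⊗ ℚ̄_p = V ⊗ ℚ̄_p`. [cite: Sprung2012, §2 (p. 1486)] [cite: SilvermanAEC2009, VII.2] -/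
theorem exists_padicModel_of_dvd_frobeniusTrace (hp2 : p ≠ 2) (V : WeierstrassCurve ℚ) [V.IsElliptic] [V.IsGloballyMinimal]
    (hgood : V.HasGoodReductionAtPrime p) (hap : (p : ℤ) ∣ V.frobeniusTrace p) :
    ∃ M : WeierstrassCurve ℤ_[p], (M.map PadicInt.Coe.ringHom).IsElliptic ∧ (M.map PadicInt.toZMod).IsElliptic ∧
      Literature.NumberTheory.EllipticCurves.HasseManin.tr (M.map PadicInt.toZMod) = V.frobeniusTrace p ∧
      IsUnit M.Δ ∧ M.hasseCoeff p ∈ IsLocalRing.maximalIdeal ℤ_[p] ∧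
      M.baseChange (AlgebraicClosure ℚ_[p]) = V.baseChange (AlgebraicClosure ℚ_[p]) := by
  have hΔ : ¬ (p : ℤ) ∣ minimalDiscriminantInt V :=
    not_dvd_minimalDiscriminantInt_of_hasGoodReductionAtPrime' V p hgood
  set M : WeierstrassCurve ℤ_[p] := (integralModelInt V).map (Int.castRingHom ℤ_[p]) with hM
  have hmodp : M.map PadicInt.toZMod = (integralModelInt V).map (Int.castRingHom (ZMod p)) := by
    rw [hM, WeierstrassCurve.map_map]
    exact congrArg (fun φ : ℤ →+* ZMod p ↦ (integralModelInt V).map φ) (RingHom.ext_int _ _)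
  have hgen : M.map PadicInt.Coe.ringHom = (integralModelInt V).map (Int.castRingHom ℚ_[p]) := by
    rw [hM, WeierstrassCurve.map_map]
    exact congrArg (fun φ : ℤ →+* ℚ_[p] ↦ (integralModelInt V).map φ) (RingHom.ext_int _ _)
  haveI hEt' : ((integralModelInt V).map (Int.castRingHom (ZMod p))).IsElliptic := by
    refine ⟨isUnit_iff_ne_zero.mpr ?_⟩
    rw [map_Δ, eq_intCast]
    change ((minimalDiscriminantInt V : ℤ) : ZMod p) ≠ 0
    rwa [Ne, ZMod.intCast_zmod_eq_zero_iff_dvd]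
  haveI hEt : (M.map PadicInt.toZMod).IsElliptic := by rw [hmodp]; infer_instance
  have htr : Literature.NumberTheory.EllipticCurves.HasseManin.tr (M.map PadicInt.toZMod) = V.frobeniusTrace p := by
    have e : Literature.NumberTheory.EllipticCurves.HasseManin.tr (M.map PadicInt.toZMod) =
        Literature.NumberTheory.EllipticCurves.HasseManin.tr ((integralModelInt V).map (Int.castRingHom (ZMod p))) := by
      rw [hmodp]
    rw [e]
    exact tr_eq_frobeniusTrace V rfl
  refine ⟨M, ?_, hEt, htr, ?_, ?_, ?_⟩
  · rw [hgen]
    refine ⟨isUnit_iff_ne_zero.mpr ?_⟩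
    rw [map_Δ, eq_intCast]
    change ((minimalDiscriminantInt V : ℤ) : ℚ_[p]) ≠ 0
    exact_mod_cast minimalDiscriminantInt_ne_zero V
  · rw [hM, map_Δ, eq_intCast]
    exact Literature.NumberTheory.LFunctions.Wooley.isUnit_intCast_of_not_dvd hΔ
  · exact hasseCoeff_mem_maximalIdeal_of_dvd_tr hp2 M (htr ▸ hap)
  · conv_rhs => rw [← map_integralModelInt V]
    rw [hM, WeierstrassCurve.baseChange, WeierstrassCurve.baseChange, WeierstrassCurve.map_map,
      WeierstrassCurve.map_map]
    congr 1

/-- **`‖a_p‖_p ≤ p⁻¹`** for an integer `a_p` divisible by `p` (the supersingular growth hypothesis of the Sprung sequence, file 1).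
[cite: Sprung2012, §2 (p. 1486)] -/
theorem norm_intCast_le_inv_of_dvd {a : ℤ} (ha : (p : ℤ) ∣ a) : ‖((a : ℤ) : ℚ_[p])‖ ≤ (p : ℝ)⁻¹ := by
  obtain ⟨b, rfl⟩ := ha
  rw [Int.cast_mul, Int.cast_natCast, norm_mul, Padic.norm_p]
  calc (p : ℝ)⁻¹ * ‖(b : ℚ_[p])‖ ≤ (p : ℝ)⁻¹ * 1 :=
        mul_le_mul_of_nonneg_left (Padic.norm_int_le_one b) (by positivity)
    _ = (p : ℝ)⁻¹ := mul_one _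

/-- For an odd prime `p` and `p ∣ a`: `a ≠ 2` and `a − 2` is a `p`-adic unit (`a − 2 ≡ −2 (mod p)`) — used to read off
`z(c_{−1})` from `z(c_0) = (a_p − 2)·z(c_{−1})` in the generation clauses. [cite: Sprung2012, §2 (p. 1486)] -/
theorem intCast_sub_two_isUnit_of_dvd (hp2 : p ≠ 2) {a : ℤ} (ha : (p : ℤ) ∣ a) :
    a - 2 ≠ 0 ∧ IsUnit (((a - 2 : ℤ) : ℤ_[p])) := by
  have hp2' : ¬ (p : ℤ) ∣ 2 := by
    intro h
    have h2 : (p : ℤ) ≤ 2 := Int.le_of_dvd two_pos h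
    have := hp.out.two_le
    omega
  have hnd : ¬ (p : ℤ) ∣ a - 2 := by
    intro h
    exact hp2' (by simpa using (Int.dvd_sub h ha).neg_right)
  refine ⟨fun h0 ↦ hnd (h0 ▸ dvd_zero _), ?_⟩
  rw [PadicInt.isUnit_iff]
  by_contra hne
  have hlt : ‖((a - 2 : ℤ) : ℤ_[p])‖ < 1 := lt_of_le_of_ne (PadicInt.norm_le_one _) hne
  exact hnd ((PadicInt.norm_int_lt_one_iff_dvd _).mp hlt)

end SprungHonda

end Literature.NumberTheory.EllipticCurves.Sprung2012.Honda

end Part9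

/-!
## Part 10 — port of `Summits/BirchSwinnertonDyer/BirchSwinnertonDyer/Theorems/PrintX8VSInputHondaSystemPrimalPadic.lean` (1 declarations kept)

# The primal Honda data of Sprung's Theorem 2.2 over Mathlib's `ℚ_[p]`, for every embedding `ι : ℚ̄ → ℚ̄_p`

(Port of the declarations listed in the Part header; the source module's docstring — cell bookkeeping of the BSD
printed-inputs programme — is abridged to its title here.)
-/

section Part10

open scoped _root_.Classical
open _root_.Finset _root_.PowerSeries

namespace Literature.NumberTheory.EllipticCurves.Sprung2012.Honda

namespace SprungHonda

open Literature.NumberTheory.EllipticCurves Literature.NumberTheory.GaloisRepresentations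
  Literature.NumberTheory.EllipticCurves.ZpExtension Literature.NumberTheory.EllipticCurves.Kobayashi2003
  Literature.NumberTheory.EllipticCurves.Sprung2012.Honda Literature.NumberTheory.EllipticCurves.Sprung2012.Honda.PadicCyclotomicTower
  Literature.NumberTheory.EllipticCurves.Sprung2012.Honda.BallEval
open Literature.NumberTheory.EllipticCurves.FormalGroupChart (kernel)
open Literature.RingTheory.FormalGroups (hondaShift)

variable {p : ℕ} [hp : Fact p.Prime]

/-- **The primal Honda data of Sprung's Thm. 2.2 over `ℚ_[p]`, for every embedding `ι`.**
[cite: Sprung2012, Thm. 2.2 (p. 1487) and Cor. 2.10 (p. 1489)] [cite: Kobayashi2003, Prop. 8.12 and Lemma 8.9] -/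
theorem exists_primalHonda_padic (W : WeierstrassCurve ℚ) [W.IsElliptic] [W.IsGloballyMinimal] (hp2 : p ≠ 2)
    (hgood : W.HasGoodReductionAtPrime p) (hap : (p : ℤ) ∣ W.frobeniusTrace p) (κ : ZpExtension ℚ p) (hκ : κ.IsCyclotomic)
    (ι : AlgebraicClosure ℚ →ₐ[ℚ] AlgebraicClosure ℚ_[p]) :
    ∃ (cneg : localPoints W ℚ_[p]) (c : ℕ → localPoints W ℚ_[p]) (N : ℕ), N.Coprime p ∧
      cneg ∈ localLayerPointsOfEmb κ ι W 0 ∧ (∀ n, c n ∈ localLayerPointsOfEmb κ ι W n) ∧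
      c 0 = (W.frobeniusTrace p - 2) • cneg ∧
      localTraceOfEmb κ ι W 0 1 (c 1) = W.frobeniusTrace p • c 0 - ((p : ℤ) - 1) • cneg ∧
      (∀ n : ℕ, 1 ≤ n → localTraceOfEmb κ ι W n (n + 1) (c (n + 1)) = W.frobeniusTrace p • c n - c (n - 1)) ∧
      (∀ m : ℕ, 1 ≤ m → ∀ P ∈ localLayerPointsOfEmb κ ι W m,
        ∃ B ∈ AddSubgroup.closure (Set.range fun σ : Field.absoluteGaloisGroup ℚ_[p] ↦ σ • c m),
          ∃ P' ∈ localLayerPointsOfEmb κ ι W (m - 1), ∃ R ∈ localLayerPointsOfEmb κ ι W m, N • P = B + P' + p • R) ∧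
      (∀ P ∈ localLayerPointsOfEmb κ ι W 0, ∃ u : ℤ, ∃ R ∈ localLayerPointsOfEmb κ ι W 0, N • P = u • cneg + p • R) := by
  set a : ℤ := W.frobeniusTrace p with ha_def
  -- the `p`-adic model
  obtain ⟨M, hE, hEt, htr, hΔ, hA, hWM⟩ := exists_padicModel_of_dvd_frobeniusTrace hp2 W hgood hap
  haveI := hE
  haveI := hEt
  haveI hintΩ : (genFibΩ p M).IsIntegral (Valued.v (R := PadicAlgCl p)).integer := isIntegral_genFib_baseChange p M
  have hV : genFibΩ p M = W.baseChange (AlgebraicClosure ℚ_[p]) := (genFibΩ_eq_baseChange M).trans hWM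
  -- Kobayashi's tower through `F = ℚ(ζ_p)`
  haveI : NeZero p := ⟨hp.out.ne_zero⟩
  haveI := Literature.NumberTheory.NumberFields.isCyclotomicExtension_cyclotomicField_rat p
  haveI := normal_galRange_cyclotomic p (CyclotomicField p ℚ)
  let U : ℕ → Subgroup (Field.absoluteGaloisGroup ℚ) := towerSubgroup κ (CyclotomicField p ℚ)
  haveI hUf : ∀ n, (U n).FiniteIndex := fun n ↦ inferInstanceAs (towerSubgroup κ (CyclotomicField p ℚ) n).FiniteIndex
  haveI hUN : ∀ n, (U n).Normal := fun n ↦ inferInstanceAs (towerSubgroup κ (CyclotomicField p ℚ) n).Normal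
  have hU : ∀ n, localSubgroupOfEmb (U n) ι = stab p (n + 1) := fun n ↦
    localSubgroupOfEmb_towerSubgroup_eq_stab_rat (F := CyclotomicField p ℚ) (ι := ι) κ hp2 hκ n
  have hUL : ∀ n, U n ≤ κ.layerSubgroup n := fun n ↦ inf_le_left
  have hUa : Antitone U := towerSubgroup_antitone κ (CyclotomicField p ℚ)
  -- the Sprung sequence `x 0 = 1`, `p x 1 = a`, `p x (k+2) = a x (k+1) − x k`
  have hpq : (p : ℚ_[p]) ≠ 0 := by exact_mod_cast hp.out.ne_zero
  let xs : ℕ → ℚ_[p] × ℚ_[p] := fun k ↦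
    Nat.rec ((1 : ℚ_[p]), ((a : ℚ_[p]) / p)) (fun _ q ↦ (q.2, ((a : ℚ_[p]) * q.2 - q.1) / p)) k
  let x : ℕ → ℚ_[p] := fun k ↦ (xs k).1
  have hx0 : x 0 = 1 := rfl
  have hx1 : (p : ℚ_[p]) * x 1 = a := by
    show (p : ℚ_[p]) * ((a : ℚ_[p]) / p) = a
    field_simp
  have hrec : ∀ k, (p : ℚ_[p]) * x (k + 2) = a * x (k + 1) - x k := by
    intro k
    show (p : ℚ_[p]) * (((a : ℚ_[p]) * (xs k).2 - (xs k).1) / p) = a * (xs k).2 - (xs k).1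
    field_simp
  have ha : ‖((a : ℤ) : ℚ_[p])‖ ≤ (p : ℝ)⁻¹ := norm_intCast_le_inv_of_dvd hap
  have hxb : ∀ k, ‖x k‖ ≤ Real.sqrt p ^ k := norm_sprungSeq_le ha hx0 hx1 hrec
  -- the logarithm of `F_ss` and the integral Honda isomorphism
  have htr' : (Literature.NumberTheory.EllipticCurves.HasseManin.tr (M.map PadicInt.toZMod) : ℚ_[p]) = (a : ℚ_[p]) := by
    rw [htr]
  have hℓ : ∀ n, ‖coeff n (hondaShift p (Literature.NumberTheory.EllipticCurves.HasseManin.tr (M.map PadicInt.toZMod) : ℚ_[p])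
      (PowerSeries.mk fun d ↦ ∑' k : ℕ, x k * (((p ^ k).choose d : ℚ_[p]) - if d = 0 then 1 else 0)))‖ ≤ 1 := fun n ↦ by
    rw [htr']; exact norm_coeff_hondaShift_sprungLog_le_one ha hx0 hx1 hrec n
  obtain ⟨i, j, hi0, hj0, hij, -, hlog⟩ :=
    exists_integral_hondaIso M hp2 (constantCoeff_sprungLog x) (norm_coeff_one_sprungLog hx0 hxb) hℓ
  -- the tower points over `ℚ_p(ζ_{p^m})`
  obtain ⟨cΩ, hc0, hcL, hck, hcΛ⟩ := exists_sprungTowerPoints (M := M) hxb hi0 hlog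
  -- the transported action and the dictionary
  set e := toLoc hV with he
  set act : Field.absoluteGaloisGroup ℚ_[p] → (genFibΩ p M).toAffine.Point → (genFibΩ p M).toAffine.Point :=
    fun σ Q ↦ e.symm (σ • e Q) with hact_def
  have hact0 : ∀ σ, act σ 0 = 0 := fun σ ↦ act_zero hV σ
  have hact : ∀ σ (x y : PadicAlgCl p) (h : (genFibΩ p M).toAffine.Nonsingular x y),
      ∃ h', act σ (WeierstrassCurve.Affine.Point.some x y h) = WeierstrassCurve.Affine.Point.some (σ • x) (σ • y) h' :=
    fun σ x y h ↦ act_some hV σ x y h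
  have hFix : ∀ k (P : localPoints W ℚ_[p]), P ∈ localFixedPointsOfEmb ι W (U k) ↔
      e.symm P ∈ subfieldPoints (genFibΩ p M) (layer p (k + 1)).toSubfield coeffs_mem_layer :=
    fun k P ↦ mem_localFixedPointsOfEmb_iff_mem_subfieldPoints ι hV hU k P
  -- finiteness of the Galois quotients
  haveI hFt : ∀ m, Fintype (stab p m ⧸ (stab p (m + 1)).subgroupOf (stab p m)) := fun m ↦ by
    haveI : ((stab p (m + 1)).subgroupOf (stab p m)).FiniteIndex := by
      refine ⟨?_⟩
      rw [index_subgroupOf_stab_succ]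
      split_ifs
      · have := hp.out.two_le; omega
      · exact hp.out.ne_zero
    exact Fintype.ofFinite _
  -- no `p`-power torsion in the layers
  have htorsΩ := torsionFree_layer_of_stab ι W U hp2 hΔ hA hWM hU
  -- the error term `QΩ = −∑_{Γ/Stab(ζ_1)} q̃ ⋆ cΩ 1`, `Λ(QΩ) = p`
  set S₁ := ∑ q : stab p 0 ⧸ (stab p 1).subgroupOf (stab p 0),
    act ((q.out : stab p 0) : Field.absoluteGaloisGroup ℚ_[p]) (cΩ 1) with hS₁
  have hS₁L : S₁ ∈ subfieldPoints (genFibΩ p M) (layer p 0).toSubfield coeffs_mem_layer :=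
    sum_act_one_mem_sprung hx0 act hact0 hact hcL hck hcΛ (htorsΩ 1 le_rfl)
  have hS₁k : S₁ ∈ kernel (Valued.v (R := PadicAlgCl p)) (genFibΩ p M) :=
    (kernel _ _).sum_mem fun q _ ↦ act_mem_kernel act hact0 hact _ (hck 1)
  set QΩ := -S₁ with hQΩ
  have hQL : QΩ ∈ subfieldPoints (genFibΩ p M) (layer p 0).toSubfield coeffs_mem_layer := (subfieldPoints _ _ _).neg_mem hS₁L
  have hQk : QΩ ∈ kernel (Valued.v (R := PadicAlgCl p)) (genFibΩ p M) := (kernel _ _).neg_mem hS₁k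
  have hQΛ : ptLogΩ p M QΩ = (p : PadicAlgCl p) := ptLogΩ_neg_sum_act_one_sprung act hx0 hact0 hact hcL hck hcΛ
  -- the relations over `ℚ_p(ζ_{p^m})` as equalities
  have hrelΩ : ∀ m : ℕ, 1 ≤ m → (∑ q : stab p m ⧸ (stab p (m + 1)).subgroupOf (stab p m),
      act ((q.out : stab p m) : Field.absoluteGaloisGroup ℚ_[p]) (cΩ (m + 1))) = a • cΩ m - cΩ (m - 1) - QΩ := by
    intro m hm
    have h := sum_act_sub_smul_add_eq_sum_act_one_sprung act hx0 hx1 hrec hact0 hact hcL hck hcΛ htorsΩ hm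
    rw [← hS₁] at h
    rw [hQΩ, sub_neg_eq_add, ← h]
    abel
  -- transport to `E(ℚ̄_p)`
  have hQ0 : e QΩ ∈ localLayerPointsOfEmb κ ι W 0 := by
    rw [mem_localLayerPointsOfEmb_zero_iff]
    exact (mem_localFixedPointsOfEmb_top_iff ι W _).mp
      ((mem_localFixedPointsOfEmb_top_iff_mem_subfieldPoints ι hV _).mpr (by simpa [he] using hQL))
  have hyU : ∀ m, e (cΩ (m + 1)) ∈ localFixedPointsOfEmb ι W (U m) := fun m ↦ by
    rw [hFix, AddEquiv.symm_apply_apply]; exact hcL (m + 1)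
  have hy0 : e (cΩ 0) = 0 := by rw [hc0, map_zero]
  have hrel0 : localPairTraceOfEmb ι W (κ.layerSubgroup 0) (U 0) (e (cΩ 1)) = -e QΩ := by
    have h₁ : localSubgroupOfEmb (⊤ : Subgroup (Field.absoluteGaloisGroup ℚ)) ι = stab p 0 := by
      rw [stab_zero]; exact Subgroup.comap_top _
    rw [layerSubgroup_zero, localPairTraceOfEmb_toLoc_eq_sum ι W hV h₁ (hU 0) (hcL 1), hQΩ, map_neg, neg_neg]
  have hrel : ∀ m : ℕ, 1 ≤ m → localPairTraceOfEmb ι W (U (m - 1)) (U m) (e (cΩ (m + 1))) =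
      a • e (cΩ m) - e (cΩ (m - 1)) - e QΩ := by
    intro m hm
    obtain ⟨k, rfl⟩ := Nat.exists_eq_add_of_le' hm
    rw [Nat.add_sub_cancel, localPairTraceOfEmb_toLoc_eq_sum ι W hV (hU k) (hU (k + 1)) (hcL (k + 2)),
      show (∑ q : stab p (k + 1) ⧸ (stab p (k + 2)).subgroupOf (stab p (k + 1)),
        e.symm (((q.out : stab p (k + 1)) : Field.absoluteGaloisGroup ℚ_[p]) • e (cΩ (k + 2)))) =
        a • cΩ (k + 1) - cΩ k - QΩ by simpa using hrelΩ (k + 1) (Nat.succ_pos k),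
      map_sub, map_sub, map_zsmul]
  -- `N₁ = #Ẽ(𝔽_p) = p + 1 − a`
  set N₁ : ℕ := Nat.card (M.map PadicInt.toZMod).toAffine.Point with hN₁
  have hN₁' : (N₁ : ℤ) = p + 1 - a := by
    have h := htr
    rw [Literature.NumberTheory.EllipticCurves.HasseManin.tr, ZMod.card] at h
    rw [hN₁]
    linarith
  -- the descended points
  set c : ℕ → localPoints W ℚ_[p] := fun n ↦
    (N₁ : ℤ) • localPairTraceOfEmb ι W (κ.layerSubgroup n) (U n) (e (cΩ (n + 1))) + ((p : ℤ) - 1) • e QΩ with hc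
  obtain ⟨hR0, hR1, hRn⟩ := descent_relations κ ι W U hp2 hκ hUa hUL hU hN₁' (y := fun m ↦ e (cΩ m)) hy0 hyU hQ0 hrel0 hrel c
    (fun n ↦ rfl)
  have hcop : ((p - 1) * N₁ * N₁).Coprime p := by
    have h1 : (p - 1).Coprime p := (Nat.coprime_self_sub_left hp.out.one_lt.le).mpr (Nat.coprime_one_left p)
    have h2 : N₁.Coprime p := by
      obtain ⟨t, ht⟩ := hap
      rw [← Nat.isCoprime_iff_coprime]
      refine ⟨1, t - 1, ?_⟩
      rw [hN₁', ht]
      ring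
    exact Nat.Coprime.mul_left (Nat.Coprime.mul_left h1 h2) h2
  refine ⟨e QΩ, c, (p - 1) * N₁ * N₁, hcop, hQ0, fun n ↦ descent_mem_layer κ ι W U (y := fun m ↦ e (cΩ m)) hyU hQ0 n,
    hR0, hR1, hRn, ?_, ?_⟩
  · intro m hm P hP
    exact descent_generation κ ι W U hp2 hκ hUL hU hΔ hA hWM hV hx0 hxb hi0 hj0 hij hlog hcL hck hcΛ hQL rfl c
      (fun n ↦ rfl) hm hP
  · intro P hP
    exact descent_generation_zero κ ι W U hp2 hU hΔ hA hWM hV hQL hQk hQΛ rfl hP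

end SprungHonda

end Literature.NumberTheory.EllipticCurves.Sprung2012.Honda

end Part10

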